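/-
Copyright: cell `langlands-arthur-audit` (papers/Langlands/langlands-arthur-audit), unit `pub-arthur-down-g42`
(downstream tracer, gen 42).  Thirty-second file of the downstream register (module M227 of the cell's MODULE-MAP, CLAIMed in `lean/MODULE-MAP2.md`
2026-08-23T03:18:50Z; M224 / M226 are the TYPER line's `Leaves/Sp4TopUnipotent.lean` / `Leaves/Sp4TopJordan.lean`, M225 is `DownstreamSupport13.lean`):
`Downstream.lean` (tranches 1–4) … `Downstream31.lean` (104–106, module M223, at 93 % of the gate's 200 000-byte file cap after v4) are full or kept for small
appends, so the register continues here, APPEND-ONLY in the same conventions and the same namespace `…Arthur2013.Downstream`; v1 imports `…Downstream31` (through it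
`…Downstream30`, `…Downstream25` (tranche 89: row C226's `Consumers89.FMrefined` with `fmRefined_of_inputs` / `fmRefined_conditional_form`, and through it tranche 34's
`Implications34`), … and `…Downstream` (`BookInputs`, `Nodes`)).  v1 = the hundred-and-seventh tranche (`Consumers107`: the two successor nodes recorded by unit
`pub-arthur-down-g41` in `DIVERGENCE2.md` D-DN-g41-9 — a NEW node `FMggpEquiv` on the EXISTING row C226 (M. Furusawa – K. Morimoto, Compositio Math. 160 (2024) 2115–2202 =
arXiv:2205.09503 v2: COROLLARY 1.1, the (SO(5), SO(2)) Gan – Gross – Prasad equivalence for tempered π on G_D ⇐ the row's Theorem 1.2 = `Consumers89.FMrefined`: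
« The equivalence between the conditions (1) and (2) is immediate from » [Theorem 1.2], the local equivalence « is proved by Waldspurger [115] at any non-archimedean place » … « and by Luo [77] » — Arthur-2013-free as printed) and a NEW node `KTrationality` on the EXISTING row C271
(S. Kuga – M. Tsuzuki, *An asymptotic formula of spectral average of central L-values on GSp(2) for square free levels*, arXiv:2410.03166, v2 2025-03-25 ONLY, §7:
COROLLARY 1.4 = Theorem 7.3 with Lemma 7.4 — for every large prime N a cuspidal Π on GL₄ of symplectic type, JPSS-conductor N², regular algebraic, with non-vanishing
twisted central values and [ℚ(Π) : ℚ] ≥ C_p √(log log N) — ⇐ the book BY NAME (Lemma 7.4's proof: every cuspidal σπ of G = PGSp₂ « it belongs to some global A-packet », [1] = the book) ∧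
`FMggpEquiv` (« By [8, Corollary 1.1], we » …, « Thus, by [8, Corollary 1.1] once again, »)); `Implications107`; bookkeeping theorems); v2 (same unit) = the
hundred-and-eighth tranche APPENDED (`Consumers108`, THE MOK-2014 CONDUIT VEIN — appliers of row C191 (C.-P. Mok, Compositio Math. 150 (2014), `Consumers28.MokGSp4` ⇐
the book ∧ row A4) found by the local-graph forward citations of arXiv:1109.5392 after a corpus full-text hit: NEW row C273 H. Hida – J. Tilouine, *Symmetric power
congruence ideals and Selmer groups*, J. Inst. Math. Jussieu 19 (2020) (`HTunitaryU4` = Theorem 1.3 (j = 2) / Cors 3.6–3.7 and `HTstandardGSp4` = Thms 7.1–7.2 ⇐ C191: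
« that the base change from GSp4 to GL4 has also been established [Mok14], so that there is also a »; « The tool this time is the base change from GSp4 (Q) » … « established by C.-P. Mok [Mok14] and [Clo91] »; `HTsymTower` = Theorem 1.6 for n = 5,…,8 ⇐ row C177 `Consumers18.ClozelThorne2`: « This theorem applies for n = 5, 6, 7, 8 by [CT15] »), NEW row C274 A. Jones,
*Modular elliptic curves over the field of twelfth roots of unity*, LMS J. Comput. Math. 19 (2016) (`JonesQzeta12` ⇐ C191: « shall combine the resulting data with our knowledge of the Galois representations constructed in [Mok14] »), NEW row C275 K. Tsaltas –
F. Jarvis, *Descending congruences of theta lifts on GSp4*, J. Number Theory 199 (2019) (hypothesis node `TJlgc` « we will assume full local-global » [compatibility] supplied ⇐ C191: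
« this is a result of Sorensen (see [24]) and Mok (see Theorem 3.1 » [of [19])]; `TJdescent` = Theorem 4.2 ⇐ the node), NEW row C276 H. Wang, *Level lowering for GSp(4) and vanishing cycles on Siegel threefolds*,
arXiv:1910.07569 (PREPRINT; `HWangLevelLowering` = Theorems 1 / 2 ⇐ C191: « the proof of it can be found in [Taylor93], [Laum05], [Weis05], [Sor10] and [Mo14]. »), NEW row C277 M. Broshi – M. Z. Mullath – C. Sorensen – T. Weston,
*Unobstructed deformation problems for GSp(4)*, arXiv:2009.06575 (PREPRINT; `BMSWunobstructed` = Theorem 1.1 with Remark 1.5 ⇐ C191: « [Sor] and [Mok]. » « In [Mok], Mok relaxes this assumption on $\pi$ using Arthur's results. »);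
`Implications108`; bookkeeping theorems; no new import); v3 (same unit) = the hundred-and-ninth tranche APPENDED (`Consumers109`, THE SYMMETRIC-POWER VEIN, I —
appliers of rows C177 `Consumers18.ClozelThorne2` (Clozel – Thorne II, Ann. of Math. 181 (2015): the 5th / 7th symmetric powers) and C29 `Consumers64.ClozelThorneIII`
(part III, Duke Math. J. 166 (2017): Sym⁶ / Sym⁸) found by the local-graph forward citations of the two DOIs: NEW row C278 N. Gillman – M. Kural – A. Pascadi – J. Peng –
A. Sah, Res. Number Theory 6 (2020) (`GKPPSsatoTateGaps` = Theorems 1.1 / 1.2 ⇐ C177 ∧ C29: « Choose $\ell_{\max} = 8$, so that $L(s, \Sym^\ell E)$ is automorphic for all $\ell \le \ell_{\max}$ and for all non-CM elliptic curves $E$ [CT17]. »), NEW row C279 R. J. Lemke Oliver – J. Thorner, IMRN 2019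
(`LOTeffectiveST8` = Theorem 1.8's unconditional case N = 8 over ℚ ⇐ C29 as cited: « or if $I$ can be $\mathrm{Sym}^8$-minorized and $\pi$ is a Hecke newform over $\mathbb{Q}$, then this is unconditional. »), NEW row C280 F. Januszewski, *Non-abelian p-adic Rankin–Selberg
L-functions and non-vanishing of central L-values*, Amer. J. Math. 146 (2024) (`JanuszewskiSymPadicL` = the introduction's symmetric-power application ⇐ C177 ∧ C29:
« imply the existence of $p$-adic meromorphic $L$-functions for symmetric power $L$-functions $L(s,\Sym^n f)$ » … « which is linearly disjoint from $\QQ(e^{2\pi i/35}),$ and $1\leq n\leq 8$, provided that $f$ is of sufficiently large parallel weight. »), NEW row C281 X. Zhang, *Selmer groups of symmetric powers of ordinary modular Galois representations*, Amer. J. Math. 143 (2021)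
(hypothesis node `ZhangSymLayers` « Assume that the Langlands functorialities » … « are established for all $k$ » supplied ⇐ C177 ∧ C29: « for $p>7$, the functorialities » … « are established for all $n\leq9$ and all $k\geq0$. »; `ZhangSelmerTower` = Theorem 4.27 ⇐ the node);
`Implications109`; bookkeeping theorems; no new import); v4 (unit `pub-arthur-down-g43`, gen 43) = the hundred-and-tenth tranche APPENDED (`Consumers110`, THE
NOETHER–LEFSCHETZ / BALL-QUOTIENT VEIN, II — second- and third-order consumers of rows C17-Acta `Consumers4.BMMball` (N. Bergeron – J. Millson – C. Moeglin, Acta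
Math. 216 (2016)) and C99 `Consumers2.BLMM` (N. Bergeron – Z. Li – J. Millson – C. Moeglin, Invent. Math. 208 (2017)), found by the local-graph forward citations of
arXiv:1306.1515 / 1412.3774 / 2108.12404: NEW row C282 M. Stover – D. Toledo, *Residual finiteness for central extensions of lattices in PU(n,1) and negatively curved
projective varieties*, Pure Appl. Math. Q. 18 (2022) (hypothesis node `STcupProduct` = its Theorem 3.3 / Corollary 3.5 supplied ⇐ C17-Acta: « The proof of Theorem (thm:MainRF2) begins by using work of Bergeron, Millson, and Moeglin [Acta] »;
« Taking $q=1$ and the appropriate values of $(a,b)$ in [Acta] »; `STcentralRF` = Theorem 1.2 and `STbranchedCovers` = Proposition 5.1 / Theorem 1.5 ⇐ the node), NEW row C283 C. Llosa Isenrich – P. Py, *Groups with exotic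
finiteness properties from complex Morse theory*, J. Topol. 18 (2025) (`LIPexoticKernels` = Theorem 1.1 ⇐ C282 `STbranchedCovers`: « The first result takes as input a new class of hyperbolic Kähler groups constructed by Stover and Toledo [StoTol-21-II]. » — « relies on deep results on the cohomology of arithmetic groups due to Bergeron, Millson and Moeglin [BeMiMo-16] »), NEW row C284
D. Petersen, *A vanishing result for tautological classes on the moduli of K3 surfaces*, Amer. J. Math. 141 (2019) (`PetersenVanishing` = Theorem 2.2 / Corollary 2.3
⇐ C99: « In this case, $\beta$ is a linear combination of Noether–Lefschetz divisors [bergeronlimillsonmoeglin] »), NEW row C285 R. Laza – K. G. O'Grady, *Birational geometry of the moduli space of quartic K3 surfaces*, Compositio Math. 155 (2019)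
(`LOGpicardRank` = Theorem 3.1.1 ⇐ C99: « Recent work of Bergeron et al. [pick3nl] establishes that this is in fact an isomorphism. »); `Implications110`; bookkeeping theorems; no new import).  Nothing of the first thirty-one files is
redeclared or changed.
-/
import HarnessLib
import Literature.NumberTheory.Automorphic.Arthur2013.Downstream31

/-!
# Downstream of Arthur (2013), Mok (2015), KMSW (2014): the typed register, thirty-second file (tranches ≥ 107)

**What is reproduced.**  As in the first thirty-one files: for published theorems (and dated preprints) that invoke J. Arthur, *The Endoscopic Classification of
Representations* (AMS Colloq. Publ. 61, 2013) [cite: Arthur2013], C. P. Mok's memoir [cite: Mok2012] or Kaletha – Mínguez – Shin – White [claim: KalethaMinguezShinWhite2014,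
under-review], or that invoke an already-typed consumer of them, one HYPOTHESIS `E_…` per statement quoting the sentences in which the paper invokes them, recording WHICH
leaves and nodes of the three dependency DAGs the proof consumes; and bookkeeping theorems composing these hypotheses with the packaged inputs `BookInputs` of
`Downstream.lean`, `MokInputs` / `KMSWInputs`, and with the bookkeeping theorems of the rows reused (`fmRefined_of_inputs`, `fmRefined_conditional_form` of tranche 89).
Quotations are exact substrings of the cell's texts, staged byte-identically with sha256 under `HOME/pub-arthur-down-g42/primaries/` (`SHA256SUMS`, 219 lines): the arXiv PDF
text `paper-arxiv-2205.09503` (row C226's text: p0001:L1 "arXiv:2205.09503v2  [math.NT]  5 Apr 2024", 101 pp. — the published version is Compositio Math. 160 (2024), no. 9, 2115–2202, doi:10.1112/S0010437X24007267, whose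
text was NOT compared; mathematical italics extracted as ‘/u1D70B’ codes, kept verbatim as in tranches 89 / 104; p0072 `cmp`-identical to unit `pub-arthur-down-g40`'s
staging), the pypdf text `pdf-arxiv-2410.03166v2` of the arXiv v2 PDF of row C271 (67 pp., byte-identical copy of unit `pub-arthur-down-g41`'s staging; v2 2025-03-25 per
`primaries/arxivabs/abs_2410.03166.html`, read-only GET 2026-08-23; zbMATH ‘Preprint’, no Crossref record → PREPRINT) and the corpus TeX `paper-arxiv-2410.03166` (v1 wording,
title only).  Locators ‘pNNNN:Ln’.  Sentences naming a conj., titles with the word and bibliography entries are in the comment block or cut before the word.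

**Why a thirty-second file, and why these two nodes (v1; GAPS G-DN-447 / G-DN-448).**  `Downstream31.lean` reached 93 % of the cap with tranche 106.  Tranche 106 typed Kuga –
Tsuzuki's Theorem 1.2 / Corollary 1.3 on both arXiv versions and recorded (D-DN-g41-9) that v2 adds a §7 ‘An application’ whose Corollary 1.4 uses the A-packet classification
of PGSp₂ BY NAME and ‘[8, Corollary 1.1]’ = Furusawa – Morimoto 2024's GGP EQUIVALENCE — a statement of row C226 that tranches 89 (Theorems 1.1 / 1.2 / 1.4: `FMggp1`,
`FMggp2`, `FMrefined`, `FMbocherer`, `FMliu`) and 104 (Corollary 8.1: `FMtempered`) had not typed.  Both are typed here, the C226 node first.  ROW C226, NEW NODE (M. Furusawa –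
K. Morimoto, title in the comment block; bib FurusawaMorimoto2024SO5 pre-existing): the lead sentence « As a corollary of Theorem 1.2, we prove the (SO(5), SO(2)) case of the Gan- » [GGP conj. in the form of [32, Conj. 24.1]] — COROLLARY 1.1
(for (π, V_π) irreducible cuspidal TEMPERED on G_D(𝔸) with trivial central character, D an arbitrary quaternion algebra: (1) the (ξ, Λ, ψ)-Bessel period does not vanish on π
⟺ (2) L(1/2, π × AI(Λ)) ≠ 0 and every local Bessel functional α_v ≢ 0 ⟺ (3) L(1/2, π × AI(Λ)) ≠ 0 and Hom_{R_{ξ,v}}(π_v, χ^{ξ,Λ}_v) ≠ {0} at every place) — REMARK 1.9, THE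
PLACE: (1) ⟺ (2) « The equivalence between the conditions (1) and (2) is immediate from » [Theorem 1.2] = `Consumers89.FMrefined` (the Ichino – Ikeda type formula (1.6.2), typed in tranche 89 ⇐ Mok at all ranks ∧ row C67
`Consumers34.FurusawaMorimoto` ∧ row C24 `Consumers34.BPlocalGGP` — [read: by Mok [82]]); (2) ⟺ (3) « is proved by Waldspurger [115] at any non-archimedean place » [v] « and by Luo [77] » [recently at any archimedean place] —
Waldspurger, Astérisque 347 (2012) and Z. Luo, arXiv:2009.13947 (a preprint; the local archimedean GGP for special orthogonal groups): neither invokes the book, Mok or KMSW —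
absorbed.  Typed `FMggpEquiv` := Corollary 1.1 ⇐ `FMrefined`.  THE AUTHORS' WORDING: no status sentence at the corollary; the paper's assumption (1.5.4) (the endoscopic
classification for the inner forms G_D, [3, Conj. 9.4.2, 9.5.4] — tranche 89's hypothesis node `FM154gen`) governs Theorem 1.1 (2), NOT Theorem 1.2 / Corollary 1.1, which
are stated for tempered π without it (Remark 1.5: under (1.5.4) the formula matches Liu's conj.; for split D (1.5.4) [read: is indeed fulfilled]).  ROW C271, NEW NODE
(S. Kuga – M. Tsuzuki; bib KugaTsuzuki2024SpectralAverage pre-existing, tranche 106): v2's §1 after Corollary 1.3: [read: Theorem 1.2 is deduced from Theorem 6.11 with an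
error term whose dependence on f_S is explicit … As one of such applications, in §7, we prove the following.] — COROLLARY 1.4 (l ∈ 2ℤ_{≥7}; M, D < 0 coprime fundamental
discriminants; p ∤ MD: there exist N_p > p|DM| and C_p > 0 such that for every prime N > N_p there is an irreducible cuspidal automorphic Π of GL₄(𝔸) with (i) JPSS-conductor
N², (ii) regular algebraic of infinity type (l, 2, 1, 3−l), so ℚ(Π) is a number field, (iii) of symplectic type, (iv) L(1/2, Π) L(1/2, Π × κ_M) L(1/2, Π × κ_D) ≠ 0, (v)
dim_ℚ ℚ(Π) ≥ C_p √(log log N)) — §7: THEOREM 7.2 (a weighted density theorem with explicit error) ⇐ « From Theorem 6.11 combined with [20, Theorem 5.4], we obtain » [the formula] (Theorem 6.11 = the paper's relative trace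
formula; [20] = the authors' Rankin – Selberg paper, census E8, Arthur-free by design) over the sets Π_cusp(l,N)^{G,new} DEFINED through the Arthur parameter « ([1] and [9], see also [33]). » ([1]
= the book, [9] = Gee – Taïbi = row A4, [33] = Schmidt 2018 = row C180 — definitional pointers, as ruled in tranche 106); THEOREM 7.3 (π ∈ Π_cusp(l,N)^{G,new} with L(1/2, π
× μ) ≠ 0, L(1/2, π) L(1/2, π, κ_D) ≠ 0 and [ℚ(π) : ℚ] ≥ C_p √(log log N)) ⇐ the argument of [39, §3.2] (Sakugawa – Sugiyama, census E65, Arthur-free) « using Theorem 7.2 » [instead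
of [22, Theorem 1.1] = Kim – Wakatsuki – Yamauchi, census C8 — replaced, not invoked] and a variant of [35, Lemma 6.16] (Shin – Templier 2014 = census row C220's text; only
this measure-theoretic lemma is adapted, [read: the same proof works] — no typed statement of C220 is invoked); LEMMA 7.4 (σ-conjugates of π ∈ Π^{E,Λ}_cusp(l,N)^{G,new}: σπ
in the same family, π^{GL} regular algebraic with σψ the parameter of σπ, ℚ(π) = ℚ(π^{GL}), conductor N², twisted non-vanishing preserved) ⇐ THE CLASSIFICATION BY NAME:
[read: since σπ is a cuspidal automorphic representation of G(A),] « it belongs to some global A-packet » [Π_ψ′ with a global A-parameter ψ′ … an isobaric automorphic representation ξ of GL₄(𝔸)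
determined by ψ′] ([1] = the book ↦ `∀ N, ν.Everything N`, the by-name convention of tranches 19 – 29 and 104 – 106) ∧ « By [8, Corollary 1.1], we » [have L(1/2, π × AI(Λ)) ≠ 0 and π_v has
local (E_v, Λ_v)-Bessel model for all v] … « Thus, by [8, Corollary 1.1] once again, » [σπ admits a global (E, σ∘Λ)-Bessel model] ([8] = Furusawa – Morimoto 2024 = row C226 ↦ the new node
`FMggpEquiv`); [3] Clozel (Théorème 3.13), [11] Grobner – Raghuram (– Gan) AJM 2014 ([11, Theorem 7.1.2], period relations for GL₄ — its own remark on [read: Arthur's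
classification] is prospective prose, not a use), [12], [17] Jacquet – Shalika, [18], [28], [32]: published, Arthur-2013-free, absorbed; the close: « Corollary 1.4 follows from Theorem 7.3 applied to » [(Λ, μ) =
(1, κ_M) and Lemma 7.4].  Typed `KTrationality` := Corollary 1.4 (with Theorem 7.3 and Lemma 7.4) ⇐ book by name ∧ `FMggpEquiv`.  NOT BOUND: Theorem 1.2 / `KTequidist`
(Theorem 7.3 runs through Theorem 7.2, a sibling of Theorem 1.2 from Theorem 6.11, not through Theorem 1.2; ingredient (ii) of §6.5 « (The existence of a transfer to GL4 [1] cf. [32]) » is printed for Theorem 1.2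
only — the same by-name premise covers it; `DIVERGENCE2.md` §DN-g42).  THE AUTHORS' WORDING: no status sentence on the classification in §7; Mok / Kaletha not in the text.
FLAGS: C226's Corollary 1.1 (PUBLISHED 2024, stated for all tempered π on every G_D) inherits through Theorem 1.2 Mok's 2024–2026 preprint layer and weighted fundamental
lemmas and KMSW's general weighted fundamental lemma (`fmggpEquiv_conditional_form`); C271's Corollary 1.4 (PREPRINT 2025) inherits the book's 2024–2026 preprint layer and
two weighted fundamental lemmas by name AND that union through [8, Corollary 1.1] (`ktRationality_conditional_form`).  SUPPORT (canonical reading, `DownstreamSupport13.lean`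
§110): support(`FMggpEquiv`) = Mok 29 ∪ KMSW's Mok import (no book leaf); support(`KTrationality`) = book 24 ∪ Mok 29 ∪ KMSW's Mok import.  DISCOVERY RECORD of this unit
(status-neutral; GAPS G-DN-447): the corpus full-text channel (sixteen conjunctive needles naming the classification AND Siegel / paramodular / unitary objects) and the
local-graph forward citations of rows C44, C226, C271, of Atobe 2018 and of Schmidt 2018 / 2020, matched against the census, returned only census rows and NON-USES as
printed (remarks and bibliographic pointers: Grobner – Raghuram AJM 2014 Remark 42; Berger – Dembélé – Pacetti – Şengün JLMS 2015 Remark 4.4; Dickson IJNT 2015;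
Dummigan, Glasgow Math. J. 2021, whose Theorem 1.5 is stated under its own Conj. 1.1 with Remark 1.6 anticipating Furusawa – Morimoto) — recorded in `GAPS.md`, no rows.

**v2: why a hundred-and-eighth tranche — THE MOK-2014 CONDUIT VEIN (GAPS G-DN-447 (d), G-DN-449).**  The corpus full-text sweep of this seat (needle ‘Mok "quasi-split unitary"
"base change" cohomological cuspidal’) surfaced Hida – Tilouine's use of ‘[Mok14]’ = C.-P. Mok, *Galois representations attached to automorphic forms on GL₂ over CM fields*,
Compositio Math. 150 (2014) 523–567 = arXiv:1109.5392 — the census's CONDUIT ROW C191 (tranche 28, `Downstream5.lean`: `Consumers28.MokGSp4` ⇐ the book ∧ row A4 Gee – Taïbi,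
through which rows C118 / C144 / C148 were typed; Mok's 2011 sentence [read: conditional on the results of Arthur]).  The row's all-years local forward citations (`lit citing
arxiv:1109.5392 --source local`: 35; 13 not in the census files) were then read: FIVE consumers typed here, three non-uses and older census rows (G-DN-449 (a)).  The sentences are
quoted in the field and edge docstrings of `Consumers108` / `Implications108` below; only the bindings are summarised here.  ROW C273 (ABSENT from the census): Haruzo Hida –
Jacques Tilouine, p0001:L1-2 "SYMMETRIC POWER CONGRUENCE IDEALS AND SELMER GROUPS" — p0001:L3 "Haruzo Hida, Jacques Tilouine" (J. Inst. Math. Jussieu 19 (2020), no. 5, 1521–1572, doi:10.1017/S1474748018000476 — Crossref via `lit cite`; typed on the HAL preprint text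
hal-01398905 v1 (18 Nov 2016) held as `paper-doi-10-1017-s1474748018000476`, 35 pp.; the journal text was NOT compared; bib HidaTilouine2020SymmetricPower NEW) — three typed
statements: `HTunitaryU4` := Theorem 1.3's case j = 2 (= §3.2's Corollaries 3.6 / 3.7; §4's Corollary 4.3 re-uses the morphism θ′) ⇐ C191 (the morphism θ′ : h^u_3 → h^s_2 exists
because « that the base change from GSp4 to GL4 has also been established [Mok14], so that there is also a » [commutative diagram]); `HTstandardGSp4` := §7's Theorems 7.1 / 7.2 ⇐ C191 (« As we noted above, using the base change from GSp(4) to GL(4) » [established in [Mok14] and Clozel's descent to U(4)]); `HTsymTower` :=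
Theorem 1.6 APPLIED for n = 5, …, 8 ⇐ row C177 `Consumers18.ClozelThorne2` (« This theorem applies for n = 5, 6, 7, 8 by [CT15] »; §6 « have been established in [CT15]. »; the theorem itself carries the Sym^m transfers as an explicit
hypothesis, §2.2 « It is known for n − 1 ≤ 8 thanks to the works of Kim-Shahidi [KS02b], Kim [Kim03] » [and Clozel-Thorne [CT14], [CT15]]) — [CT15] = part II (Annals 2015) = C177, bound AS CITED ([CT14] = part I = census row C210, whose typed node is
its Proposition 2.9 (3): named, not bound; part III = row C29, which constructs Sym⁶ / Sym⁸ in 2017, is not cited by this 2016 text); [Clo91], Arthur – Clozel, Kim – Shahidi, Kim,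
Geraghty [Ge10], [Pi12b], Urban, [HT15]: Arthur-2013-free, absorbed.  THE AUTHORS' WORDING: « established by C.-P. Mok [Mok14] and [Clo91] »; « This theorem applies for n = 5, 6, 7, 8 by [CT15] » — no status sentence; the word Arthur occurs only in
‘Arthur and Clozel’; the book is not cited (the dependence is second-order, through Mok 2014).  ROW C274 (ABSENT): Andrew Jones, p0001:L1 "Modular elliptic curves over the field of twelfth roots of unity" (LMS J. Comput. Math. 19 (2016)
155–174, doi:10.1112/S1461157016000048 per the arXiv journal-ref; corpus TeX `paper-arxiv-1505.01812` = arXiv v1 2015-05-07, the only version; bib Jones2016TwelfthRoots NEW) —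
`JonesQzeta12` := the modularity of the elliptic curves of Table 5.10 over ℚ(ζ₁₂) (§5) ⇐ C191 (Theorem 1 of the text = [read: a version of the main result in [Mok14]]; « shall combine the resulting data with our knowledge of the Galois representations constructed in [Mok14] »
[to give the first proven examples of modular elliptic curves over a quartic CM field]) — [HLTT13] / [Sch13] are named as later constructions, not used; Faltings – Serre, Livné, [GHY13],
[DGP10]: Arthur-free.  THE AUTHOR'S WORDING: no status sentence; Arthur not in the text.  ROW C275 (ABSENT): Konstantinos Tsaltas – Frazer Jarvis, p0003:L1 "Descending congruences of theta lifts on GSp4" — p0003:L2 "Konstantinos Tsaltas1" / p0003:L5 "Frazer Jarvis∗" (J. Number Theory 199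
(2019) 251–288, doi:10.1016/j.jnt.2018.11.012; typed on the authors' accepted manuscript, White Rose eprint 140012, `paper-doi-10-1016-j-jnt-2018-11-012`, 40 pp.; bib
TsaltasJarvis2019Descending NEW) — the register's node-and-supplier pattern (tranches 83 / 105): hypothesis node `TJlgc` := §4's standing assumption « we will assume full local-global » [compatibility],
SUPPLIED ⇐ C191 by footnote 8 (« this is a result of Sorensen (see [24]) and Mok (see Theorem 3.1 » [of [19]]; [24] = Sorensen 2010, globally generic Π only — the paper's theta lifts are holomorphic, non-generic) and by §5's discussion
([read: one can get functoriality in the sense that we require using the] « endoscopic classiﬁcation of Arthur; » … « This lift is described by Mok in [19]; »); `TJdescent` := Theorem 4.2 ⇐ `TJlgc`; Weissauer – Laumon (the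
Galois representation itself, via [2]), Roberts, [17], [25], [27], [28], Gee – Geraghty [12] (discussed, not used): Arthur-2013-free, absorbed.  THE AUTHORS' WORDING: the
assumption is explicit and its supplier printed (G-vii with supplier); the book is named once (§5) as the source of Mok's lift.  ROW C276 (ABSENT): Haining Wang, p0001:L1 "Level lowering for GSp(4) and vanishing cycles on Siegel threefolds"
(arXiv:1910.07569: v1 2019-10-16 = the corpus TeX `paper-arxiv-1910.07569`, 22 chunks; v3 2022-09-23 RETITLED *Level lowering on Siegel modular threefold of paramodular level*
per `primaries/arxivabs/abs_1910.07569.html`; no journal reference → PREPRINT; bib HWang2019LevelLowering NEW; NOT the author's census row C144 = arXiv:2204.07807) —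
`HWangLevelLowering` := Theorems 1 / 2 (Mazur's and Ribet's principles for holomorphic Siegel modular forms of paramodular level) ⇐ C191 through §3's Theorem 3 (the Galois
representation W_(π,l) of a holomorphic non-CAP π: « the proof of it can be found in [Taylor93], [Laum05], [Weis05], [Sor10] and [Mo14]. ») — bound AS CITED jointly with Taylor, Laumon, Weissauer, Sorensen (published, Arthur-2013-free), exactly as
tranche 28 bound row C118's [read: Theorem 4.3.4 (Taylor, Laumon, Weissauer, Schmidt, and Mok)].  THE AUTHOR'S WORDING: no status sentence; Arthur not in the text (but for
‘Arthur packets’ in a reference title).  ROW C277 (ABSENT): Michael Broshi – Mohammed Zuhair Mullath – Claus Sorensen – Tom Weston (authors per `abs_2009.06575.html`; the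
corpus TeX shows only the first author's e-mail), p0001:L1 "Unobstructed deformation problems for GSp(4)" (arXiv:2009.06575 v1 2020-09-14, the only version; no journal reference → PREPRINT; corpus TeX `paper-arxiv-2009.06575`, 13
chunks, bibliography not rendered — [Mok] is identified as Mok 2014 by the corpus citation graph (the e-print is a citer of arXiv:1109.5392) and by the content of Theorem 3.1 /
Remark 3.2; bib BroshiEtAl2020Unobstructed NEW) — `BMSWunobstructed` := Theorem 1.1 (with Remark 1.5's scope: holomorphic Siegel cusp forms of cohomological weights k₁ ≥ k₂ ≥ 3
not supercuspidal at 2) ⇐ C191 (Theorem 3.1 [read: (Weissauer, Urban, Sorensen, Mok)], proof « [Sor] and [Mok]. »; Remark 3.2 « In [Mok], Mok relaxes this assumption on $\pi$ using Arthur's results. ») — [Sor] = Sorensen 2010 (a co-author's;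
globally generic π, Arthur-free) is cited jointly; for the globally generic π of Theorem 1.1 as stated it would suffice, for Remark 1.5's holomorphic forms [Mok] is needed ([read:
The weaker assumption that π belongs to a global generic Arthur parameter] « will suffice [Mok]. ») — bound AS CITED (`DIVERGENCE2.md` §DN-g42b); [GT], [GeT], [Dinakar], [BLGGT], [GHTT]:
Arthur-2013-free, absorbed.  THE AUTHORS' WORDING: « In [Mok], Mok relaxes this assumption on $\pi$ using Arthur's results. » — no status sentence.  FLAGS: C273 (PUBLISHED 2020), C274 (PUBLISHED 2016), C275 (PUBLISHED 2019), C276 / C277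
(PREPRINTS) inherit through Mok 2014's transfer the book's 2024–2026 preprint layer and its two weighted fundamental lemmas (`mok2014vein_conditional_form`); C273's third
statement inherits instead, through Clozel – Thorne II, Mok's (memoir) preprint layer and weighted fundamental lemmas and KMSW's general weighted fundamental lemma
(`htSymTower_conditional_form`).  NOT TYPED (G-DN-449 (a)): Loeffler – Williams, ANT 14 (2020) = arXiv:1802.08207 ([mok14] inside a conditional remark on local-global
compatibility — G-vii, non-use); Dembélé – Loeffler – Pacetti, Math. Z. (2019) = arXiv:1612.06625 ([Mok] for a method of proof — non-use); Guitart – Masdeu – Şengün, J. Algebra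
(2016) = arXiv:1501.02936 (no sentence located); Berger – Dembélé – Pacetti – Şengün JLMS 2015 (G-DN-447 (b)).  SUPPORT (canonical reading, `DownstreamSupport13.lean` §111):
book 24 for the six C191-supported statements (through C191 and A4); Mok 29 ∪ KMSW's supply of `StabOrdI` (no book leaf, no KMSW sequel) for `HTsymTower`.

**v3: why a hundred-and-ninth tranche — THE SYMMETRIC-POWER VEIN, I (GAPS G-DN-449 (d), G-DN-450).**  Tranche 108 bound Hida – Tilouine's symmetric-power tower to row
C177; the all-years local forward citations of Clozel – Thorne II (Ann. of Math. 181 (2015), doi:10.4007/annals.2015.181.1.5 = row C177, tranche 18, `Downstream3.lean`: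
`Consumers18.ClozelThorne2` ⇐ Mok at all ranks ∧ KMSW's node `StabOrdI`; the authors' sentence [read: the whole paper as conditional on the results in [Mok]]) and III (Duke
Math. J. 166 (2017), doi:10.1215/00127094-3714971 = row C29, tranche 64, `Downstream17.lean`: `Consumers64.ClozelThorneIII` ⇐ Mok ∧ `StabOrdI` ∧ E43 ∧ C177) were then
read (`lit citing`, local graph: 75 + 70 citers, 85 distinct; 13 census rows; c. 50 analytic papers of 2021–2026 on moments of symmetric-power coefficients whose texts, where held,
take Sym^m f for all m from Newton – Thorne (census-3: no invocation of the three classifications) — non-uses for this register; paywalled ones not read): FOUR pre-2020-vintage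
consumers typed here (G-DN-450 (a)).  The sentences are quoted in the field and edge docstrings of `Consumers109` / `Implications109` below; only the bindings are summarised
here.  ROW C278 (ABSENT from the census): Nate Gillman – Michael Kural – Alexandru Pascadi – Junyao Peng – Ashwin Sah, *Patterns of primes in the Sato – Tate c.* (title
verbatim in the comment block; Res. Number Theory 6 (2020), Paper No. 9, doi:10.1007/s40993-019-0184-8; corpus TeX `paper-arxiv-1907.08285` = arXiv v1, the only version;
bib GillmanEtAl2020SatoTatePatterns NEW) — `GKPPSsatoTateGaps` := Theorems 1.1 / 1.2 (bounded gaps and Green – Tao patterns inside Sato – Tate prime sets of measure ≥ 0.36,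
for every non-CM E/ℚ, unconditionally) ⇐ C177 ∧ C29 (« and $\ell\in\{5,6,7,8\}$ to Clozel and Thorne [CT15, CT17]. »; proof of Theorem 1.1: « Choose $\ell_{\max} = 8$, so that $L(s, \Sym^\ell E)$ is automorphic for all $\ell \le \ell_{\max}$ and for all non-CM elliptic curves $E$ [CT17]. »; « Accordingly, for an unconditional result, we can only afford to use an approximation of $\one_I$ by polynomials of degree up to $8$. ») — both parts bound, as cited.  THE AUTHORS' WORDING:
no status sentence; ‘unconditional’ is the authors' word for ℓ ≤ 8.  ROW C279 (ABSENT): Robert J. Lemke Oliver – Jesse Thorner, *Effective log-free zero density estimates for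
automorphic L-functions and the Sato – Tate c.* (Int. Math. Res. Not. IMRN 2019, no. 22, 6988–7036, doi:10.1093/imrn/rnx309; corpus TeX `paper-arxiv-1505.03122`, version among
v1 – v4 not determined; bib LemkeOliverThorner2019ZeroDensity NEW) — `LOTeffectiveST8` := Theorem 1.8's second unconditional case (the short-interval Sato – Tate asymptotic for
Sym⁸-minorizable I and π a Hecke newform over ℚ; the theorem itself carries [read: Sym^n π ∈ A_{n+1}(K) for each n ≤ N] as an explicit hypothesis — G-vii form with a printed
supplier): « By recent work of Clozel and Thorne [ClozelThorne], if $\pi$ is associated to a classical modular form, and $K\cap\Q(e^{2\pi i/35})=\Q$, then $L(s,\mathrm{Sym}^n\pi,K)\in\mathcal{A}_{n+1}(K)$ for $n\leq 8$. » … « or if $I$ can be $\mathrm{Sym}^8$-minorized and $\pi$ is a Hecke newform over $\mathbb{Q}$, then this is unconditional. » ⇐ C29 AS CITED ([ClozelThorne] = part iii, ‘preprint’, the only Clozel – Thorne item in the bibliography; « this is known in general only for $n\leq 4$ » [GJ, Kim,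
KS1, KS2]: Arthur-free).  THE AUTHORS' WORDING: ‘unconditional’; no status sentence.  ROW C280 (ABSENT): Fabian Januszewski, p0001:L1 "Non-abelian p -adic Rankin-Selberg L -functions and non-vanishing of central L -values" (Amer. J. Math. 146 (2024), no. 2,
495–578, doi:10.1353/ajm.2024.a923241 — Crossref via `lit cite`; corpus TeX `paper-arxiv-1708.02616`, version among v1 (2017) – v6 (2023) not determined, its bibliography of
2017/2018 vintage; bib Januszewski2024RankinSelberg NEW) — `JanuszewskiSymPadicL` := the application asserted in the introduction (p-adic meromorphic L-functions for
L(s, Sym^n f), 1 ≤ n ≤ 8, f a non-CM nearly ordinary Hilbert cusp form of large parallel weight over F linearly disjoint from ℚ(e^{2πi/35}); no numbered statement) ⇐ C177 ∧ C29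
(« Thanks to recent progress by Clozel-Thorne [clozelthorne2014,clozelthorne2015,clozelthorne2017], we know that $\Sym^n$ exists for $n\leq 8$ for Hilbert modular forms over totally real fields $F$ under mild hypotheses. »; [clozelthorne2014] = part I = census row C210, named, not bound).  THE AUTHOR'S WORDING: ‘under mild hypotheses’; no status sentence.  ROW C281 (ABSENT):
Xiaoyu Zhang, *Selmer groups of symmetric powers of ordinary modular Galois representations* (Amer. J. Math. 143 (2021), no. 1, 125–173, doi:10.1353/ajm.2021.0002; corpus
TeX `paper-arxiv-1802.08329` = arXiv v1, the only version; bib XZhang2021SymmetricSelmer NEW; an Iwasawa-theoretic sequel to row C273 Hida – Tilouine over the cyclotomic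
tower, « We compare, for $n\leq 4$ and under certain assumptions, » [Sym^{2n} ⊗ det^{−n}]) — the register's node-and-supplier pattern: hypothesis node `ZhangSymLayers` := §4's standing assumption (« Assume that the Langlands functorialities » [Sym^{n−1} :
GL₂/ℚ_k ⇝ GL_n/ℚ_k] « are established for all $k$ »), SUPPLIED ⇐ C177 ∧ C29 by the next sentence (« for $p>7$, the functorialities » … « are established for all $n\leq9$ and all $k\geq0$. »; [ClozelThorne2014] = C210 named, not bound); `ZhangSelmerTower` :=
Theorem 4.27 = Theorem 1.2's second part (torsionness of the dual Selmer group of A^{n−1}(ρ_μ) over ℚ_∞, the order of its trivial zero, and the congruence-ideal formula on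
each layer) ⇐ `ZhangSymLayers`; [ArthurClozel], [Clozel1991], [Geraghty], [HidaTilouine]'s R = T theorems (§2): Arthur-2013-free, absorbed.  THE AUTHOR'S WORDING: the
assumption is explicit and its supplier printed (G-vii with supplier); no status sentence; Arthur only in ‘Arthur – Clozel’.  FLAGS: all four PUBLISHED (2020, 2019, 2024,
2021); each inherits, through parts II / III, Mok's (memoir) 2024–2026 preprint layer, Mok's two weighted fundamental lemmas and KMSW's general weighted fundamental lemma, and
NO open leaf of the book (`symPowerVein_conditional_form`); the later literature's Arthur-free route to Sym^m (Newton – Thorne 2021) post-dates C278 / C279 / C281 and the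
wording of C280's text and is not cited by any of the four — recorded in `DIVERGENCE2.md` §DN-g42c, not modelled.  NOT TYPED (G-DN-450 (a)): J. Thorner, Res. Math. Sci. 8
(2021) = arXiv:2002.10450 and the 2021–2026 analytic papers held as text (arXiv:2101.06705, 2208.14786, 2208.10459, 2308.06632): Sym^m from Newton – Thorne, Clozel –
Thorne cited for history — non-uses; S. Löbrich – W. Ma – J. Thorner, Res. Math. Sci. 4 (2017) = arXiv:1606.07427 (theorems stated under an explicit automorphy-and-symplecticity
hypothesis; [CT] cited for the status of part of it — G-vii without a full supplier, not typed); D. Ramakrishnan arXiv:1503.08242 and arXiv:1503.01283 (prose mentions);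
I. Blanco-Chacón – L. Dieulefait, J. Number Theory (2026) = arXiv:2310.11522 (historical mention); H. Lao, Acta Math. Hungar. (2019) and P.-J. Wong, J. Number Theory (2018)
(paywalled, acquisition requests acq-10370 / acq-10371 filed by the read attempt; not read).  SUPPORT (canonical reading, `DownstreamSupport13.lean` §112): Mok 29 ∪ KMSW's
five `StabOrdI` premises for all five statements; on the book's side only E43's five PUBLISHED leaves (through C29) — no open book leaf; `LOTeffectiveST8` differs from the
other four only at the reading level (C177 not a typed premise of it).

**v4: why a hundred-and-tenth tranche — THE NOETHER–LEFSCHETZ / BALL-QUOTIENT VEIN, II (GAPS G-DN-452, G-DN-453).**  Tranche 4 (v5, `Downstream.lean`) typed the first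
second-order consumers of Bergeron – Millson – Moeglin's two papers and of Bergeron – Li – Millson – Moeglin (rows C161 `BHK`, C162 `BFZcor` ⇐ C99; C163 `ChenSinger` ⇐ C17-IMRN;
C164 `StoverBall` ⇐ C17-Acta — all 2025 / 2026 preprints found by the arXiv mailing).  The all-years local forward citations of arXiv:1306.1515 (C17-Acta: 31 citers, 14 not in the
census), arXiv:1110.3049 (C17-IMRN: 34 / 19) and arXiv:1412.3774 (C99: 49 / 40 — the K3 / hyperkähler moduli literature, essentially absent from the census) were read where text is
held; this tranche types the four PUBLISHED uses whose invocation is a sentence in the proof of a numbered statement (G-DN-453 (a)); the further uses found (N. Bergeron – Z. Li, Duke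
Math. J. 168 (2019) and its sequel; A. Di Lorenzo – R. Fringuelli – A. Vistoli, Bull. Lond. Math. Soc. (2024); I. Barros – P. Beri – L. Flapan – B. Williams, arXiv:2407.07622; the
2024 preprint arXiv:2411.12931) are recorded for the next tranche (G-DN-453 (c)).  The sentences are quoted in the field and edge docstrings of `Consumers110` / `Implications110`
below; only the bindings are summarised here.  ROW C282 (ABSENT from the census; the PREDECESSOR of row C164's [StoverToledo2]): Matthew Stover – Domingo Toledo, p0001:L1 "Residual finiteness for central extensions of lattices in $\mathrm{PU}(n,1)$ and negatively curved projective varieties"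
(Pure Appl. Math. Q. 18 (2022), no. 4, 1771–1797, doi:10.4310/pamq.2022.v18.n4.a15; corpus TeX `paper-arxiv-2108.12404`, arXiv v1 / v2, chunked version not determined; bib
StoverToledo2022CentralExtensions NEW) — the register's node-and-supplier pattern (tranches 83 / 105 / 108 / 109): hypothesis node `STcupProduct` := Theorem 3.3 (for compact
congruence arithmetic ball quotients of simple type: classes in the span of totally geodesic divisors, all of H^{1,1} if n ≥ 3, all of H² if n ≥ 4, lie in the image of
∧²H¹ on a congruence cover) with Corollary 3.5, SUPPLIED ⇐ C17-Acta (« Taking $q=1$ and the appropriate values of $(a,b)$ in [Acta] »; « Using [Acta], arguing almost verbatim as in the proof of [Acta] »; the authors attribute the argument to Bergeron: « the arguments for Theorem (thm:ChernInSpan) and Theorem (thm:Cup) should be attributed to him »);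
`STcentralRF` := Theorem 1.2 (residual finiteness of the central extensions of Γ by ℤ or ℤ/d with characteristic class in that span; unconditionally in the class for n ≥ 4) with
Theorem 1.1 (the preimage of a cocompact arithmetic lattice of simple type in every connected cover of PU(n,1) is residually finite) and Corollary 1.4 ⇐ the node (proof of
Theorem 1.2: Corollary 3.5 then [StoverToledo]'s criterion); `STbranchedCovers` := Proposition 5.1 (cyclic covers of a congruence cover branched along a totally geodesic divisor,
every degree d ≥ 2) with Theorem 1.5 (negatively curved smooth projective n-folds not homotopy equivalent to a locally symmetric manifold, all n ≥ 2; « answering a question raised to the second author by Gromov over $40$ years ago ») ⇐ the node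
(« Existence of these branched covers follows from Corollary (cor:ComplementRF). »; Zheng's theorem for the metric).  [Invent] = C99 is named for the Kudla – Millson METHOD of Theorem 3.2 (c₁ in the span), not invoked — not bound.  THE AUTHORS'
WORDING: no status sentence; Arthur, Mok, KMSW do not occur in the text; [Acta] is [read: deep structural results on cohomology arising from the theta correspondence].  ROW C283
(ABSENT): Claudio Llosa Isenrich – Pierre Py, p0001:L1 "Groups with exotic finiteness properties from complex Morse theory" (J. Topol. 18 (2025), no. 1, e70013, doi:10.1112/topo.70013; corpus TeX `paper-arxiv-2310.04073` = arXiv v1, the only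
version; bib LlosaIsenrichPy2025ExoticFiniteness NEW) — `LIPexoticKernels` := Theorem 1.1 (for every n ≥ 2 a compact Kähler n-fold Y, negatively curved and not homotopy equivalent
to a locally symmetric manifold, with a dense open cone O ⊂ H¹(Y, ℝ) ∖ 0 of classes φ : π₁(Y) → ℤ whose kernels are of type F_{n−1} and not FP_n(ℚ)) ⇐ C282 `STbranchedCovers`
(the input restated as the authors' Theorem 4.2 ( [StoTol-21-II]); « Theorem (thm:StoverToledo) implies that there is a finite congruence cover » in the proof) — a THIRD-ORDER row (C283 ⇐ C282 ⇐ C17-Acta ⇐ Mok ∧ KMSW ∧ AMR).  THE AUTHORS'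
WORDING: the divisibility of [D] « relies on deep results on the cohomology of arithmetic groups due to Bergeron, Millson and Moeglin [BeMiMo-16] » and Remark 4.3 (arithmeticity enters [read: through the results on the cohomology of arithmetic groups used in [StoTol-21-II]]);
no status sentence; Arthur, Mok, KMSW absent.  Theorem 1.2 / Corollary 1.3 (also obtainable from arithmetic ball quotients with b₁ > 0), Theorems 1.4 / 1.5: not typed.  ROW
C284 (ABSENT): Dan Petersen, p0001:L1 "A vanishing result for tautological classes on the moduli of K3 surfaces" (Amer. J. Math. 141 (2019), no. 3, 733–736, doi:10.1353/ajm.2019.0014; corpus TeX `paper-arxiv-1606.06716` = arXiv v2; bib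
Petersen2019K3Vanishing NEW) — `PetersenVanishing` := Theorem 2.2 (W_k H^k(M_Λ, ℚ) = 0 for k > 2(d − 2), 4 ≤ d = dim M_Λ ≤ 19) with Corollary 2.3 (the tautological cohomology
ring of F_g vanishes above degree 34) ⇐ C99 (« every class in $H^2(M_\Lambda,\Q)$ is in fact a linear combination of Noether–Lefschetz divisors, after [bergeronlimillsonmoeglin] »; « In this case, $\beta$ is a linear combination of Noether–Lefschetz divisors [bergeronlimillsonmoeglin] » — the generation of H² by Noether–Lefschetz divisors); Remark 2.4 uses C99's degree ≤ 8 statement for a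
further unnumbered assertion.  THE AUTHOR'S WORDING: ‘after [BLMM]’; no status sentence; Arthur absent.  ROW C285 (ABSENT): Radu Laza – Kieran G. O'Grady, *Birational geometry of
the moduli space of quartic K3 surfaces* (Compositio Math. 155 (2019), no. 9, 1655–1710, doi:10.1112/S0010437X19007516; corpus TeX `paper-arxiv-1607.01324` = arXiv v1, the only
version; bib LazaOGrady2019QuarticK3 NEW) — `LOGpicardRank` := Theorem 3.1.1 (the rank ρ_N of Pic of the N-dimensional D-tower variety F_{Λ_N}(Õ(Λ_N)^+), N ≥ 3, by an explicit
formula; the Picard number of F(N) for N odd) ⇐ C99 (« we will compute its rank by applying results of Bergeron et al. [pick3nl], and of Bruinier [bruinier] »; proof: Borcherds' map from S_{k,Λ_N}, injective after Bruinier, « Recent work of Bergeron et al. [pick3nl] establishes that this is in fact an isomorphism. »); the authors flag the case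
N = 10 (Picard number 1, hence H_h(10) ∝ λ(10)) as load-bearing for the sequel (« That is a key relation for what follows. ») while recording Gritsenko's independent relation H_h(10) = 8λ(10).  THE AUTHORS'
WORDING: ‘Recent work of Bergeron et al. establishes’; no status sentence; Arthur absent.  FLAGS: all four PUBLISHED (2022, 2025, 2019, 2019); C282 / C283 inherit, through the
Acta paper, Mok's open leaves and KMSW's general weighted fundamental lemma and NO node of the book (`stoverToledoLine_conditional_form`); C284 / C285 inherit, through C99, ALL
24 leaves of the book's DAG (`k3ModuliLine_conditional_form`) — in texts of algebraic geometry and geometric group theory that do not name Arthur.  NOT TYPED (G-DN-453 (b)): J. H.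
Bruinier – M. Möller, *Cones of Heegner divisors*, J. Algebraic Geom. 28 (2019) = arXiv:1705.05534 (`nonuse/`): its theorems (rational polyhedrality of the cones of Heegner
divisors) are proved from Borcherds' modularity and coefficient growth; C99 enters only the unnumbered remark « It is moreover surjective ( [BLMM]) under » […] « This implies that the image cone is full-dimensional. » — remark-level, no typed statement;
F. Greer – Z. Li – Z. Tian, IMRN 2015 = arXiv:1402.2330, S. Floccari, arXiv:2308.02267, Y. Maeda, Canad. Math. Bull. 2020 = arXiv:1908.08063, and the 2024 Res. Number Theory
paper arXiv:2307.02926: C17 / C99 cited for context only — non-uses.  SUPPORT (canonical reading, `DownstreamSupport13.lean` §113): Mok 29 ∪ KMSW's five `StabOrdI` premises ∪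
AMR-unitary for the ball-quotient line, no book leaf; all 24 book leaves for the K3-moduli line, no Mok / KMSW leaf beyond the inner-form stabilisation's.

**Deliberately not here.**  Any claim about the truth of a downstream statement, about L-values, Bessel periods, fields of rationality or conductors beyond what the quoted
sentences say (v2: nothing about congruence ideals, Selmer groups, modularity of particular curves, level lowering or deformation rings is asserted; v3: nothing about
gaps between primes, zero-density estimates, p-adic L-functions or Selmer groups over the cyclotomic tower; v4: nothing about residual finiteness, branched covers,
Kähler groups, tautological rings or Picard ranks); the fields of `Consumers107` / `Consumers108` / `Consumers109` / `Consumers110` are arbitrary propositions and the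
`E_…` hypotheses record only which typed inputs the TEXTS invoke.  The canonical reading and the countermodel supports follow in the support files (§110 / §111 /
§112 / §113 in `DownstreamSupport13.lean`).
-/

set_option autoImplicit false

namespace Literature.NumberTheory.Automorphic.Arthur2013

namespace Downstream

/-! ## Hundred-and-seventh tranche (v1, unit `pub-arthur-down-g42`): NEW node `FMggpEquiv` on the EXISTING row C226 (⇐ C226's `Consumers89.FMrefined`) and NEW node
`KTrationality` on the EXISTING row C271 (⇐ the book by name ∧ `FMggpEquiv`)

Context (both rows EXIST: C226 = block `[g35c]` of `DOWNSTREAM4.md`, typed in tranche 89 (`Downstream25.lean`: `Consumers89.FMggp1` / `FMggp2` / `FMrefined` / `FMbocherer` /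
`FMliu`) and given the node `Consumers104.FMtempered` in tranche 104 (`Downstream31.lean`); C271 = block `[g41b]`, typed in tranche 106 (`Downstream31.lean`:
`Consumers106.KTequidist` / `KTnonvanishing`) on the v1 and v2 texts, whose v2-only §7 was recorded NOT TYPED in `DIVERGENCE2.md` D-DN-g41-9 pending a node for
[8, Corollary 1.1]; typed premises reused: row C226's `Consumers89.FMrefined` (`fmRefined_of_inputs`, `fmRefined_conditional_form`, `Downstream25.lean`) and the book by
name (`∀ N, ν.Everything N`, `BookInputs` of `Downstream.lean`) — all in the transitive closure of this file's import).  Texts under `HOME/pub-arthur-down-g42/primaries/`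
(`SHA256SUMS`, 219 lines): `paper-arxiv-2205.09503` (C226: arXiv PDF text, p0001:L1 "arXiv:2205.09503v2  [math.NT]  5 Apr 2024", 101 pp.), `pdf-arxiv-2410.03166v2` (C271: arXiv v2 PDF text, 67 pp., byte-identical
copy of down-g41's staging), `paper-arxiv-2410.03166` (C271: corpus TeX, v1 wording, title only).  Loci: C226 p0001:L1-4, p0008:L9-10, p0009:L28-62, p0094:L125-126,
p0095:L49-51, p0097:L34-35, p0099:L7-9; C271 v2 p0005:L33-36, p0006:L22-48, p0035:L1-9, p0036:L29-78, p0037:L1-61, p0038:L1-32, p0065:L29-48, p0066:L40-49. -/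

/-- NEW nodes on the EXISTING rows C226 (Furusawa – Morimoto 2024) and C271 (Kuga – Tsuzuki 2024/2025) of the census, as an arbitrary assignment of propositions; nothing about the content of a field is assumed. [cite: Arthur2013, downstream register of the cell, hundred-and-seventh tranche (structure only)] -/
structure Consumers107 where
  /-- Row C226, NEW NODE (EXISTING census row of block `[g35c]` of `DOWNSTREAM4.md`, typed in tranche 89 for its Theorems 1.1 / 1.2 / 1.4 and in tranche 104 for its Corollary 8.1; PUBLISHED: Compositio Math. 160 (2024), no. 9, 2115–2202, doi:10.1112/S0010437X24007267; arXiv PDF text `paper-arxiv-2205.09503`, p0001:L1 "arXiv:2205.09503v2  [math.NT]  5 Apr 2024"), Masaaki Furusawa – Kazuki Morimoto (title in the comment block) — the lead sentence: p0009:L28 "As a corollary of Theorem 1.2, we prove the (SO(5), SO(2)) case of the Gan-" [GGP conj.] p0009:L29 "in the form as stated in [32," [Conj. 24.1]. — COROLLARY 1.1, THE TYPED STATEMENT: p0009:L30-33 "Corollary 1.1. Let (/u1D70B,/u1D449/u1D70B) be an irreducible cuspidal tempered automorphic rep- resentation of /u1D43A/u1D437(A) with a trivial central character. Then the following three conditions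 are equivalent. (1) The (/u1D709,Λ,/u1D713)-Bessel period does not vanish on /u1D70B." p0009:L34 "(2) /u1D43F" [(1/2, π × AI(Λ))] p0009:L39-40 "≠ 0 and the local Bessel period /u1D6FCΛ/u1D463,/u1D713/u1D709 ,/u1D463 /nequivalence0 on/u1D70B/u1D463at any place/u1D463of/u1D439." p0009:L41 "(3) /u1D43F" [(1/2, π × AI(Λ))] p0009:L46 "≠ 0 and Hom/u1D445/u1D709 ,/u1D463" [(π_v, χ^{ξ,Λ}_v)] p0009:L51-52 "≠ {0} at any place /u1D463of /u1D439." [cite: FurusawaMorimoto2024SO5, Cor. 1.1 (page p0009:L30-52)] -/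
  FMggpEquiv : Prop
  /-- Row C271, NEW NODE (EXISTING census row of block `[g41b]` of `DOWNSTREAM4.md`, typed in tranche 106 for its Theorem 1.2 / Corollary 1.3; PREPRINT arXiv:2410.03166, v1 2024-10-04, v2 2025-03-25 (`primaries/arxivabs/abs_2410.03166.html`, read-only GET 2026-08-23); the statements below exist in v2 ONLY, arXiv v2 PDF text `pdf-arxiv-2410.03166v2`), Seiji Kuga – Masao Tsuzuki, p0001:L1 "An asymptotic formula of spectral average of central $L$-values on ${\bf GSp}(2)$ for square free levels" — §1, THE LEAD AND COROLLARY 1.4, THE TYPED STATEMENT: p0006:L22-30 "Theorem 1.2 is deduced from Theorem 6.11 with an error term whose d ependence onfS ∈ ⊗p∈SHp is explicit: this version is more important in potential applications. As one of such applications, in §7, we prove the following. Corollary 1.4. Let l ∈ 2Z⩾ 7. Let M and D < 0 be fundamental discriminants prime to each other. Let p be a prime such that p ∤ MD . Then, there exists constants Np > p|DM | and Cp > 0 with the following properties: For any prime numberN > Np, there exists an irreducible cuspidal automorphic represe ntation Π of GL4(A) such that (i) The JPSS-conductor of Π is N 2," […] p0006:L33 "(iii) Π is of symplectic type, i.e.,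 L(s, Π, ∧2) has a pole at s = 1," [(iv) L(1/2, Π) L(1/2, Π × κ_M) L(1/2, Π × κ_D) ≠ 0,] p0006:L47-48 "(v) dim Q Q(Π) ⩾ Cp √log logN ." — §7, THEOREM 7.3 (the corollary's first half): p0036:L42-44 "Theorem 7.3. There exist constants Np > DM and Cp > 0 with the following properties: For any prime number N > Np, there exists π ∈ Π cusp(l,N )G,new such that" [• L(1/2, π × μ) ≠ 0 and L(1/2, π) L(1/2, π, κ_D) ≠ 0, •] p0036:L58-59 "• [Q(π) : Q] ⩾ Cp √log logN , where Q(π) is the ﬁeld of rationality of π." — LEMMA 7.4 (its second half): p0037:L6-11 "We need the notion of regular-algebraicity of irreducible cuspidal re presentations of GLn in the sense of [3, Deﬁnition 3.12]. Lemma 7.4. Let π ∈ Π E,Λ cusp(l,N )G,new and σ ∈ Aut(C). Let ψ = πGL ⊠ 1SL2(C) be the global Arthur parameter of π, where πGL is an irreducible cuspidal automorphic representation of GL4(A) of symplectic type." p0037:L12-17 "(i) We have σπ ∈ Π cusp(l,N )G,new. When Λ = χ ◦ NE/Q for some ﬁnite order characterχ of A×/Q×, we have σπ ∈ Π E,σ◦Λ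 cusp (l,N )G,new. (ii) We have that πGL is regular algebraic, and σψ := σπGL ⊠ 1SL2(C) is the global Arhtur parameter of σπ. (iii) We have Q(π) = Q(πGL), and that the JPSS conductor of πGL is N 2." p0037:L18 "(iv) For any ﬁnite order character η of A×/Q×, L" [(1/2, π, η)] p0037:L22 "̸= 0 if and only if" [L(1/2, σπ, σ∘η) ≠ 0.] — the assembly: p0038:L30-32 "We deal with Λ ∈ ˆCl(E) in this work; however, this proof works on a general Λ having ramiﬁcations. Corollary 1.4 follows from Theorem 7.3 applied to ( Λ,µ ) = (1,κM ) and Lemma 7.4." [cite: KugaTsuzuki2024SpectralAverage, Cor. 1.4 (v2 p0006:L25-48), Thm 7.3 (v2 p0036:L42-59), Lemma 7.4 (v2 p0037:L8-27), §7 end (v2 p0038:L30-32)] -/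
  KTrationality : Prop

variable (ν : Nodes) (μ : Mok2015.Nodes) (κ : KMSW2014.Nodes) (c : Consumers) (c₈₉ : Consumers89) (c₁₀₇ : Consumers107)

-- Verbatim lines kept out of docstrings by the register's lint (sentences naming a conj., titles with the word, bibliography entries):
-- C226 (`paper-arxiv-2205.09503`) title: p0001:L2-4 "ON THE GROSS-PRASAD CONJECTURE WITH ITS REFINEMENT FOR (SO (5), SO (2)) AND THE GENERALIZED B ¨OCHERER CONJECTURE"
-- C226 the lead sentence of Corollary 1.1 in full: p0009:L28-29 "As a corollary of Theorem 1.2, we prove the (SO(5), SO(2)) case of the Gan- Gross-Prasad conjecture in the form as stated in [32, Conjec ture 24.1]."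
-- C226 bibliography [3] / [32] / [77] / [115]: p0094:L125-126 "[3] J. Arthur, The endoscopic classiﬁcation of representations. Orthogo nal and symplectic groups. Amer. Math. Soc. Colloq. Publ. 61, xviii+590 pp. Amer. Math. Soc., Providence, RI, 2013." / p0095:L49-51 "[32] W. T. Gan, B. Gross and D. Prasad, Symplectic local root numbers, central critical L values, and restriction problems in the representation theory of classical groups. Sur les conjectures de Gross et Prasad. I. Ast ´erisque No. 346 (2012), 1–109." / p0097:L34-35 "[77] Z. Luo, A local trace formula for the local Gan-Gross-Prasad conjecture for special orthogonal groups. Preprint, arXiv:2009.13947" / p0099:L7-9 "[115] J.-L. Waldspurger, La conjecture locale de Gross-Prasad pour les repr ´esentations temp ´er´ees des groupes sp ´eciaux orthogonaux. Sur les conjectures de Gross et Prasad. II Ast ´erisque 347, 103–165 (2012)"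
-- C271 (`pdf-arxiv-2410.03166v2`) bibliography [1] / [8] / [9] / [35] / [39]: p0065:L29-31 "[1] Arthur, J., The endoscopic classiﬁcation of representations. orthogo nal and symplectic groups , American Mathematical Society Colloquium Publications, vol. 61, Amer ican Mathematical Society, Providence, RI," / p0065:L45-47 "[8] Furusawa, M., Morimoto, K., On the Gross-Prasad conjecture with its reﬁnement for (SO(5), SO(2)) and the generalized B¨ ocherer’s conjecture, Compos. Math. 160(2024), no. 9, 2115–2202." / p0065:L48 "[9] Gee, T., Taibi, O., Arthur’s multiplicity formula for GSp4 and restriction to Sp4. J. Ec." / p0066:L40 "[35] Shin, S.W., Templier,N., On ﬁelds of rationality for automorphic representations , Compos." / p0066:L48-49 "[39] Sakugawa, K., Sugiyama, S., Integrality of Hecke eigenvalues and the growth of Hecke ﬁel ds, (preprint) arXiv: 2401.11716v1."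

/-- Row C226's COROLLARY 1.1 ⇐ ITS THEOREM 1.2 — the place is Remark 1.9: p0009:L53-54 "Remark 1.9. The equivalence between the conditions (1) and (2) is immediate from Theorem 1.2. The equivalence" [(1.6.3): α^{Λ_v,ψ}_{ξ,v} ≢ 0 ⟺ Hom_{R_{ξ,v}}(π_v, χ^{ξ,Λ}_v) ≠ {0}] p0009:L61-62 "is proved by Waldspurger [115] at any non-archimedean place /u1D463and by Luo [77] recently at any archimedean place /u1D463, respectively." — Theorem 1.2 (p0008:L9-10 "Theorem 1.2. Let (/u1D70B,/u1D449/u1D70B) be an irreducible cuspidal tempered automorphic rep- resentation of/u1D43A/u1D437(A) with a trivial central character." … the Ichino – Ikeda type formula (1.6.2)) = row C226's `Consumers89.FMrefined` (tranche 89, `Downstream25.lean`: ⇐ Mok at all ranks ∧ row C67 `Consumers34.FurusawaMorimoto` ∧ row C24 `Consumers34.BPlocalGGP`); the local equivalence (1.6.3) rests on Waldspurger [115] (Astérisque 347, 2012) and Luo [77] (a 2020 preprint on the archimedean local GGP for special orthogonal groups) — neither cites the book, Mok or KMSW: absorbed (Arthur-2013-free as printed); [32, Conj. 24.1] = Gan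 – Gross – Prasad, Astérisque 346 (the statement being proved, bibliography in the comment block). [cite: FurusawaMorimoto2024SO5, Cor. 1.1 with Rem. 1.9 (page p0009:L28-62), Thm 1.2 (page p0008:L9-10) (edge as printed)] -/
def E_FMggpEquiv : Prop := c₈₉.FMrefined → c₁₀₇.FMggpEquiv

/-- Row C271's COROLLARY 1.4 (v2) ⇐ THE BOOK BY NAME AND ROW C226's COROLLARY 1.1 — the places: the assembly p0038:L30-32 "We deal with Λ ∈ ˆCl(E) in this work; however, this proof works on a general Λ having ramiﬁcations. Corollary 1.4 follows from Theorem 7.3 applied to ( Λ,µ ) = (1,κM ) and Lemma 7.4."; Theorem 7.3's proof: p0036:L60 "Proof. We follow the argument described in [39, §3.2]. We consider the set" […] p0036:L75 "To have a lower bound, we need a version of [35, Lemma 6.1 6] for PGSp2" p0036:L76-78 "with the Plancherel measureµPl p therein being replaced with our mΛ,µ p ; the same proof" p0037:L1-5 "works since the Lebesgue measure on (iR)2/W (∼= [Y 0 p ]) is absolutely continuous with respect to mΛ,µ p . Then, we argue in the same way as [39, §3.2], using Theorem 7.2 instead of [22, Theorem 1.1], to have the lower bound # Y(p,N ) ≫p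 (logN)2. □" — Theorem 7.2's proof: p0036:L29 "Proof. From Theorem 6.11 combined with [20, Theorem 5.4], we obtain the form ula" p0036:L30-32 "with the error term (6.15) ( σ = 2 + ε) and O(N − 3 2 ∥fp,k∥1) which comes from the Saito-Kurokawa representations and the Yoshida type represen tations. By Lemma" p0036:L33 "7.1, the error term amounts to a sum of terms of the form pAN −B (A ∈ R,B > 0)" [p^A N^{−B}] — the summation sets Π^{(E,Λ)}_cusp(l,N)^{G,new} are defined through the Arthur parameter: p0005:L33-36 "cusp (l,N )G,new be the set of π ∈ Π (E,Λ) cusp (l,N ) whose Arthur parameter is of the form πGL ⊠ 1SL2(C) with πGL an irreducible cuspidal automorphic representation of GL4(A) such that L(s,π GL, ∧2) has a pole at s = 1 ([1] and [9], see also [33])." ([1] = the book, [9] = Gee – Taïbi = row A4, [33] = Schmidt 2018 = row C180 — definitional pointers, as in tranche 106); Lemma 7.4's proof, THE BY-NAME USE OF THE CLASSIFICATION: p0037:L44-45 "σπGL is also of symplectic type. Thus, we have a global A-parameter σψ := σπGL ⊠ 1SL2(C) of G. We claim that σπ is of general type belonging to the A-packet Π σψ." […] p0037:L50-56 "5.3.1]).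 Thus, LS(s,σπ) = LS(s,σπGL). On the other hand, since σπ is a cuspidal automorphic representation of G(A), it belongs to some global A-packet Π ψ′ with a global A-parameter ψ′. For suﬃciently larger S, the partial L-function LS(s,σπ) coincides with the standard partial L-function LS(s,ξ ) of an isobaric automorphic representation ξ of GL4(A) determined by ψ′. Thus, LS(s,σΠ) = LS(s,σπ) = LS(s,ξ ). By [17, Theorem (4.4)], we conclude that σπGL = ξ, i.e., σψ = ψ′, which in particular means that σπ is also of general type." — and THE USE OF [8, Corollary 1.1] (twice): p0037:L57-61 "It remains to show that σπ has a global (E,σ ◦ Λ)-Bessel model. At this point, we use the assumption that Λ is of the form χ ◦ NE/Q, so that ˆL(s,σπ × AI(σ ◦ Λ)) = ˆL(s,σπGL ×σ ◦χ)ˆL(s,σπGL ×σ ◦χκD) for all σ ∈ Aut(C). By [8, Corollary 1.1], we haveL(1/2,π × AI(Λ)) ̸= 0 and πv has local (Ev, Λv)-Bessel model for all v. Thus, ˆL(1/2,π GL ×χ)ˆL(1/2,π GL ×χκD) ̸= 0. By [11, Theorem 7.1.2], there exists a system" p0038:L1 "of elements Ω( σπ) ∈ C×/Q(πGL)× such that,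 for any ﬁnite order η ∈ ˆA×/Q×," […] p0038:L14 "Thus, by [8, Corollary 1.1] once again, σπ admits a global ( E,σ ◦ Λ)-Bessel model." p0038:L15 "This complete the proof of (i) and (ii)." — [1] = J. Arthur, *The Endoscopic Classification of Representations* (bibliography [1] in the comment block) ↦ `∀ N, ν.Everything N` (the register's by-name binding, tranches 19 – 29, 104 – 106: every cuspidal σπ of G = PGSp₂ ≅ SO(5) lies in a global A-packet with an isobaric parameter on GL₄); [8, Corollary 1.1] = row C226's new node `FMggpEquiv`; [3] = Clozel (regular algebraicity, Théorème 3.13), [11] = Grobner – Raghuram (with Gan), [12], [17] = Jacquet – Shalika, [18], [20] = the authors' Rankin – Selberg paper (census E8, Arthur-free by design), [28], [32], [35] = Shin – Templier, Compositio 150 (2014) = census row C220's text, of which only the measure-theoretic Lemma 6.16 is ADAPTED to the measure m_p^{Λ,μ} ([read: the same proof works]) — no typed statement of C220 is invoked, [39] = Sakugawa – Sugiyama (census E65, Arthur-free): published or Arthur-2013-free as used, absorbed; Theorem 7.2 ⇐ Theorem 6.11 ∧ [20, Theorem 5.4] (the paper's own relative trace formula; ingredient (ii) of §6.5 — p0035:L1-5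 "(ii) (The existence of a transfer to GL4 [1] cf. [32]) Either there exists an irre- ducible cuspidal automorphic representation Π of GL4(A) of symplectic type such that L(s, Π) = L(s,π ), or there exists a pair of irreducible cuspidal au- tomorphic representations ( σ1,σ 2) of GL2(A) such that L(s,σ 1)L(s,σ 2) = L(s,π ). Then, by [23], L" [(1/2, π, μ)] p0035:L9 "⩾ 0 for any µ with µ2 = 1." — is printed for Theorem 1.2, not for Theorems 7.2 / 7.3, and is covered by the same by-name premise). [cite: KugaTsuzuki2024SpectralAverage, §7: Thm 7.2 proof (v2 p0036:L29-33), Thm 7.3 proof (v2 p0036:L60-78, p0037:L1-5), Lemma 7.4 proof (v2 p0037:L28-61, p0038:L1-15), Cor. 1.4 (v2 p0038:L30-32), §1.1 (v2 p0005:L33-36); Arthur2013, Thm 1.5.2 (as [1]); FurusawaMorimoto2024SO5, Cor. 1.1 (as [8]) (edges as printed)] -/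
def E_KTrationality : Prop := (∀ N, ν.Everything N) → c₁₀₇.FMggpEquiv → c₁₀₇.KTrationality

/-- The hundred-and-seventh tranche of implications (C226's new node: one edge from the row's Theorem 1.2; C271's new node: one edge from the book by name ∧ C226's new node). [cite: FurusawaMorimoto2024SO5, Cor. 1.1; KugaTsuzuki2024SpectralAverage, Cor. 1.4 (edges as printed)] -/
structure Implications107 : Prop where
  ggp : E_FMggpEquiv c₈₉ c₁₀₇
  ktR : E_KTrationality ν c₁₀₇

variable {ν μ κ c c₈₉ c₁₀₇}
variable {c₈ : Consumers8} {c₃₃ : Consumers33} {c₃₄ : Consumers34}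

/-- C226's COROLLARY 1.1 GIVEN ITS THEOREM 1.2. [cite: FurusawaMorimoto2024SO5, Cor. 1.1 (bookkeeping proved here)] -/
theorem fmggpEquiv_of_rows (X : Implications107 ν c₈₉ c₁₀₇) (hR : c₈₉.FMrefined) : c₁₀₇.FMggpEquiv :=
  X.ggp hR

/-- C226's COROLLARY 1.1 FROM THE INPUTS OF MOK's DAG AND KMSW's PROVED SCOPE, through tranche 89's `fmRefined_of_inputs` (Theorem 1.2 ⇐ Mok ∧ C67 ∧ C24, with tranche 34's
edges); nothing of the book's own DAG enters this node (tranche 89's reading of Theorem 1.2 is Mok-side). [cite: FurusawaMorimoto2024SO5, Cor. 1.1, Thm 1.2 (bookkeeping proved here)] [claim: KalethaMinguezShinWhite2014, under-review] -/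
theorem fmggpEquiv_of_inputs (X : Implications107 ν c₈₉ c₁₀₇) (X₈₉ : Implications89 ν μ c c₈ c₃₄ c₈₉) (T : Implications34 μ κ c₃₃ c₃₄) (M : MokInputs μ)
    (K : KMSWInputs μ κ) : c₁₀₇.FMggpEquiv :=
  X.ggp (fmRefined_of_inputs X₈₉ T M K)

/-- C226's COROLLARY 1.1 IN CONDITIONAL FORM, 2026 (PUBLISHED 2024; [read: is immediate from Theorem 1.2]; no status sentence at the corollary): granting Mok's internal
derivations, supply edges and PUBLISHED inputs, KMSW's chapter / supply edges and published inputs, KMSW's Mok import and the identification of the two copies of the general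
weighted fundamental lemma, and the edges of tranches 34 / 89, the (SO(5), SO(2)) GGP equivalence for tempered π is conditional on MOK's 2024–2026 preprint layer and on Mok's
general / non-standard weighted fundamental lemmas. [cite: FurusawaMorimoto2024SO5, Cor. 1.1 (bookkeeping proved here)] [claim: KalethaMinguezShinWhite2014, under-review] -/
theorem fmggpEquiv_conditional_form (X : Implications107 ν c₈₉ c₁₀₇) (X₈₉ : Implications89 ν μ c c₈ c₃₄ c₈₉) (T : Implications34 μ κ c₃₃ c₃₄)
    (D1 : KMSW2014.E_ImportMok μ κ) (D3 : KMSW2014.E_SameWFL μ κ) (MB : μ.SectionEdges) (MS : μ.SupplyEdges) (MP : μ.PublishedLeaves) (KB : κ.ChapterEdges)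
    (KS : κ.SupplyEdges) (KP : κ.PublishedLeaves) :
    μ.PreprintLeaves2026 → μ.WFL_general → μ.WFL_nonstandard → c₁₀₇.FMggpEquiv :=
  fun hMQ m6 m7 => X.ggp (fmRefined_conditional_form X₈₉ T D1 D3 MB MS MP KB KS KP hMQ m6 m7)

/-- C271's COROLLARY 1.4 GIVEN THE BOOK BY NAME AND C226's COROLLARY 1.1. [cite: KugaTsuzuki2024SpectralAverage, Cor. 1.4 (bookkeeping proved here)] -/
theorem ktRationality_of_rows (X : Implications107 ν c₈₉ c₁₀₇) (hν : ∀ N, ν.Everything N) (hG : c₁₀₇.FMggpEquiv) : c₁₀₇.KTrationality :=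
  X.ktR hν hG

/-- C271's COROLLARY 1.4 FROM THE INPUTS OF ALL THREE DAGs: the book (by name) and — through C226's Corollary 1.1 ⇐ Theorem 1.2 ⇐ Mok ∧ C67 ∧ C24 (tranches 89 / 34) — Mok's
inputs and KMSW's proved scope. [cite: KugaTsuzuki2024SpectralAverage, Cor. 1.4; FurusawaMorimoto2024SO5, Cor. 1.1 (bookkeeping proved here)] [claim: KalethaMinguezShinWhite2014, under-review] -/
theorem ktRationality_of_inputs (X : Implications107 ν c₈₉ c₁₀₇) (X₈₉ : Implications89 ν μ c c₈ c₃₄ c₈₉) (T : Implications34 μ κ c₃₃ c₃₄) (A : BookInputs ν)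
    (M : MokInputs μ) (K : KMSWInputs μ κ) : c₁₀₇.KTrationality :=
  X.ktR A.everything (fmggpEquiv_of_inputs X X₈₉ T M K)

/-- C271's COROLLARY 1.4 IN CONDITIONAL FORM, 2026 (PREPRINT, v2 2025; [read: it belongs to some global A-packet]; [read: By [8, Corollary 1.1]]; no status sentence):
granting the book's and Mok's internal derivations, supply edges and PUBLISHED inputs, KMSW's chapter / supply edges and published inputs, KMSW's Mok import and the
identification of the two copies of the general weighted fundamental lemma, and the edges of tranches 34 / 89, the existence of the cuspidal Π on GL₄ with conductor N²,
non-vanishing twisted central values and [ℚ(Π) : ℚ] ≥ C_p √(log log N) is conditional on the BOOK's 2024–2026 preprint layer and two weighted fundamental lemmas AND on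
MOK's 2024–2026 preprint layer and Mok's general / non-standard weighted fundamental lemmas. [cite: KugaTsuzuki2024SpectralAverage, Cor. 1.4 (bookkeeping proved here)] [claim: KalethaMinguezShinWhite2014, under-review] -/
theorem ktRationality_conditional_form (X : Implications107 ν c₈₉ c₁₀₇) (X₈₉ : Implications89 ν μ c c₈ c₃₄ c₈₉) (T : Implications34 μ κ c₃₃ c₃₄)
    (B : ν.BookEdges) (S : ν.SupplyEdges) (P : ν.PublishedLeaves) (D1 : KMSW2014.E_ImportMok μ κ) (D3 : KMSW2014.E_SameWFL μ κ) (MB : μ.SectionEdges)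
    (MS : μ.SupplyEdges) (MP : μ.PublishedLeaves) (KB : κ.ChapterEdges) (KS : κ.SupplyEdges) (KP : κ.PublishedLeaves) :
    ν.PreprintLeaves2026 → ν.WFL_general → ν.WFL_nonstandard → μ.PreprintLeaves2026 → μ.WFL_general → μ.WFL_nonstandard → c₁₀₇.KTrationality :=
  fun hQ h6 h7 hMQ m6 m7 =>
    have A : BookInputs ν := ⟨B, S, P, hQ, ⟨h6, h7⟩⟩
    X.ktR A.everything (fmggpEquiv_conditional_form X X₈₉ T D1 D3 MB MS MP KB KS KP hMQ m6 m7)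

/-- THE WHOLE HUNDRED-AND-SEVENTH TRANCHE FROM THE INPUTS OF THE THREE DAGs AND THE EARLIER TRANCHES' EDGES (C226's Corollary 1.1: Mok ∪ KMSW's import through Theorem 1.2;
C271's Corollary 1.4: the book by name and that node). [cite: FurusawaMorimoto2024SO5, Cor. 1.1; KugaTsuzuki2024SpectralAverage, Cor. 1.4 (bookkeeping proved here)] [claim: KalethaMinguezShinWhite2014, under-review] -/
theorem hundredseventh_of_inputs (X : Implications107 ν c₈₉ c₁₀₇) (X₈₉ : Implications89 ν μ c c₈ c₃₄ c₈₉) (T : Implications34 μ κ c₃₃ c₃₄) (A : BookInputs ν)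
    (M : MokInputs μ) (K : KMSWInputs μ κ) : c₁₀₇.FMggpEquiv ∧ c₁₀₇.KTrationality :=
  have g : c₁₀₇.FMggpEquiv := fmggpEquiv_of_inputs X X₈₉ T M K
  ⟨g, X.ktR A.everything g⟩

/-! ## Hundred-and-eighth tranche (v2, unit `pub-arthur-down-g42`): THE MOK-2014 CONDUIT VEIN — NEW rows C273 `HTunitaryU4` / `HTstandardGSp4` (⇐ C191) and `HTsymTower`
(⇐ C177), C274 `JonesQzeta12` (⇐ C191), C275 node `TJlgc` (⇐ C191) with `TJdescent` (⇐ it), C276 `HWangLevelLowering` (⇐ C191), C277 `BMSWunobstructed` (⇐ C191)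

Context (C273 – C277 ABSENT from `DOWNSTREAM.md` … `DOWNSTREAM4.md`; NEW rows, block `[g42b]` of `DOWNSTREAM4.md`; typed premises reused: row C191 `Consumers28.MokGSp4` (C.-P. Mok,
Compositio Math. 150 (2014) = arXiv:1109.5392; tranche 28, `Downstream5.lean`: `mokGSp4_of_leaves` ⇐ book ∧ A4, `mokGSp4_conditional_form`) and row C177
`Consumers18.ClozelThorne2` (Clozel – Thorne, Ann. of Math. 181 (2015); tranche 18, `Downstream3.lean`: `clozelThorne2_of_leaves` ⇐ Mok ∧ KMSW's node `StabOrdI`,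
`ct2_conditional_form`) — both in the transitive closure of this file's import).  Texts under `HOME/pub-arthur-down-g42/primaries/` (`SHA256SUMS`):
`paper-doi-10-1017-s1474748018000476` (C273; the HAL hal-01398905 v1 (2016) text, 35 pp.), `paper-arxiv-1505.01812` (C274; corpus TeX), `paper-doi-10-1016-j-jnt-2018-11-012`
(C275; the authors' accepted manuscript, 40 pp.), `paper-arxiv-1910.07569` (C276; corpus TeX, v1 wording), `paper-arxiv-2009.06575` (C277; corpus TeX).  Loci: C273 p0001:L1-3,
p0004:L18-30, p0005:L5-23, p0007:L12-15, L35-37, p0021:L16-39, p0022:L5-22, p0023:L40-42, p0024:L33-55, p0025:L5-64, p0034:L70-75, p0035:L45-46; C274 p0001:L1, p0002:L3, L13, L19,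
p0004:L7-9, p0012:L9, L17, p0017:L60; C275 p0001:L10-11, p0003:L1-18, p0005:L37-38, p0031:L30-45, p0032:L12-15, p0035:L4-15, p0040:L15-16, L25-26; C276 p0001:L1, p0004:L7-23,
p0009:L98, p0010:L13-16, p0021:L68-70; C277 p0001:L1, p0002:L3-48, p0004:L49-83. -/

/-- NEW rows C273 (Hida – Tilouine 2020), C274 (Jones 2016), C275 (Tsaltas – Jarvis 2019), C276 (H. Wang 2019/2022), C277 (Broshi – Mullath – Sorensen – Weston 2020) of the census, as an arbitrary assignment of propositions; nothing about the content of a field is assumed. [cite: Arthur2013, downstream register of the cell, hundred-and-eighth tranche (structure only)] -/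
structure Consumers108 where
  /-- C273, first statement (NEW census row, block `[g42b]` of `DOWNSTREAM4.md`; PUBLISHED: J. Inst. Math. Jussieu 19 (2020), no. 5, 1521–1572, doi:10.1017/S1474748018000476 (Crossref via `lit cite`; online 2018); typed on the HAL preprint text hal-01398905 v1 (2016), `paper-doi-10-1017-s1474748018000476` — the journal text was NOT compared), Haruzo Hida – Jacques Tilouine, p0001:L1-2 "SYMMETRIC POWER CONGRUENCE IDEALS AND SELMER GROUPS" — p0001:L3 "Haruzo Hida, Jacques Tilouine" — THE GOAL: p0004:L18-20 "The goal of this paper is to establish analogues of part (a) of the theorem above for higher j’s, provided the automorphic base change is established for Symmm for certain values of m less than 2j." — THEOREM 1.3 (the case j = 2 is the typed statement, made precise in §3.2 as Corollaries 3.6 / 3.7; Corollary 4.3 of §4 re-uses the same morphism θ′): p0004:L21-25 "Theorem 1.3. Assume (∗) and 3(a + 1) < p − 1. Then, • for j = 3, the characteristic power series of Sel(Ajµ )∗ is a generator of the ideal of congruences between the family Symm3 µ and Siegel families which are not of the form Symm3 µ0 for other GL2 -families µ0 , • for j = 2, the characteristic power series of Sel(Ajµ )∗ is a generator of the congruence ideal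 between the family Symm3 µ and families on U (4) which don’t come from Siegel families." — COROLLARY 3.6: p0022:L5-9 "Corollary 3.6. Assume (∗). 1) Assume either α12 6≡ 1 (mod mA1 ) or 3(a + 1) < p − 1, then the ideals cλ0 , cλ λ(cθ0 ) and cθ0 are principal and we have the relation cλ0 = cλ λ(cθ0 ). 2) If one assumes 3(a + 1) < p − 1, one has moreover that cλ0 is generated by Char(Sel(Adsp4 ρµ ))," — COROLLARY 3.7: p0022:L15 "Note that the associated primes of λ(cθ0 ) in A" [Ã₁] p0022:L14 "e1 are congruence primes between Symm3 (µ) and" p0022:L16 "unitary families which don’t come from Siegel families." […] p0022:L22 "Corollary 3.7. The ideal λ(cθ0 ) is principal generated by Char(Sel(A2µ ))∗ ." — COROLLARY 4.3: p0023:L40-42 "Corollary 4.3. We have cλ00 = cλ λ(cθ00 ). Moreover, the congruence ideal λ(cθ0 ) divides λ(cθ00 ) and" [λ(c_θ″)/λ(c_θ′) = Char(Sel(A⁴μ)*)] [cite: HidaTilouine2020SymmetricPower, Thm 1.3 (j = 2) = Cors 3.6-3.7, Cor. 4.3 (pages p0004:L21-25, p0022:L5-22, p0023:L40-42)] -/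
  HTunitaryU4 : Prop
  /-- C273, second statement: §7, THE STANDARD REPRESENTATION OF GSp(4) — the announcement: p0005:L14-23 "We finally give an analogue result starting from a Hida family σ on GSp4 (Q) instead of a Hida family µ on GL2 (Q). The method and result are similar although the Hida family σ is two variable so that the commutative algebra results involve three–dimensional local rings, so that we can only compare localizations at height one primes of the congruence ideal and the characteristic power series of the standard (degree 5) Selmer group. The tool this time is the base change from GSp4 (Q) to U (4) (for an imaginary quadratic field) established by C.-P. Mok [Mok14] and [Clo91] and the conclusion is that the two variable characteristic power series of the degree 5 Galois representation associated to the family σ generates the height one part of the ideal of congruences between the base change of σ to U (4) and families on U (4) which don’t come from GSp4 (Q). See Section 7 for the statement and the proof." — THEOREM 7.1: p0025:L38-39 "Theorem 7.1. Assume a1 + a2 + 3 < p − 1; then we have R2 = Ts2 and R3 = Tu3 , and the rings Ts2 resp. Tu3 is local complete intersection over Λ2 resp. Λ3 ." — THEOREM 7.2: p0025:L60 "Theorem 7.2. The reflexive envelope σ(c"[^_θ′]) p0025:L61 "of the ideal σ(cθ 0 ) of A2 is principal and is generated" p0025:L62 "by Char((Sel(Stσ ))∗ )." [cite: HidaTilouine2020SymmetricPower,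 §7 Thms 7.1-7.2 (pages p0005:L14-23, p0025:L38-39, L60-62)] -/
  HTstandardGSp4 : Prop
  /-- C273, third statement: THEOREM 1.6 APPLIED for n = 5, …, 8 (the theorem itself carries the symmetric-power transfers as an explicit hypothesis; the typed statement is the application the authors assert): p0005:L5-11 "Theorem 1.6. Assume (∗) and that p − 1 > n(a + 1). Assume also that N has at least two prime factors. Assume that the transfers Symmn−1 and Symmn from GL2 (Q) to GLn resp. GLn+1 are established. Then, the characteristic power series of Sel(Anµ )∗ is a generator of the quotient of the congruence ideal between the family Symmn µ and families of unitary forms on U (n + 1) by the congruence ideal between the family Symmn−1 µ and families of unitary forms on U (n). In particular, the quotient of these ideals is integral and principal." — p0005:L12-13 "This theorem applies for n = 5, 6, 7, 8 by [CT15] where the Symmm transfer is established for m ≤ 8. See Section 6 for a more precise statement and the proof." — §6: p0024:L33-35 "Theorem 6.1. Assuming (∗), n(a + 1) < p − 1, and that the transfer Symmj is established for j = n − 1, n, then for j = n − 1, n, we have Rj = Tuj and these rings are local complete intersection over Λj ." […] p0024:L46-47 "and dividing by the invertible ideal cµ , we conclude that λn−1 (cθn−1 ) divides λn (cθn ) and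 that the" p0024:L49 "quotient is the principal ideal Char(Sel Anµ ) ." — p0024:L50-51 "This theorem applies to n = 4, 5, 6, 7, 8 since the transfers Symmj , j = 3, 4, 5, 6, 7, 8 of a classical form of weight ≥ 2 have been established in [CT15]. For n = 4, we obtain a different proof of the" […] p0024:L54-55 "Symm3 , resp. Symm4 transfers and families on U (4) resp. U (5). For n ≥ 5, there is no alternative proof because there is no known transfer from GSp4 to U (n + 1) compatible to Symm3 and Symmn ." [cite: HidaTilouine2020SymmetricPower, Thm 1.6 with p0005:L12-13, Thm 6.1 and §6 (pages p0005:L5-13, p0024:L33-55)] -/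
  HTsymTower : Prop
  /-- C274 (NEW census row, block `[g42b]`; PUBLISHED: LMS J. Comput. Math. 19 (2016) 155–174, doi:10.1112/S1461157016000048 (arXiv journal-ref); corpus TeX `paper-arxiv-1505.01812` = arXiv v1 2015-05-07, the only version), Andrew Jones, p0001:L1 "Modular elliptic curves over the field of twelfth roots of unity" — p0002:L3 "In this article we perform an extensive study of the spaces of automorphic forms for $\mathrm{GL}_2$ of weight two and level $\mathfrak{n}$, for $\mathfrak{n}$ an ideal in the ring of integers of the quartic CM field $\mq(\zeta_{12})$ of twelfth roots of unity. This study is conducted through the computation of the Hecke module $H^*(\Gamma_0(\mathfrak{n}),\mc)$, and the corresponding Hecke action. Combining this Hecke data with the Faltings-Serre method for proving equivalence of Galois representations, we are able to provide the first known examples of modular elliptic curves over this field." — §5, THE TYPED STATEMENT (the modularity of the elliptic curves of Table 5.10 over ℚ(ζ₁₂)): p0012:L9 "In Table 5.10 (on the following page) we list the coefficients" […] p0012:L17 "For each of the elliptic curves appearing in Table 5.10, we list a set of primes $\mathfrak{p}$ of $F$ which suffice to prove modularity of the curve" [cite: Jones2016TwelfthRoots, §5 with Table 5.10 (chunks p0002:L3,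 p0012:L9-17)] -/
  JonesQzeta12 : Prop
  /-- C275, first statement = a HYPOTHESIS NODE (NEW census row, block `[g42b]`; PUBLISHED: J. Number Theory 199 (2019) 251–288, doi:10.1016/j.jnt.2018.11.012; typed on the authors' accepted manuscript (White Rose eprint 140012), `paper-doi-10-1016-j-jnt-2018-11-012`: p0001:L10 "Tsaltas, K. and Jarvis, A.F. (2019) Descending congruences of theta lifts on GSp4. Journal" p0001:L11 "of Number Theory, 199. pp. 251-288. ISSN: 0022-314X"), Konstantinos Tsaltas – Frazer Jarvis, p0003:L1 "Descending congruences of theta lifts on GSp4" — p0003:L2 "Konstantinos Tsaltas1" / p0003:L5 "Frazer Jarvis∗" — p0003:L9-18 "We study the question of when a congruence between two theta lifts on GSp4/Q descends to a congruence on modular forms on GL2 over a quadratic ﬁeld. In order to accomplish that, we use the theory of the local theta correspondence between similitude orthogonal groups and the similitude symplectic group GSp4 , together with a classiﬁcation for the degeneration modulo a prime of conductors for the L-parameters of irreducible admissible representations of GSp4 over a non-archimedean local ﬁeld. We explain that this is unlikely to be used in conjunction with existing results on congruences for GSp4/Q to deduce a theory of congruences over imaginary quadratic ﬁelds. On the other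 hand, we prove a result which does give some such congruence results by twisting." — THE STANDING ASSUMPTION OF §4 (full local-global compatibility for the Galois representation R attached to the theta lift Π): p0031:L30-32 "R : GQ → GSp4 (Qℓ ) is the associated Galois representation to Π, we will assume full local-global compatibility8 ; thus, for all p, we have" [R_p ≅ R|_{D_p}] [cite: TsaltasJarvis2019Descending, §4 (page p0031:L30-33)] -/
  TJlgc : Prop
  /-- C275, second statement: THEOREM 4.2, THE TYPED CONSUMER (under the standing assumption): p0032:L12-15 "Theorem 4.2. Under the assumptions above, the congruence between Π and Π′ descends to a congruence between the cuspidal automorphic representation π, and another automorphic representation π ′ for GL2 over the imaginary quadratic ﬁeld K." [cite: TsaltasJarvis2019Descending, Thm 4.2 (page p0032:L12-15)] -/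
  TJdescent : Prop
  /-- C276 (NEW census row, block `[g42b]`; PREPRINT arXiv:1910.07569, v1 2019-10-16 (the corpus TeX `paper-arxiv-1910.07569` carries the v1 title and wording), v3 2022-09-23 retitled *Level lowering on Siegel modular threefold of paramodular level* (`primaries/arxivabs/abs_1910.07569.html`, read-only GET 2026-08-23; no journal reference)), Haining Wang, p0001:L1 "Level lowering for GSp(4) and vanishing cycles on Siegel threefolds" — THEOREM 1 (Mazur's principle for paramodular level): p0004:L7-8 "Theorem 1. Let $\pi$ be a cuspidal automorphic representation of $\GSp_{4}$ that is cohomological which is non-CAP and non-endoscopic whose component at infinity $\pi_{\infty}$ is a holomorphic discrete series of Harish Chandra parameter $(a, b, -a-b+3)$ with $a\geq b \geq 0$ and such that $l>a+b+4$. Let $p$ be a prime distinct from $l$ and such that $p\not\equiv 1 \mod l$. Let $U=K(p)U^{p}\subset \GSp_{4}(\QQ_{p})\GSp_{4}(\mathbb{A}^{(p)}_{f})$ be a neat open compact subgroup such that $\pi^{U}\neq 0$. We assume that $\pi_{p}$ is ramified. Suppose the residual Galois representation $\bar{\rho}_{\pi, l}$ satisfies the following assumptions" [• ρ̄ unramified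 at p; • ρ̄ irreducible; • H³_!(X_{K(p)}, 𝕍)_𝔪 ⊗ k semisimple] p0004:L16 "Then there exists a cuspidal automorphic representation $\pi^{\prime}$ with the same type as $\pi$ at $\infty$ such that $\bar{\rho}_{\pi, l}\cong \bar{\rho}_{\pi^{\prime}, l}$ and $\pi^{\prime}_{p}$ is unramified." — THEOREM 2 (Ribet's principle): p0004:L22-23 "Theorem 2. Let $\pi$ be a cuspidal automorphic representation of $\GSp_{4}$ that is cohomological which is non-CAP and non-endoscopic whose component at infinity $\pi_{\infty}$ is a holomorphic discrete series of Harish Chandra parameter $(a, b, -a-b+3)$ with $a\geq b \geq 0$ such that $l\geq a+b+4$. Let $p, q$ be two distinct primes different from $l$. Let $U=K(p)K(q)U^{pq}\subset \GSp_{4}(\QQ_{p})\GSp_{4}(\QQ_{q})\GSp_{4}(\mathbb{A}^{(p)}_{f})$ be a neat open compact subgroup such that $\pi^{U}\neq 0$. We assume that $\pi_{p}$ and $\pi_{q}$ are both ramified. Suppose the residual Galois representation $\bar{\rho}_{\pi, l}$ satisfies the following assumptions" [cite: HWang2019LevelLowering, Thms 1-2 (chunk p0004:L7-23)] -/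
  HWangLevelLowering : Prop
  /-- C277 (NEW census row, block `[g42b]`; PREPRINT arXiv:2009.06575 v1 2020-09-14, the only version (`primaries/arxivabs/abs_2009.06575.html`; authors per the abs page: Michael Broshi, Mohammed Zuhair Mullath, Claus Sorensen, Tom Weston); corpus TeX `paper-arxiv-2009.06575`, whose bibliography is not rendered), p0001:L1 "Unobstructed deformation problems for GSp(4)" — THE HYPOTHESES: p0002:L3 "Let $\pi$ be a cuspidal automorphic representation for $\GSp(4)$ over $\Q$. We assume that:" p0002:L5-6 "* The archimedean component $\pi_{\infty}$ of $\pi$ is essentially discrete series with the same central and infinitesimal character as the finite-dimensional irreducible algebraic representation of highest weight $a \geq b \geq 0$;" p0002:L8 "* $\pi$ has a unitary twist of the form $\pi \otimes ||\cdot||^{w/2}$, with $w \in \Z$;" p0002:L10 "* $\pi$ is globally generic (i.e., $\pi$ has a non-zero Whittaker-Fourier coefficient)." — THEOREM 1.1, THE TYPED STATEMENT: p0002:L33-34 "Theorem 1.1. Let $\pi$ be as above. Assume also that $\pi$ is not supercuspidal at $2$." p0002:L36 "If $a > b > 0$, then $\Hl(\GQSp,\ad \rbpp)=0$ for all but finitely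 many primes $\p$ such that $\rbpp(G_{\Q(\zeta_p)}) \subset \GL_4(\Fpbar)$ is an adequate subgroup." — REMARK 1.5 (its scope): p0002:L48 "Remark 1.5. It is not strictly necessary to assume that $\pi$ is globally generic. An analogous (but weaker) assumption on the global $L$-packet containing $\pi$ suffices. (See remark 3.2 for details.) In particular, Theorem 1.1 applies to all classical Holomorphic Siegel cusp forms of cohomological weights $k_1 \geq k_2 \geq 3$ which are not supercuspidal at 2. (The Harish-Chandra parameter of such a form is $(a, b) = (k_1-1, k_2-2)$.)" [cite: BroshiEtAl2020Unobstructed, Thm 1.1 with Rem. 1.5 (chunk p0002:L3-48)] -/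
  BMSWunobstructed : Prop

variable (ν : Nodes) (μ : Mok2015.Nodes) (κ : KMSW2014.Nodes) (c : Consumers) (c₁₈ : Consumers18) (c₁₉ : Consumers19) (c₂₈ : Consumers28) (c₁₀₈ : Consumers108)

-- Verbatim lines kept out of docstrings by the register's lint (sentences naming a conj., bibliography entries):
-- C273 (`paper-doi-10-1017-s1474748018000476`) the sentence after Corollary 3.6: p0022:L17 "Moreover, according to the Greenberg-Iwasawa main conjecture, the ideal λ(cθ0 ) should be generated by the (still conjectural) p-adic L function Lp (A2µ ). On the other hand, for p > 3, we have a"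
-- C273 Remark 7.3: p0025:L63-64 "Remark 7.3. The p-adic L function Lp (Stσ ) has been constructed by Zheng Liu in her 2016 Columbia thesis, and the main conjecture implies that σ(cθ0 ) is also generated by Lp (Stσ ). It is"
-- C273 bibliography [Clo91] / [CT14] / [CT15] / [Mok14]: p0034:L70-71 "L. Clozel, Représentations galoisiennes associées aux représentations automorphes autoduales de GL(n), Publications Mathématiques de l’IHÉS, 73 (1991), p. 97-145" / p0034:L72-73 "L. Clozel, J. Thorne, Level-raising and symmetric power functoriality, I. Compositio Mathematica, Vol. 150 (2014), No. 5, pp 729-748" / p0034:L74-75 "L. Clozel, J. Thorne, Level-raising and symmetric power functoriality, II. Annals of Mathematics, Vol. 181 (2015), No. 1, pp. 303-359" / p0035:L45-46 "C. P. Mok, Galois representations attached to automorphic forms on GL2 over a CM field, Compos. Math. 150, (2014), pp 523-567"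
-- C274 (`paper-arxiv-1505.01812`) bibliography [Mok14]: p0017:L60 "[[Mok14]] C.P. Mok: Galois representations attached to automorphic forms on $\mathrm{GL}_2$ over CM fields, Compos. Math. 150, no. 4, 2014, pp. 523-567."
-- C275 (`paper-doi-10-1016-j-jnt-2018-11-012`) bibliography [19] / [24]: p0040:L15-16 "[19] C.P.Mok, Galois representations attached to automorphic forms on GL2 over CM ﬁelds, Compos. Math. 150 (2014) 523–567" / p0040:L25-26 "[24] C.Sorensen, Galois representations attached to Hilbert-Siegel modular forms, Do. Math. 15 (2010) 623–670"
-- C276 (`paper-arxiv-1910.07569`) bibliography [Mo14]: p0021:L68-70 "[Mo14] C-P Mok, Galois representations attached to automorphic forms on ${\rm GL}_2$ over CM fields,"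

/-- C273's THEOREM 1.3 (j = 2) / COROLLARIES 3.6, 3.7, 4.3 ⇐ ROW C191 — the place is §3.2, the construction of the morphism θ′ : h^u_3 → h^s_2 through which the unitary congruence ideal λ(c_θ′) is defined: p0021:L16-21 "As already mentioned, the Symm3 base change to GL4 (Q) is established by Kim. Recall that we fixed a squarefree level N and a prime factor q1 thereof. As above, we choose an auxiliary imaginary quadratic field in which p and q1 split. We then choose a degree 16 skew field of center K with second kind involution, which ramifies exactly at those two primes. There exists a unitary group U (4) compact at infinity, quasi split at all inert primes. By Arthur and Clozel, automorphic forms can be transfered from GL2 (Q) to U (4). In his thesis [Ge10], D. Geraghty defined a Hida Hecke algebra" […] p0021:L24-25 "h2 , in order to distinguish unitary and symplectic group Hecke algebras. The Symm3 base change provides a ring homomorphism hu3 → h1 with a commutative diagram" [diagram] p0021:L37-39 "λ2 = 2n and λ3 = n. But we need a more precise information about this diagram. For this, we note that the base change from GSp4 to GL4 has also been established [Mok14], so that there is also a commutative diagram of ring homomorphisms" — [Mok14] = C.-P. Mok, *Galois representations attached to automorphic forms on GL₂ over CM fields*, Compositio Math. 150 (2014) = row C191 `Consumers28.MokGSp4`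 (tranche 28: ⇐ the book ∧ row A4; its typed content is the paper's Galois-representation theorems, of which the transfer GSp₄ → GL₄ for a simple generic parameter is the Arthur-dependent step — bound AS CITED); the Sym³ lift (Kim), the transfer GL₂ → U(4) (Arthur – Clozel 1989), Geraghty's Hida theory [Ge10], the R = T theorems of §2 for n = 4 (Kim – Shahidi / Kim): Arthur-2013-free, absorbed. [cite: HidaTilouine2020SymmetricPower, §3.2 (page p0021:L16-39), Cors 3.6-3.7 (page p0022:L5-22); Mok2014Compositio, Thm 3.1 (as [Mok14]) (edge as printed)] -/
def E_HTunitaryU4 : Prop := c₂₈.MokGSp4 → c₁₀₈.HTunitaryU4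

/-- C273's THEOREMS 7.1 / 7.2 ⇐ ROW C191 — the places: §1: « The tool this time is the base change from GSp4 (Q) » … « established by C.-P. Mok [Mok14] and [Clo91] »; §7: p0025:L5-9 "7. The case of the standard representation of GSp(4) This is a digression which does not involve symmetric powers of GL2 . Let instead consider a Hida family of Siegel cusp forms that is, a Λ2 -algebra homomorphism σ : hs2 → A2 onto a domain A2 which is finite and torsion free over Λ2 . As we noted above, using the base change from GSp(4) to GL(4) established in [Mok14] and Clozel’s descent to U (4), we constructed a morphism θ0 : hu3 → hs2 . We" — [Mok14] = row C191 (the base change GSp(4) → GL(4)); [Clo91] = Clozel, Publ. Math. IHÉS 73 (1991) (descent to U(4)): p0007:L35 "By [Clo91, Lemma 3.8 and Prop.4.11 ], ΠD" p0007:L36-37 "descends as a cuspidal representation ΠG on G (for more general results of descent from D× to G, see Labesse [Lab09, Th.5.4] and C.-P. Mok [Mok14]). The difference with [Clo91, Prop.4.11] is" — Arthur-2013-free, absorbed ([Lab09], [Mok14] there are ‘more general’ alternatives for the descent, not bound). [cite: HidaTilouine2020SymmetricPower, §1 (page p0005:L18-19), §7 (page p0025:L5-9), §2.2 (page p0007:L35-37);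 Mok2014Compositio, Thm 3.1 (as [Mok14]) (edge as printed)] -/
def E_HTstandardGSp4 : Prop := c₂₈.MokGSp4 → c₁₀₈.HTstandardGSp4

/-- C273's THEOREM 1.6 FOR n = 5, …, 8 ⇐ ROW C177 — the places: §1: p0005:L12-13 "This theorem applies for n = 5, 6, 7, 8 by [CT15] where the Symmm transfer is established for m ≤ 8. See Section 6 for a more precise statement and the proof." — §2.2: p0007:L12-14 "2.2. Symmn−1 Langlands functoriality. We assume that the Symmn−1 Langlands functoriality from GL2 to GLn is established (sending non CM classical cusp eigensystems to cuspidal eigensystems on GLn ). It is known for n − 1 ≤ 8 thanks to the works of Kim-Shahidi [KS02b], Kim [Kim03]" p0007:L15 "and Clozel-Thorne [CT14], [CT15]." — §6: p0024:L50-51 "This theorem applies to n = 4, 5, 6, 7, 8 since the transfers Symmj , j = 3, 4, 5, 6, 7, 8 of a classical form of weight ≥ 2 have been established in [CT15]. For n = 4, we obtain a different proof of the" […] p0024:L54-55 "Symm3 , resp. Symm4 transfers and families on U (4) resp. U (5). For n ≥ 5, there is no alternative proof because there is no known transfer from GSp4 to U (n + 1) compatible to Symm3 and Symmn ." — [CT15]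 = L. Clozel – J. Thorne, *Level-raising and symmetric power functoriality, II*, Ann. of Math. 181 (2015) = row C177 `Consumers18.ClozelThorne2` (tranche 18: ⇐ Mok at all ranks ∧ KMSW's node `StabOrdI`; bound AS CITED — the authors attribute the Sym^m transfers for m ≤ 8 to [CT15]; part III (Duke 2017, row C29), which constructs Sym⁶ / Sym⁸, postdates this 2016 text and is not cited); [CT14] = part I = census row C210 (whose typed node is its Proposition 2.9 (3), a different statement — named at §2.2, NOT bound); [KS02b] Kim – Shahidi, [Kim03] Kim: Arthur-free (2002 / 2003), absorbed. [cite: HidaTilouine2020SymmetricPower, Thm 1.6 application (page p0005:L12-13), §2.2 (page p0007:L12-15), §6 (page p0024:L50-55); ClozelThorne2015, Cor. 1.3 (as [CT15]) (edge as printed)] -/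
def E_HTsymTower : Prop := c₁₈.ClozelThorne2 → c₁₀₈.HTsymTower

/-- C274's MODULARITY EXAMPLES ⇐ ROW C191 — the places: §1: p0002:L13 "More recently, Mok ([Mok14]) has constructed Galois representations attached to automorphic forms defined over CM fields, subject to certain conditions on the central character of these forms (in particular, his construction covers those forms which are expected to correspond to elliptic curves)." p0002:L13 "Harris, Lan, Taylor and Thorne ([HLTT13]) and Scholze ([Sch13]) have removed these restrictions, and in fact construct Galois representations attached to regular automorphic forms for $\mathrm{Res}_{F/\mq}(\mathrm{GL}_n)$ for all $n$ over CM or totally real fields (with Scholze's results extending even further to account for “torsion automorphic forms”)." — p0002:L19 "In this paper, we shall extend these methods to the field $\mq(\zeta_{12})$, and, adapting the methodology of [DGP10], shall combine the resulting data with our knowledge of the Galois representations constructed in [Mok14] to give the first proven examples of modular elliptic curves over a quartic CM field." — §2: p0004:L7 "With this in mind, we can now state a version of the main result in [Mok14]:" p0004:L9 "Theorem 1. Let $F$ be a CM field, and let $\pi$ be a cuspidal automorphic representation of $\mathrm{Res}_{F/\mq}(\mathrm{GL}_2)$ of cohomological type, with trivial central character, and fix a prime $\ell$. Then there exists an $\ell$-adic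 Galois representation" [ρ_π : G_F → GL₂(ℚ̄_ℓ) with local-global compatibility up to semisimplification at v ∤ ℓ, and up to Frobenius semisimplification where π_v is not a twist of Steinberg] — [Mok14] (bibliography in the comment block) = row C191 `Consumers28.MokGSp4` (its Theorems 1.1 / 1.2: the Galois representations for cohomological π on GL₂ over a CM field with local-global compatibility — exactly the typed content of the row); [HLTT13] / [Sch13] are named as later constructions removing Mok's central-character restriction but are NOT the representations the paper uses ([read: our knowledge of the Galois representations constructed in [Mok14]]); the Faltings – Serre method, Livné's criterion, [GHY13]'s cohomology computations, [DGP10]: Arthur-free, absorbed. [cite: Jones2016TwelfthRoots, §1 (chunk p0002:L13, L19), §2 Thm 1 (chunk p0004:L7-9); Mok2014Compositio, Thms 1.1-1.2 (as [Mok14]) (edge as printed)] -/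
def E_JonesQzeta12 : Prop := c₂₈.MokGSp4 → c₁₀₈.JonesQzeta12

/-- C275's STANDING ASSUMPTION (node `TJlgc`) SUPPLIED ⇐ ROW C191 — the place is footnote 8 to the assumption: p0031:L43-45 "ciated Galois representation, this is a result of Sorensen (see [24]) and Mok (see Theorem 3.1 of [19]). For a non-cohomological representation which is a theta lift, the required local-global compatibility result exists up to semisimplification; this is Theorem 4.11 of [19]." [the footnote's first word « asso4 ciated » = associated] — and the discussion of §5: p0035:L4-15 "As stated, the main theorem of Gee and Geraghty only applies to globally generic representations. The reason is that Gee and Geraghty deduce their main result from a similar result for GL4 , and then use a transfer between GSp4 and GL4 ; this transfer is only known in the globally generic case. However, when we take the global theta lift to a cuspidal automorphic representation Π of GSp4 (AQ ), we have that at the archimedean place ∞, Π∞ is holomorphic and non-generic, so that Π is not globally generic. For our global theta lift, which is non-generic, one can get functoriality in the sense that we require using the endoscopic classiﬁcation of Arthur; in particular, the lifting Π̃ (an automorphic representation of GL4 (AQ )) of Π is given by Arthur’s global parameter, since Π and Π̃ share the same global parameter. This lift is described by Mok in [19]; in particular see the proof of Theorem 3.1 of [19]." — [19] = Mok, Compositio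 Math. 150 (2014) = row C191 `Consumers28.MokGSp4` (its Theorem 3.1 — the Galois representation of a cohomological Π on GSp₄ in a simple generic parameter, with local-global compatibility, obtained through the transfer to GL₄ given by Arthur's global parameter — and its Theorem 4.11); [24] = Sorensen, Doc. Math. 15 (2010) (globally generic Π; the paper's theta lifts are holomorphic, hence NOT globally generic: [read: so that Π is not globally generic]) — Arthur-free, absorbed; the sentence [read: using the endoscopic classification of Arthur] names the book as the source of Mok's lift — covered by C191's own premise (⇐ book ∧ A4), not bound separately.  The node is supplied for cohomological Π with irreducible Galois representation (full compatibility) and, up to semisimplification, for the non-cohomological theta lifts ([19, Thm 4.11]) — the scope printed in the footnote. [cite: TsaltasJarvis2019Descending, §4 footnote 8 (page p0031:L43-45), §5 (page p0035:L4-15); Mok2014Compositio, Thms 3.1, 4.11 (as [19]) (edge as printed)] -/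
def E_TJlgc : Prop := c₂₈.MokGSp4 → c₁₀₈.TJlgc

/-- C275's THEOREM 4.2 ⇐ ITS STANDING ASSUMPTION — p0032:L12-15 "Theorem 4.2. Under the assumptions above, the congruence between Π and Π′ descends to a congruence between the cuspidal automorphic representation π, and another automorphic representation π ′ for GL2 over the imaginary quadratic ﬁeld K." [under the assumptions above = the set-up of §4 incl. « we will assume full local-global » [compatibility]]; the Galois representation itself is Weissauer – Laumon's: p0005:L37-38 "Then work of Weissauer and Laumon (see Theorem 3.1 of [2]) associates a 4-dimensional Galois representation to Π." ([2] = Berger – Dembélé – Pacetti – Şengün, Arthur-free); the theta correspondence (Roberts, [17], [28]), the degeneration of conductors ([25], [27]): Arthur-free, absorbed. [cite: TsaltasJarvis2019Descending, Thm 4.2 (page p0032:L12-15), §1.2 (page p0005:L37-38) (edge as printed)] -/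
def E_TJdescent : Prop := c₁₀₈.TJlgc → c₁₀₈.TJdescent

/-- C276's THEOREMS 1 / 2 ⇐ ROW C191 — the place is §3, the Galois representation W_{π,l} used throughout (for holomorphic, hence non-generic, non-CAP π): p0009:L98 "Let $\pi$ be a cuspidal automorphic representation of $\GSp_{4}$ which is not CAP, whose $\pi_{\infty}$ is a holomorphic discrete series of Harish Chandra parameter $(a, b, -a-b+3)$ with $a\geq b \geq 0$." […] p0009:L98 "We review the construction of the Galois representation attached to $\pi$. We define" — p0010:L13 "The following theorem summarizes the properties of $W_{\pi, l}$ and the proof of it can be found in [Taylor93], [Laum05], [Weis05], [Sor10] and [Mo14]." p0010:L15-16 "Theorem 3. Let $\pi$ be as above and $\Theta_{\pi}: \mathbb{T}^{S}\rightarrow \CC$ be the character giving the action of $\mathbb{T}^{S}$ on $\pi$. Then $W_{\pi, l}$ gives rise to a Galois representation" [ρ_{π,l} : Gal(ℚ̄/ℚ) → GSp₄(ℚ̄_l) — unramified with the Hecke characteristic polynomial at good p ≠ l; local-global compatibility at all p ≠ l; …] — [Mo14] = Mok, Compositio Math. 150 (2014) = row C191 `Consumers28.MokGSp4` (bound AS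 CITED, jointly with [Taylor93], [Laum05] Laumon, [Weis05] Weissauer, [Sor10] Sorensen — published and Arthur-2013-free —, as the register bound row C118's [read: Theorem 4.3.4 (Taylor, Laumon, Weissauer, Schmidt, and Mok)] in tranche 28); the vanishing-cycle / level-lowering arguments, [VH19], [BLR91], Madapusi Pera [MP16]: Arthur-free, absorbed. [cite: HWang2019LevelLowering, §3 Thm 3 (chunks p0009:L98, p0010:L13-16); Mok2014Compositio, Thm 3.1 (as [Mo14]) (edge as printed)] -/
def E_HWangLevelLowering : Prop := c₂₈.MokGSp4 → c₁₀₈.HWangLevelLowering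

/-- C277's THEOREM 1.1 (with Remark 1.5's scope) ⇐ ROW C191 — the places: THEOREM 3.1 and its proof: p0004:L49-51 "Theorem 3.1. (Weissauer, Urban, Sorensen, Mok) Suppose $\pi$ is globally generic and that $\pi \otimes || \cdot||^{w/2}$ is unitary for some $w \in \Z$. Assume that $\pi_{\infty}$ belongs to the (essentially) discrete series $L$-parameter $\phi_{(w; a, b)}$ with weights $a > b > 0$. Then for any prime $\p$ the Galois representation $\rpp$ satisfies" [properties: unramified outside S ∪ {p}; full local-global compatibility at ℓ ≠ p via rec_GT; de Rham with the listed Hodge–Tate weights; crystalline at unramified p; pure; odd] p0004:L78-79 "Proof. [Sor] and [Mok]." — REMARK 3.2: p0004:L82-83 "Remark 3.2. It is not necessary to assume that $\pi$ is globally generic in the above theorem. The weaker assumption that $\pi$ belongs to a global generic Arthur parameter will suffice [Mok]. Hence it is enough to assume that the local $L$-packet containing $\pi_v$ contains a generic element for all places $v$. In [Sor], global genericity of $\pi$ is used to get a strong lift $\pi \rightsquigarrow \Pi$ from $\GSp_4$ to $\GL_4$ compatible with the local Langlands correspondences for the two groups at all places. In [Mok], Mok relaxes this assumption on $\pi$ using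 Arthur's results." — [Mok] = Mok, Compositio Math. 150 (2014) = row C191 `Consumers28.MokGSp4` (identified by the corpus citation graph (the e-print cites arXiv:1109.5392) and by the content of Theorem 3.1 / Remark 3.2; the corpus TeX does not render the bibliography); [Sor] = Sorensen 2010 (a co-author's paper; globally generic π, Arthur-free): BOTH are cited for Theorem 3.1, on which Theorem 1.1 rests, and Remark 1.5 / 3.2 extend Theorem 1.1 to holomorphic Siegel cusp forms through [Mok] alone (« will suffice [Mok]. » … « In [Mok], Mok relaxes this assumption on $\pi$ using Arthur's results. ») — bound AS CITED to C191; [GT] Gan – Takeda, [GeT], [Dinakar], [BLGGT], [GHTT]: Arthur-2013-free, absorbed. [cite: BroshiEtAl2020Unobstructed, Thm 3.1 with proof and Rem. 3.2 (chunk p0004:L49-83), Rem. 1.5 (chunk p0002:L48); Mok2014Compositio, Thm 3.1 (as [Mok]) (edge as printed)] -/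
def E_BMSWunobstructed : Prop := c₂₈.MokGSp4 → c₁₀₈.BMSWunobstructed

/-- The hundred-and-eighth tranche of implications (C273: two edges from C191 and one from C177; C274, C276, C277: one edge each from C191; C275: a node supplied from C191 and one edge from it). [cite: HidaTilouine2020SymmetricPower, Thms 1.3, 1.6, 7.1-7.2; Jones2016TwelfthRoots, §5; TsaltasJarvis2019Descending, Thm 4.2; HWang2019LevelLowering, Thms 1-2; BroshiEtAl2020Unobstructed, Thm 1.1 (edges as printed)] -/
structure Implications108 : Prop where
  htU : E_HTunitaryU4 c₂₈ c₁₀₈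
  htS7 : E_HTstandardGSp4 c₂₈ c₁₀₈
  htSym : E_HTsymTower c₁₈ c₁₀₈
  jones : E_JonesQzeta12 c₂₈ c₁₀₈
  tjL : E_TJlgc c₂₈ c₁₀₈
  tjD : E_TJdescent c₁₀₈
  hw : E_HWangLevelLowering c₂₈ c₁₀₈
  bmsw : E_BMSWunobstructed c₂₈ c₁₀₈

variable {ν μ κ c c₁₈ c₁₉ c₂₈ c₁₀₈}

/-- THE SIX C191-SUPPORTED STATEMENTS (C273 ×2, C274, C275's node and theorem, C276, C277) GIVEN ROW C191. [cite: HidaTilouine2020SymmetricPower, Thms 1.3, 7.1-7.2; Jones2016TwelfthRoots, §5; TsaltasJarvis2019Descending, Thm 4.2; HWang2019LevelLowering, Thms 1-2; BroshiEtAl2020Unobstructed, Thm 1.1 (bookkeeping proved here)] -/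
theorem mok2014vein_of_row (X : Implications108 c₁₈ c₂₈ c₁₀₈) (h₁₉₁ : c₂₈.MokGSp4) :
    (c₁₀₈.HTunitaryU4 ∧ c₁₀₈.HTstandardGSp4) ∧ c₁₀₈.JonesQzeta12 ∧ (c₁₀₈.TJlgc ∧ c₁₀₈.TJdescent) ∧ c₁₀₈.HWangLevelLowering ∧ c₁₀₈.BMSWunobstructed :=
  have l : c₁₀₈.TJlgc := X.tjL h₁₉₁
  ⟨⟨X.htU h₁₉₁, X.htS7 h₁₉₁⟩, X.jones h₁₉₁, ⟨l, X.tjD l⟩, X.hw h₁₉₁, X.bmsw h₁₉₁⟩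

/-- THE SIX C191-SUPPORTED STATEMENTS FROM THE BOOK's INPUTS, through tranche 28's `mokGSp4_of_leaves` (C191 ⇐ the book ∧ row A4 ⇐ the book); nothing of Mok 2015 or KMSW.
[cite: HidaTilouine2020SymmetricPower, Thms 1.3, 7.1-7.2; Jones2016TwelfthRoots, §5; TsaltasJarvis2019Descending, Thm 4.2; HWang2019LevelLowering, Thms 1-2; BroshiEtAl2020Unobstructed, Thm 1.1; Mok2014Compositio, Thm 3.1 (bookkeeping proved here)] -/
theorem mok2014vein_of_leaves (X : Implications108 c₁₈ c₂₈ c₁₀₈) (X₂₈ : Implications28 ν μ κ c c₁₉ c₂₈) (I : Implications ν μ κ c) (A : BookInputs ν) :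
    (c₁₀₈.HTunitaryU4 ∧ c₁₀₈.HTstandardGSp4) ∧ c₁₀₈.JonesQzeta12 ∧ (c₁₀₈.TJlgc ∧ c₁₀₈.TJdescent) ∧ c₁₀₈.HWangLevelLowering ∧ c₁₀₈.BMSWunobstructed :=
  mok2014vein_of_row X (mokGSp4_of_leaves X₂₈ I A)

/-- THE SIX C191-SUPPORTED STATEMENTS IN CONDITIONAL FORM, 2026 (C273 PUBLISHED 2020, [read: has also been established [Mok14]]; C274 PUBLISHED 2016; C275 PUBLISHED 2019, its
compatibility assumption explicit with Mok as the printed supplier; C276 PREPRINT 2019/2022; C277 PREPRINT 2020; no status sentence on the classification in any of them): granting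
the book's internal derivations, supply edges and every PUBLISHED input, and tranche 28's edges, all six are conditional — through Mok 2014's transfer GSp₄ → GL₄ — on the book's
2024–2026 preprint layer and on the general and the non-standard weighted fundamental lemmas (row C191's own 2011 sentence: [read: conditional on the results of Arthur]).
[cite: HidaTilouine2020SymmetricPower, Thms 1.3, 7.1-7.2; Jones2016TwelfthRoots, §5; TsaltasJarvis2019Descending, Thm 4.2; HWang2019LevelLowering, Thms 1-2; BroshiEtAl2020Unobstructed, Thm 1.1 (bookkeeping proved here)] -/
theorem mok2014vein_conditional_form (X : Implications108 c₁₈ c₂₈ c₁₀₈) (X₂₈ : Implications28 ν μ κ c c₁₉ c₂₈) (I : Implications ν μ κ c) (B : ν.BookEdges)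
    (S : ν.SupplyEdges) (P : ν.PublishedLeaves) :
    ν.PreprintLeaves2026 → ν.WFL_general → ν.WFL_nonstandard →
      (c₁₀₈.HTunitaryU4 ∧ c₁₀₈.HTstandardGSp4) ∧ c₁₀₈.JonesQzeta12 ∧ (c₁₀₈.TJlgc ∧ c₁₀₈.TJdescent) ∧ c₁₀₈.HWangLevelLowering ∧ c₁₀₈.BMSWunobstructed :=
  fun hQ h6 h7 => mok2014vein_of_row X (mokGSp4_conditional_form X₂₈ I B S P hQ h6 h7)

/-- C273's THEOREM 1.6 FOR n = 5, …, 8 GIVEN ROW C177. [cite: HidaTilouine2020SymmetricPower, Thm 1.6 (bookkeeping proved here)] -/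
theorem htSymTower_of_row (X : Implications108 c₁₈ c₂₈ c₁₀₈) (h₁₇₇ : c₁₈.ClozelThorne2) : c₁₀₈.HTsymTower :=
  X.htSym h₁₇₇

/-- C273's THEOREM 1.6 FOR n = 5, …, 8 FROM MOK's INPUTS AND KMSW's SUPPLY OF `StabOrdI`, through tranche 18's `clozelThorne2_of_leaves`; nothing of the book's own DAG.
[cite: HidaTilouine2020SymmetricPower, Thm 1.6; ClozelThorne2015, Thm 1.2 (bookkeeping proved here)] [claim: KalethaMinguezShinWhite2014, under-review] -/
theorem htSymTower_of_inputs (X : Implications108 c₁₈ c₂₈ c₁₀₈) (Y : Implications18 ν μ κ c₁₈) (M : MokInputs μ) (K : KMSWInputs μ κ) : c₁₀₈.HTsymTower :=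
  X.htSym (clozelThorne2_of_leaves Y M K)

/-- C273's THEOREM 1.6 FOR n = 5, …, 8 IN CONDITIONAL FORM, 2026 ([read: This theorem applies for n = 5, 6, 7, 8 by [CT15]]; no status sentence): granting Mok's section edges and
supplies, every PUBLISHED input of the memoir, KMSW's supply edge for the definite group's stabilisation with its published inputs, and tranche 18's edge, the symmetric-power
congruence-ideal theorem is conditional on MOK's 2024–2026 preprint layer, on Mok's general and non-standard weighted fundamental lemmas and, on the definite group's side, on
KMSW's general weighted fundamental lemma — exactly part II's residue (`ct2_conditional_form`). [cite: HidaTilouine2020SymmetricPower, Thm 1.6; ClozelThorne2015, §1.1 (bookkeeping proved here)] [claim: KalethaMinguezShinWhite2014, under-review] -/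
theorem htSymTower_conditional_form (X : Implications108 c₁₈ c₂₈ c₁₀₈) (Y : Implications18 ν μ κ c₁₈) (MB : μ.SectionEdges) (MS : μ.SupplyEdges) (MP : μ.PublishedLeaves)
    (KS : κ.SupplyEdges) (KP : κ.PublishedLeaves) :
    μ.PreprintLeaves2026 → μ.WFL_general → μ.WFL_nonstandard → κ.WFL_general → c₁₀₈.HTsymTower :=
  fun hQ h6 h7 k6 => X.htSym (ct2_conditional_form Y MB MS MP KS KP hQ h6 h7 k6)

/-- THE WHOLE HUNDRED-AND-EIGHTH TRANCHE FROM THE INPUTS OF THE THREE DAGs AND THE EARLIER TRANCHES' EDGES (six statements: book leaves through C191; C273's third statement: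
Mok's inputs and KMSW's supply through C177). [cite: HidaTilouine2020SymmetricPower, Thms 1.3, 1.6, 7.1-7.2; Jones2016TwelfthRoots, §5; TsaltasJarvis2019Descending, Thm 4.2; HWang2019LevelLowering, Thms 1-2; BroshiEtAl2020Unobstructed, Thm 1.1 (bookkeeping proved here)] [claim: KalethaMinguezShinWhite2014, under-review] -/
theorem hundredeighth_of_inputs (X : Implications108 c₁₈ c₂₈ c₁₀₈) (X₂₈ : Implications28 ν μ κ c c₁₉ c₂₈) (I : Implications ν μ κ c) (Y : Implications18 ν μ κ c₁₈)
    (A : BookInputs ν) (M : MokInputs μ) (K : KMSWInputs μ κ) :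
    ((c₁₀₈.HTunitaryU4 ∧ c₁₀₈.HTstandardGSp4) ∧ c₁₀₈.JonesQzeta12 ∧ (c₁₀₈.TJlgc ∧ c₁₀₈.TJdescent) ∧ c₁₀₈.HWangLevelLowering ∧ c₁₀₈.BMSWunobstructed) ∧ c₁₀₈.HTsymTower :=
  ⟨mok2014vein_of_leaves X X₂₈ I A, htSymTower_of_inputs X Y M K⟩

/-! ## Hundred-and-ninth tranche (v3, unit `pub-arthur-down-g42`): THE SYMMETRIC-POWER VEIN, I — NEW rows C278 `GKPPSsatoTateGaps` (⇐ C177 ∧ C29), C279 `LOTeffectiveST8`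
(⇐ C29), C280 `JanuszewskiSymPadicL` (⇐ C177 ∧ C29), C281 node `ZhangSymLayers` (⇐ C177 ∧ C29) with `ZhangSelmerTower` (⇐ it)

Context (C278 – C281 ABSENT from `DOWNSTREAM.md` … `DOWNSTREAM4.md`; NEW rows, block `[g42c]` of `DOWNSTREAM4.md`; typed premises reused: row C177 `Consumers18.ClozelThorne2` (L. Clozel –
J. A. Thorne, part II, Ann. of Math. 181 (2015): the 5th and 7th symmetric powers; tranche 18, `Downstream3.lean`: `clozelThorne2_of_leaves` ⇐ Mok ∧ KMSW's node `StabOrdI`,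
`ct2_conditional_form`) and row C29 `Consumers64.ClozelThorneIII` (part III, Duke Math. J. 166 (2017): Sym⁶ / Sym⁸; tranche 64, `Downstream17.lean`: `clozelThorneIII_of_inputs`
⇐ Mok ∧ `StabOrdI` ∧ E43's published leaves ∧ C177, `clozelThorneIII_conditional_form`) — both in the transitive closure of this file's import).  Texts under
`HOME/pub-arthur-down-g42/primaries/` (`SHA256SUMS`; corpus TeX): `paper-arxiv-1907.08285` (C278, 23 chunks), `paper-arxiv-1505.03122` (C279, 23 chunks), `paper-arxiv-1708.02616`
(C280, 48 chunks), `paper-arxiv-1802.08329` (C281, 33 chunks); arXiv listings `primaries/arxivabs/abs_*.html` (read-only GET 2026-08-23).  Loci: C278 p0001:L1, p0003:L24-57,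
p0004:L1-13, p0008:L94-95, p0022:L9-11; C279 p0001:L1, p0006:L10-40, p0007:L1, p0022:L17; C280 p0001:L1, p0003:L19-20, p0004:L5-6, L27-29, p0046:L41-57; C281 p0001:L1-3,
p0002:L3-22, p0004:L1-5, p0005:L85-91, p0017:L34-61, p0026:L64-77, p0032:L30-37. -/

/-- NEW rows C278 (Gillman – Kural – Pascadi – Peng – Sah 2020), C279 (Lemke Oliver – Thorner 2019), C280 (Januszewski 2024), C281 (X. Zhang 2021) of the census, as an arbitrary assignment of propositions; nothing about the content of a field is assumed. [cite: Arthur2013, downstream register of the cell, hundred-and-ninth tranche (structure only)] -/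
structure Consumers109 where
  /-- C278 (NEW census row, block `[g42c]` of `DOWNSTREAM4.md`; PUBLISHED: Res. Number Theory 6 (2020), no. 1, Paper No. 9, doi:10.1007/s40993-019-0184-8 (Crossref via `lit cite`; arXiv journal-ref ‘Res. Number Theory (2020) 6:9’); corpus TeX `paper-arxiv-1907.08285` = arXiv v1 2019-07-18, the only version; authors per `primaries/arxivabs/abs_1907.08285.html`), Nate Gillman – Michael Kural – Alexandru Pascadi – Junyao Peng – Ashwin Sah, *Patterns of primes in the Sato – Tate c.* (the title verbatim is in the comment block below) — THEOREM 1.1, THE TYPED STATEMENT (with THEOREM 1.2; both are the stated special cases, for non-CM E/ℚ and Sato – Tate measure ≥ 0.36, of the text's general Theorems (thm:bounded-gaps-sato-tate) / (thm:green-tao-sato-tate), which carry the automorphy of the symmetric powers up to ℓ_max as an input): p0003:L24-27 "Theorem 1.1. Let $E/\QQ$ be a non-CM elliptic curve, and let $I\subseteq [-1,1]$ be a closed interval such that $\mu_{ST}(I) \ge 0.36$. Denote by $\mc P_I$ the set of all primes $p$ satisfying $\cos\theta_p\in I$, and let $p_{I,n}$ be the $n$th prime in $\mc P_I$. There is a constant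 $C_I>0$ (independent of $E$) such that for any positive integer $m$, we have that" p0003:L29-31 "\[ \liminf_{n \to \infty} (p_{I,n+m} - p_{I,n})\le \exp(C_I m). \]" — THEOREM 1.2: p0003:L51-52 "Theorem 1.2. If $E/\QQ$ is a non-CM elliptic curve, and $I \subseteq [-1,1]$ is a closed interval such that $\mu_{ST}(I)\ge 0.36$, then there is a constant $C_I > 0$ (independent of $E$) such that for all $m\ge 1$ the following holds. Given any admissible set $\mc{H}=\{h_1,\ldots,h_k\}$ of size $k\ge\exp(C_I m)$, there exists an $(m+1)$-element subset $\{h_1',\ldots,h_{m+1}'\}$ of $\mc{H}$ such that there are arbitrarily long arithmetic progressions in the set" p0003:L54 "\[\{n\in\NN: n+h_i'\in\mc{P}_I\emph{ for all } 1\le i\le m+1\}.\]" — p0003:L57 "By a slight alteration of our argument, one can show that (thm:simplified-bounded-gaps) and (thm:simplified-green-tao) hold in the more general setting when the traces come from a non-CM holomorphic newform of positive even integer weight." [cite: GillmanEtAl2020SatoTatePatterns, Thms 1.1-1.2 (chunk p0003:L24-57)] -/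
  GKPPSsatoTateGaps : Prop
  /-- C279 (NEW census row, block `[g42c]`; PUBLISHED: Int. Math. Res. Not. IMRN 2019, no. 22, 6988–7036, doi:10.1093/imrn/rnx309 (arXiv journal-ref; Crossref); corpus TeX `paper-arxiv-1505.03122` (arXiv v1 2015 … v4 2016-11-17; the chunked version is not determined); authors per `abs_1505.03122.html`), Robert J. Lemke Oliver – Jesse Thorner, *Effective log-free zero density estimates for automorphic L-functions and the Sato – Tate c.* (title verbatim in the comment block) — p0006:L18 "We say that a subset $I\subseteq[-1,1]$ can be $\mathrm{\mathbf{Sym}^N}$-minorized if there exist constants $b_0,\dots, b_N\in\mathbb{R}$ with $b_0>0$ such that" — THEOREM 1.8 (stated under the explicit hypothesis that Sym^n π is automorphic for n ≤ N; THE TYPED STATEMENT is its last sentence's second unconditional case: I Sym⁸-minorizable and π a Hecke newform over ℚ): p0006:L27-28 "Theorem 1.8. Assume the above notation. Let $K$ be a totally real number field, and let $\pi\in\mathcal{A}_2(K)$ be a non-CM genuine representation which satisfies GRC and has trivial central character. Suppose that a fixed subset $I\subseteq[-1,1]$ can be $\mathrm{Sym}^N$-minorized and that $\mathrm{Sym}^{n}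 \pi\in\mathcal{A}_{n+1}(K)$ for each $n\leq N$. Let $B=\max_{0\leq n\leq N}|b_n|/b_0$, where $b_0,\ldots,b_N$ are as in (eqn:symn-minor1). There exists an absolute constant $\Cl[abcon]{satotatec1}>0$ such that if" […] p0006:L37 "\sum_{\substack{x<\mathrm{N}\p\leq x+h \\ \textup{$\pi_{\p}$ unramified}}} {\bf 1}_{I}(\cos \theta_{\p}) \log\mathrm{N}\p\asymp h," p0006:L40 "where the implied constant depends on $B$, $I$, and $K$. In particular, if $I$ can be $\mathrm{Sym}^4$-minorized, or if $I$ can be $\mathrm{Sym}^8$-minorized and $\pi$ is a Hecke newform over $\mathbb{Q}$, then this is unconditional." — p0007:L1 "It follows that any interval can be $\mathrm{Sym}^N$-minorized for $N$ sufficiently large, and thus every interval is at least conditionally covered by Theorem (thm:hoheisel_sato_tate); Lemma (lem:extreme-values) shows, however, that this minorant might be far from optimal. With the Beurling-Selberg minorant, we prove unconditional results for intervals $I$ satisfying $\mu_{\mathrm{ST}}(I)>\frac{4}{5}$. By contrast, Lemma (lem:sym4-minorized) implies unconditional results for all intervals satisfying $\mu_{\mathrm{ST}}(I) \geq 0.534$,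 and for some with measure as small as $0.139$." [cite: LemkeOliverThorner2019ZeroDensity, Thm 1.8, unconditional case N = 8 over ℚ (chunks p0006:L18-40, p0007:L1)] -/
  LOTeffectiveST8 : Prop
  /-- C280 (NEW census row, block `[g42c]`; PUBLISHED: Amer. J. Math. 146 (2024), no. 2, 495–578, doi:10.1353/ajm.2024.a923241 (Crossref via `lit cite`); corpus TeX `paper-arxiv-1708.02616` (arXiv v1 2017-08-08 … v6 2023-02-26; the chunked version is not determined — its bibliography lists part III of Clozel – Thorne as ‘To appear’, wording of 2017/2018); author per `abs_1708.02616.html`), Fabian Januszewski, p0001:L1 "Non-abelian p -adic Rankin-Selberg L -functions and non-vanishing of central L -values" — THEOREM 1: p0003:L19 "Theorem 1." p0003:L20 "Let $\Pi\widehat{\otimes}\Sigma$ be an irreducible regular algebraic cuspidal automorphic representation of $G(\Adeles)$ of cohomological weight $\lambda$. Assume the following:" […] — THEOREM 2: p0004:L5 "Theorem 2." p0004:L6 "Let $\Pi$ and $\Sigma$ be irreducible cuspidal regular algebraic automorphic representations of $\GL_{n+1}(\Adeles_F)$ and $\GL_n(\Adeles_F)$ of balanced weight. Assume that $\Pi$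 and $\Sigma$ are unitary and that $\Pi$ and $\Sigma$ are nearly ordinary at all $\mathfrak{p}\mid p$ for some prime $p.$" […] — THE TYPED STATEMENT is the application asserted in the introduction (no numbered statement in the text): p0004:L29 "Iteratively, Theorems (introthm:firstpadicL) and (introthm:firstnonvanishing) imply the existence of $p$-adic meromorphic $L$-functions for symmetric power $L$-functions $L(s,\Sym^n f)$ of non-CM nearly ordinary Hilbert modular cusp forms $f$ over a totally real number field $F/\QQ$, which is linearly disjoint from $\QQ(e^{2\pi i/35}),$ and $1\leq n\leq 8$, provided that $f$ is of sufficiently large parallel weight. Our non-vanishing result also allows for the extension of the rationality results in [raghuram2010,raghuram2015] to central $L$-values." [cite: Januszewski2024RankinSelberg, §1 application of Thms 1-2 to Sym^n f, n ≤ 8 (chunk p0004:L29; Thms 1-2 at p0003:L19-20, p0004:L5-6)] -/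
  JanuszewskiSymPadicL : Prop
  /-- C281, first statement = a HYPOTHESIS NODE (NEW census row, block `[g42c]`; PUBLISHED: Amer. J. Math. 143 (2021), no. 1, 125–173, doi:10.1353/ajm.2021.0002 (arXiv journal-ref; Crossref); corpus TeX `paper-arxiv-1802.08329` = arXiv v1 2018-02-22, the only version; author per `abs_1802.08329.html`: Xiaoyu Zhang), p0001:L1 "Selmer groups of symmetric powers of ordinary modular Galois representations" (p0001:L3 "LAGA, Institut Galilée, U. Paris 13, av. J.-B. Clément, Villetaneuse 93430, France.") — ABSTRACT (first part; the rest is in the comment block): p0002:L3-16 "Let $p$ be a fixed odd prime number, $\mu$ be a Hida family over the Iwasawa algebra of one variable, $\rho_{\mu}$ its Galois representation, $\Q_\infty/\mathbb{Q}$ the $p$-cyclotomic tower and $S$ the variable of the cyclotomic Iwasawa algebra. We compare, for $n\leq 4$ and under certain assumptions, the characteristic power series $L(S)$ of the dual of Selmer groups $\mathrm{Sel}(\mathbb{Q}_{\infty},\mathrm{Sym}^{2n}\otimes\mathrm{det}^{-n}\rho_{\mu})$ to certain congruence ideals. The case $n=1$ has been treated by H.Hida." — p0004:L1-5 "Our work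 can be seen as a generalization of [HidaTilouine] in the sense that instead of considering only one field $\mathbb{Q}$, we consider the $p$-cyclotomic tower $\mathbb{Q}_\infty/\mathbb{Q}$. In other words, we treat an Iwasawa-theoretic version of the above congruence problem for the Langlands functorialities $\mathrm{Sym}^{n-1}\colon\mathrm{GL}_2\leadsto\mathrm{GL}_n$ for each layer of $\mathbb{Q}_\infty/\mathbb{Q}$." — THE STANDING ASSUMPTION OF §4 (G = G_n the definite unitary group in n variables of §2; ℚ_k the layers of the cyclotomic ℤ_p-extension): p0017:L34-38 "We set $G=G_{/\mathbb{Q}}=G_{n/\mathbb{Q}}$ for some $n>1$. By [ArthurClozel], we have the automorphic cyclic base change functoriality $\mathrm{GL}_{2/\mathbb{Q}}\leadsto \mathrm{GL}_{2/\mathbb{Q}_k}$ for all $k$." p0017:L39-43 "Assume that the Langlands functorialities $\mathrm{Sym}^{n-1} \colon \mathrm{GL}_{2/\mathbb{Q}_k}\leadsto\mathrm{GL}_{n/\mathbb{Q}_k}$ are established for all $k$" […] [cite: XZhang2021SymmetricSelmer, §4 standing assumption (chunk p0017:L34-50)] -/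
  ZhangSymLayers : Prop
  /-- C281, second statement: THEOREM 4.27 = THEOREM 1.2's second part, THE TYPED CONSUMER (for the base change Π^G of the Hida family's members along GL₂ → GL₂/ℚ_k → GL_n/ℚ_k → G/ℚ_k, under the standing assumption): p0026:L64 "We apply Theorem (pL) and Corollary (pLandCongruenceIdeal) to $G'$ and to $G$. Using the above decomposition of congruence ideals and Selmer groups, one can show the following result." p0026:L66-77 "Theorem 4.27. Assume $\textbf{Big} (\overline{\rho}_{\Pi^{G}})$, $\textbf{Dist} (\overline{\rho}_{\Pi^{G}})$, $\textbf{RegU} (\overline{\rho}_{\Pi^{G}})$, $\mathcal{L} (\mathbb{Q},\mathrm{Ad}(\rho_\mu^{G_r}))\neq0$ for both $r=n, n-1$ and that $ B $ is regular. Then the Selmer group $\mathrm{Sel} (\mathbb{Q}_{\infty},\mathcal{A}^{n-1}(\rho_\mu))^{\ast}$ is a finitely generated torsion $B_\infty$-module. Its characteristic power series $L^{alg}_p (\mathcal{A}^{n-1}(\rho_\mu),S)$ has a zero of order $1$ at $S=0$. Moreover, for any prime ideal $P$ in $B_k$ of height one, we have (up to a factor a power of $p$ if $k>0$)" […] — THEOREM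 1.2 (second part, as announced): p0005:L85-91 "* Assume $\textbf{Big}(\overline{\rho}^{G_n}_\pi)$, $\textbf{Big}(\overline{\rho}^{G_n}_\pi)$, $\textbf{RegU}(\overline{\rho}^{G_n}_\pi)$, $\mathcal{L}(\mathbb{Q},\mathrm{Ad}(\rho^{G_n}_\mu))\neq0$, $\mathcal{L}(\mathbb{Q},\mathrm{Ad}(\rho^{G_{n-1}}_\mu))\neq0$, and $B$ regular. Then the dual Selmer group $\mathrm{Sel}(\mathbb{Q}_\infty,\mathcal{A}^{n-1}(\rho_\mu))^\ast$ is a finitely generated torsion $B_\infty$-module. Its characteristic power series $L^{alg}_p(\mathcal{A}^{n-1}(\rho_\mu),S)$ has a trivial zero at $S=0$ of order $1$." […] [cite: XZhang2021SymmetricSelmer, Thm 4.27 = Thm 1.2 (ii) (chunks p0026:L64-77, p0005:L85-91)] -/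
  ZhangSelmerTower : Prop

variable (ν : Nodes) (μ : Mok2015.Nodes) (κ : KMSW2014.Nodes) (c : Consumers) (c₁₃ : Consumers13) (c₁₄ : Consumers14) (c₁₈ : Consumers18) (c₂₈ : Consumers28)
  (c₄₃ : Consumers43) (c₄₄ : Consumers44) (c₄₅ : Consumers45) (c₆₄ : Consumers64) (c₁₀₉ : Consumers109)

-- Verbatim lines kept out of docstrings by the register's lint (titles and sentences naming a conj., bibliography entries):
-- C278 (`paper-arxiv-1907.08285`) title: p0001:L1 "Patterns of primes in the Sato–Tate conjecture"
-- C278 the status-of-automorphy sentence: p0004:L2 "Currently, automorphy has only been proven for $L(s,\Sym^\ell E)$ when $\ell\leq 8$, although it is conjectured to hold for all $\ell\in\NN$."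
-- C278 bibliography [CT15] / [CT17]: p0022:L9 "[CT15] Laurent Clozel and Jack~A. Thorne. \newblock Level raising and symmetric power functoriality, {II}. \newblock {\em Ann. of Math. (2)}, 181(1):303--359, 2015." / p0022:L11 "[CT17] Laurent Clozel and Jack~A. Thorne. \newblock Level-raising and symmetric power functoriality, {III}. \newblock {\em Duke Math. J.}, 166(2):325--402, 2017."
-- C279 (`paper-arxiv-1505.03122`) title: p0001:L1 "Effective Log-Free Zero Density Estimates for Automorphic L-Functions and the Sato–Tate Conjecture"
-- C279 §1.3, the sentence before the Clozel – Thorne sentence: p0006:L10 "The Sato-Tate conjecture is now a theorem for large classes of $\pi$. For newforms over $\Q$ and elliptic curves over totally real fields, this was proved by Barnet-Lamb, Geraghty, Harris, and Taylor [Sato-Tate], and for Hilbert modular forms, this was done by Barnet-Lamb, Gee, and Geraghty [BGG]. The proofs rely upon showing that the symmetric power $L$-functions $L(s,\mathrm{Sym}^n \pi,K)$ are all potentially automorphic, that is, there exists a finite, totally real Galois extension $L/K$ such that $\mathrm{Sym}^n \pi$ is automorphic over $L$."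
-- C279 bibliography [ClozelThorne]: p0022:L17 "[ClozelThorne] L.~Clozel and J.~Thorne. \newblock Level-raising and symmetric power functoriality, iii. \newblock {\em preprint}."
-- C280 (`paper-arxiv-1708.02616`) bibliography: p0046:L41-45 "[clozelthorne2014] L. Clozel and J. Thorne. Level-raising and symmetric power functoriality I. Compositio Mathematica 150, pages 729–748." / p0046:L47-51 "[clozelthorne2015] L. Clozel and J. Thorne. Level-raising and symmetric power functoriality II. Annals of Mathematics 181, pages 303–359." / p0046:L53-57 "[clozelthorne2017] L. Clozel and J. Thorne. Level-raising and symmetric power functoriality III. To appear in Duke Mathematical Journal 150, pages 1–53."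
-- C281 (`paper-arxiv-1802.08329`) abstract, continued: p0002:L21-22 "We conjecture the non-vanishing of this $\Lc$-invariant; this implies therefore that these Selmer groups are cotorsion."
-- C281 bibliography: p0032:L30-31 "[ClozelThorne2014] L.Clozel and J.Thorne, Level raising and symmetric power functoriality, I. Compos.Math. 150 (2014), no.5, pp.729-748." / p0032:L33-34 "[ClozelThorne2015] L.Clozel and J.Thorne, Level raising and symmetric power functoriality, II. Ann. of Math. (2) 181 (2015), pp.303-359." / p0032:L36-37 "[ClozelThorne2017] L.Clozel and J.Thorne, Level raising and symmetric power functoriality, III. To appear in Duke Math. J. 150, pp.1-53."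

/-- C278's THEOREMS 1.1 / 1.2 ⇐ ROWS C177 AND C29 — the places: §1.1: p0004:L1 "As we will see in (sec:symmetric-powers), we need to know that these $L$-functions are automorphic in order to carry through the estimates." p0004:L2 "The values $2\le\ell\le 8$ follow from automorphy lifting theorems for symmetric powers of cuspidal automorphic representations of $\GL_2$: $\ell = 2$ is due to Gelbart and Jacquet [GJ78], $\ell = 3$ to Kim and Shahidi [KS02], $\ell = 4$ to Kim [K03], and $\ell\in\{5,6,7,8\}$ to Clozel and Thorne [CT15, CT17]. (In contrast, potential automorphy is known for all $\ell$ [BGHT11].)" — p0004:L4 "Accordingly, for an unconditional result, we can only afford to use an approximation of $\one_I$ by polynomials of degree up to $8$. We will choose this approximation to be a minorant $u_- \le \one_I$." p0004:L5 "The idea of using such a polynomial minorant to obtain unconditional results appears in [LT18]." — p0004:L12-13 "We will assume these inputs in (sec:bounded-gaps) to establish a more general version of (thm:simplified-bounded-gaps), our bounded gaps result. Similarly, in (sec:green-tao) we prove a more general version of Theorem (thm:simplified-green-tao), the synthesis of our bounded-gap result with the Green–Tao theorem, assuming the results of (sec:PNT-BV-sato-tate)." — and the proof of Theorem 1.1: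 p0008:L94-95 "Proof of (thm:simplified-bounded-gaps). Choose $\ell_{\max} = 8$, so that $L(s, \Sym^\ell E)$ is automorphic for all $\ell \le \ell_{\max}$ and for all non-CM elliptic curves $E$ [CT17]. By the computations in (lem:minorization-big-measure), all intervals $I \subseteq [-1, 1]$ with $\mu_{ST}(I) \ge 0.36$ can be minorized as in the hypothesis of (thm:bounded-gaps-sato-tate). Hence (thm:simplified-bounded-gaps) follows for large enough $C_I$ (note that $\widetilde\theta = 1/7$ and $b_0$ only depends on $I$)." — [CT15] = L. Clozel – J. A. Thorne, *Level raising and symmetric power functoriality, II*, Ann. of Math. 181 (2015) = row C177 `Consumers18.ClozelThorne2` (the 5th and 7th symmetric powers over ℚ; tranche 18: ⇐ Mok at all ranks ∧ KMSW's node `StabOrdI`); [CT17] = part III, Duke Math. J. 166 (2017) = row C29 `Consumers64.ClozelThorneIII` (Sym⁶ / Sym⁸; tranche 64: ⇐ Mok ∧ `StabOrdI` ∧ E43 ∧ C177) — BOTH bound (the proof sentence names [CT17] for all ℓ ≤ 8; the introduction attributes ℓ ∈ {5,6,7,8} to [CT15, CT17]); the modularity theorem (ℓ = 1), Gelbart –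 Jacquet (ℓ = 2), Kim – Shahidi (ℓ = 3), Kim (ℓ = 4), Maynard – Tao, Thorner [T14], Lemke Oliver – Thorner [LT18] (the minorant method), Rouse – Thorner: Arthur-2013-free, absorbed; [BGHT11] (potential automorphy) is named, not used for the unconditional statements. [cite: GillmanEtAl2020SatoTatePatterns, §1.1 (chunk p0004:L1-13), proof of Thm 1.1 (chunk p0008:L94-95); ClozelThorne2015, Cor. 1.3 (as [CT15]); ClozelThorne2017III, Thm 1.1 (as [CT17]) (edge as printed)] -/
def E_GKPPSsatoTateGaps : Prop := c₁₈.ClozelThorne2 → c₆₄.ClozelThorneIII → c₁₀₉.GKPPSsatoTateGaps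

/-- C279's THEOREM 1.8, UNCONDITIONAL CASE N = 8 OVER ℚ ⇐ ROW C29 — the place is §1.3: p0006:L10 "It is expected that $L(s,\mathrm{Sym}^n \pi,K)\in\mathcal{A}_{n+1}(K)$ for each $n\geq1$, but as of right now, this is known in general only for $n\leq 4$ (see [GJ,Kim,KS1,KS2]). By recent work of Clozel and Thorne [ClozelThorne], if $\pi$ is associated to a classical modular form, and $K\cap\Q(e^{2\pi i/35})=\Q$, then $L(s,\mathrm{Sym}^n\pi,K)\in\mathcal{A}_{n+1}(K)$ for $n\leq 8$." p0006:L10 "Despite this recent progress, because of our limited knowledge of automorphy, the number of symmetric powers needed to access the interval $I$ is particularly important in the sorts of analytic problems considered in this paper." — [ClozelThorne] = the bibliography's ‘Level-raising and symmetric power functoriality, iii. preprint’ = row C29 `Consumers64.ClozelThorneIII` (bound AS CITED: the text attributes the symmetric powers n ≤ 8 for classical modular forms, K ∩ ℚ(e^{2πi/35}) = ℚ, to part III alone; part II = row C177, which gives the 5th and 7th powers and is part III's own typed premise, is not in the bibliography — the support is unchanged: C29 ⇐ Mok ∧ `StabOrdI` ∧ E43 ∧ C177); [GJ], [Kim], [KS1],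 [KS2] (n ≤ 4; the theorem's other unconditional case, Sym⁴-minorizable I), Barnet-Lamb – Geraghty – Harris – Taylor and [BGG] (potential automorphy, named for the Sato – Tate theorem, not used in Theorem 1.8), the log-free zero-density estimates themselves: Arthur-2013-free, absorbed. [cite: LemkeOliverThorner2019ZeroDensity, §1.3 (chunk p0006:L10), Thm 1.8 (chunk p0006:L27-40); ClozelThorne2017III, Thm 1.1 (as [ClozelThorne]) (edge as printed)] -/
def E_LOTeffectiveST8 : Prop := c₆₄.ClozelThorneIII → c₁₀₉.LOTeffectiveST8

/-- C280's SYMMETRIC-POWER APPLICATION ⇐ ROWS C177 AND C29 — the place is the introduction: p0004:L27 "Using symmetric power functoriality for $\GL(2)$, it is easy to produce automorphic representations $\Pi$ and $\Sigma$ satisfying the hypotheses of Theorems (introthm:firstpadicL) and (introthm:firstnonvanishing). By [gelbartjacquet1978,kim2003,kimshahidi2002], the symmetric power functoriality $\Sym^n$ from $\GL(2)$ to $\GL(n+1)$ is known for $n\leq 4$ over arbitrary number fields. Thanks to recent progress by Clozel-Thorne [clozelthorne2014,clozelthorne2015,clozelthorne2017], we know that $\Sym^n$ exists for $n\leq 8$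 for Hilbert modular forms over totally real fields $F$ under mild hypotheses. Symmetric power lifts preserve near ordinarity and regular algebraicity (cf. Theorem 5.3 and Proposition 5.4 in [raghuram2010] and Theorem 3.2 in [raghuram2015]). Using base change in solvable extensions [arthurclozel1989], we may produce examples over more general number fields." — [clozelthorne2015] = row C177 `Consumers18.ClozelThorne2`; [clozelthorne2017] = row C29 `Consumers64.ClozelThorneIII` (the condition [read: linearly disjoint from ℚ(e^{2πi/35})] is exactly parts II / III's: Sym⁵ over F linearly disjoint from ℚ(ζ₅), Sym⁷ from ℚ(ζ₃₅), Sym⁶ from ℚ(ζ₅), Sym⁸ from ℚ(ζ₇)); [clozelthorne2014] = part I = census row C210 (whose typed node is its Proposition 2.9 (3), a different statement — named, NOT bound, as in tranche 108); [gelbartjacquet1978], [kim2003], [kimshahidi2002] (n ≤ 4), [raghuram2010] / [raghuram2015] (near-ordinarity and regular algebraicity of the lifts), Arthur – Clozel base change, and the paper's own Theorems 1 / 2: Arthur-2013-free, absorbed. [cite: Januszewski2024RankinSelberg, §1 (chunk p0004:L27-29); ClozelThorne2015, Cor. 1.3 (as [clozelthorne2015]); ClozelThorne2017III, Thm 1.1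 (as [clozelthorne2017]) (edge as printed)] -/
def E_JanuszewskiSymPadicL : Prop := c₁₈.ClozelThorne2 → c₆₄.ClozelThorneIII → c₁₀₉.JanuszewskiSymPadicL

/-- C281's STANDING ASSUMPTION (node `ZhangSymLayers`) SUPPLIED ⇐ ROWS C177 AND C29 — the place is the sentence following the assumption (the register's node-and-supplier pattern, tranches 83 / 105 / 108): p0017:L51-58 "Note that by [ClozelThorne2014,ClozelThorne2015,ClozelThorne2017], for $p>7$, the functorialities $\mathrm{Sym}^{n-1} \colon \mathrm{GL}_{2/\mathbb{Q}_k} \leadsto\mathrm{GL}_{n/\mathbb{Q}_k}$ are established for all $n\leq9$ and all $k\geq0$." — p0017:L59-61 "By [Clozel1991], we have the functoriality of automorphic descent $\mathrm{GL}_{n/\mathbb{Q}_k}\leadsto G_{/\mathbb{Q}_k}$." — [ClozelThorne2015] = row C177 `Consumers18.ClozelThorne2`; [ClozelThorne2017] = row C29 `Consumers64.ClozelThorneIII` (over the totally real layers ℚ_k of the cyclotomic ℤ_p-extension, which are linearly disjoint from ℚ(ζ₅) and ℚ(ζ₇) when p > 7 — the supplier's printed scope: p > 7, n ≤ 9, i.e.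 Sym^m for m ≤ 8, matching the abstract's [read: for n ≤ 4] in the notation Sym^{2n}); [ClozelThorne2014] = part I = census row C210 (named, NOT bound); [ArthurClozel] (cyclic base change), [Clozel1991] (descent to the definite unitary group), Gelbart – Jacquet / Kim – Shahidi / Kim (n ≤ 5 in the GL_n notation): Arthur-2013-free, absorbed. [cite: XZhang2021SymmetricSelmer, §4 (chunk p0017:L51-61); ClozelThorne2015, Cor. 1.3 (as [ClozelThorne2015]); ClozelThorne2017III, Thm 1.1 (as [ClozelThorne2017]) (edge as printed)] -/
def E_ZhangSymLayers : Prop := c₁₈.ClozelThorne2 → c₆₄.ClozelThorneIII → c₁₀₉.ZhangSymLayers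

/-- C281's THEOREM 4.27 (= Theorem 1.2, second part) ⇐ ITS STANDING ASSUMPTION — p0026:L64 "We apply Theorem (pL) and Corollary (pLandCongruenceIdeal) to $G'$ and to $G$. Using the above decomposition of congruence ideals and Selmer groups, one can show the following result." [Theorem (pL) and Corollary (pLandCongruenceIdeal) applied to G′ = G_{n−1} and G = G_n, whose Hida families Π^{G′}, Π^{G} are the images of the GL₂ family under the assumed functorialities and Clozel's descent]; the R = T theorems for definite unitary groups of §2 ([Geraghty], [HidaTilouine] = census row C273's §2, used here through its own statements, not through C273's typed fields), Hida theory, [Clozel1991], [ArthurClozel]: Arthur-2013-free, absorbed. [cite: XZhang2021SymmetricSelmer, Thm 4.27 with p0026:L64 (chunk p0026:L64-77) (edge as printed)] -/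
def E_ZhangSelmerTower : Prop := c₁₀₉.ZhangSymLayers → c₁₀₉.ZhangSelmerTower

/-- The hundred-and-ninth tranche of implications (C278, C280: one edge each from C177 ∧ C29; C279: one edge from C29; C281: a node supplied from C177 ∧ C29 and one edge from it). [cite: GillmanEtAl2020SatoTatePatterns, Thms 1.1-1.2; LemkeOliverThorner2019ZeroDensity, Thm 1.8; Januszewski2024RankinSelberg, §1; XZhang2021SymmetricSelmer, Thm 4.27 (edges as printed)] -/
structure Implications109 : Prop where
  gkpps : E_GKPPSsatoTateGaps c₁₈ c₆₄ c₁₀₉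
  lot : E_LOTeffectiveST8 c₆₄ c₁₀₉
  jan : E_JanuszewskiSymPadicL c₁₈ c₆₄ c₁₀₉
  zhL : E_ZhangSymLayers c₁₈ c₆₄ c₁₀₉
  zhS : E_ZhangSelmerTower c₁₀₉

variable {ν μ κ c c₁₃ c₁₄ c₁₈ c₂₈ c₄₃ c₄₄ c₄₅ c₆₄ c₁₀₉}

/-- THE WHOLE TRANCHE GIVEN ROWS C177 AND C29. [cite: GillmanEtAl2020SatoTatePatterns, Thms 1.1-1.2; LemkeOliverThorner2019ZeroDensity, Thm 1.8; Januszewski2024RankinSelberg, §1; XZhang2021SymmetricSelmer, Thm 4.27 (bookkeeping proved here)] -/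
theorem symPowerVein_of_rows (X : Implications109 c₁₈ c₆₄ c₁₀₉) (h₁₇₇ : c₁₈.ClozelThorne2) (h₂₉ : c₆₄.ClozelThorneIII) :
    c₁₀₉.GKPPSsatoTateGaps ∧ c₁₀₉.LOTeffectiveST8 ∧ c₁₀₉.JanuszewskiSymPadicL ∧ (c₁₀₉.ZhangSymLayers ∧ c₁₀₉.ZhangSelmerTower) :=
  have z : c₁₀₉.ZhangSymLayers := X.zhL h₁₇₇ h₂₉
  ⟨X.gkpps h₁₇₇ h₂₉, X.lot h₂₉, X.jan h₁₇₇ h₂₉, ⟨z, X.zhS z⟩⟩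

/-- THE WHOLE TRANCHE FROM MOK's AND KMSW's INPUTS AND THE BOOK's PUBLISHED LEAVES, through tranche 18's `clozelThorne2_of_leaves` (C177 ⇐ Mok ∧ `StabOrdI`) and tranche 64's
`clozelThorneIII_of_inputs` (C29 ⇐ Mok ∧ `StabOrdI` ∧ E43's five published book leaves ∧ C177) — no open leaf of the book. [cite: GillmanEtAl2020SatoTatePatterns, Thms 1.1-1.2; LemkeOliverThorner2019ZeroDensity, Thm 1.8; Januszewski2024RankinSelberg, §1; XZhang2021SymmetricSelmer, Thm 4.27; ClozelThorne2015, Thm 1.2; ClozelThorne2017III, Thm 6.1 (bookkeeping proved here)] [claim: KalethaMinguezShinWhite2014, under-review] -/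
theorem symPowerVein_of_inputs (X : Implications109 c₁₈ c₆₄ c₁₀₉) (Z : Implications64 ν μ κ c c₁₈ c₂₈ c₄₅ c₆₄) (Y₁₈ : Implications18 ν μ κ c₁₈)
    (V : Implications45 ν μ κ c₁₃ c₁₄ c₄₃ c₄₄ c₄₅) (P : ν.PublishedLeaves) (M : MokInputs μ) (K : KMSWInputs μ κ) :
    c₁₀₉.GKPPSsatoTateGaps ∧ c₁₀₉.LOTeffectiveST8 ∧ c₁₀₉.JanuszewskiSymPadicL ∧ (c₁₀₉.ZhangSymLayers ∧ c₁₀₉.ZhangSelmerTower) :=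
  symPowerVein_of_rows X (clozelThorne2_of_leaves Y₁₈ M K) (clozelThorneIII_of_inputs Z Y₁₈ V P M K)

/-- THE WHOLE TRANCHE IN CONDITIONAL FORM, 2026 (C278 PUBLISHED 2020: [read: for an unconditional result]; C279 PUBLISHED 2019: [read: then this is unconditional]; C280 PUBLISHED
2024; C281 PUBLISHED 2021, its functoriality assumption explicit with Clozel – Thorne as the printed supplier; no status sentence on the classifications in any of them): granting
Mok's section edges and supplies, every PUBLISHED input of the memoir, KMSW's supply edge for the definite group's stabilisation with its published inputs, the book's published
leaves (E43) and the earlier tranches' edges, all five statements are conditional on MOK's 2024–2026 preprint layer, on Mok's general and non-standard weighted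
fundamental lemmas and, on the definite unitary group's side, on KMSW's general weighted fundamental lemma — exactly parts II / III's residue (`ct2_conditional_form`,
`clozelThorneIII_conditional_form`). [cite: GillmanEtAl2020SatoTatePatterns, Thms 1.1-1.2; LemkeOliverThorner2019ZeroDensity, Thm 1.8; Januszewski2024RankinSelberg, §1; XZhang2021SymmetricSelmer, Thm 4.27; ClozelThorne2015, §1.1; ClozelThorne2017III, p0003:L39-41 (bookkeeping proved here)] [claim: KalethaMinguezShinWhite2014, under-review] -/
theorem symPowerVein_conditional_form (X : Implications109 c₁₈ c₆₄ c₁₀₉) (Z : Implications64 ν μ κ c c₁₈ c₂₈ c₄₅ c₆₄) (Y₁₈ : Implications18 ν μ κ c₁₈)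
    (V : Implications45 ν μ κ c₁₃ c₁₄ c₄₃ c₄₄ c₄₅) (P : ν.PublishedLeaves) (MB : μ.SectionEdges) (MS : μ.SupplyEdges) (MP : μ.PublishedLeaves)
    (KS : κ.SupplyEdges) (KP : κ.PublishedLeaves) :
    μ.PreprintLeaves2026 → μ.WFL_general → μ.WFL_nonstandard → κ.WFL_general →
      c₁₀₉.GKPPSsatoTateGaps ∧ c₁₀₉.LOTeffectiveST8 ∧ c₁₀₉.JanuszewskiSymPadicL ∧ (c₁₀₉.ZhangSymLayers ∧ c₁₀₉.ZhangSelmerTower) :=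
  fun hQ h6 h7 k6 =>
    symPowerVein_of_rows X (ct2_conditional_form Y₁₈ MB MS MP KS KP hQ h6 h7 k6)
      (clozelThorneIII_conditional_form Z Y₁₈ V P MB MS MP KS KP hQ h6 h7 k6)

/-- THE WHOLE HUNDRED-AND-NINTH TRANCHE FROM THE INPUTS OF THE THREE DAGs AND THE EARLIER TRANCHES' EDGES (the book enters only through E43's published leaves).
[cite: GillmanEtAl2020SatoTatePatterns, Thms 1.1-1.2; LemkeOliverThorner2019ZeroDensity, Thm 1.8; Januszewski2024RankinSelberg, §1; XZhang2021SymmetricSelmer, Thm 4.27 (bookkeeping proved here)] [claim: KalethaMinguezShinWhite2014, under-review] -/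
theorem hundredninth_of_inputs (X : Implications109 c₁₈ c₆₄ c₁₀₉) (Z : Implications64 ν μ κ c c₁₈ c₂₈ c₄₅ c₆₄) (Y₁₈ : Implications18 ν μ κ c₁₈)
    (V : Implications45 ν μ κ c₁₃ c₁₄ c₄₃ c₄₄ c₄₅) (A : BookInputs ν) (M : MokInputs μ) (K : KMSWInputs μ κ) :
    c₁₀₉.GKPPSsatoTateGaps ∧ c₁₀₉.LOTeffectiveST8 ∧ c₁₀₉.JanuszewskiSymPadicL ∧ (c₁₀₉.ZhangSymLayers ∧ c₁₀₉.ZhangSelmerTower) :=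
  symPowerVein_of_inputs X Z Y₁₈ V A.published M K

/-! ## Hundred-and-tenth tranche (v4, unit `pub-arthur-down-g43`): THE NOETHER–LEFSCHETZ / BALL-QUOTIENT VEIN, II — NEW rows C282 node `STcupProduct` (⇐ C17-Acta
`Consumers4.BMMball`) with `STcentralRF` / `STbranchedCovers` (⇐ it), C283 `LIPexoticKernels` (⇐ C282 `STbranchedCovers`), C284 `PetersenVanishing` (⇐ C99 `Consumers2.BLMM`),
C285 `LOGpicardRank` (⇐ C99)

Context (C282 – C285 ABSENT from `DOWNSTREAM.md` … `DOWNSTREAM4.md`; NEW rows, block `[g43]` of `DOWNSTREAM4.md`; typed premises reused: row C17-Acta `Consumers4.BMMball` (N. Bergeron –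
J. Millson – C. Moeglin, Acta Math. 216 (2016); tranche 4, `Downstream.lean`: `bmmBall_of_inputs` ⇐ Mok ∧ KMSW's node `StabOrdI` ∧ AMR's unitary theorem, `bmmBall_conditional_form`)
and row C99 `Consumers2.BLMM` (N. Bergeron – Z. Li – J. Millson – C. Moeglin, Invent. Math. 208 (2017); tranche 2: `blmm_of_leaves` ⇐ every leaf of the book ∧ the inner-form
stabilisation, `blmm_conditional_form`) — both in the transitive closure of this file's import; the second-order rows already on these two premises are C161 `BHK`, C162 `BFZcor`
(⇐ C99) and C164 `StoverBall` (⇐ C17-Acta), tranche 4 v5).  Texts under `HOME/pub-arthur-down-g43/primaries/` (`SHA256SUMS`; corpus TeX): `paper-arxiv-2108.12404` (C282, 15 chunks),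
`paper-arxiv-2310.04073` (C283, 22 chunks), `paper-arxiv-1606.06716` (C284, 5 chunks), `paper-arxiv-1607.01324` (C285, 50 chunks); not typed: `nonuse/paper-arxiv-1705.05534` (J. H.
Bruinier – M. Möller, J. Algebraic Geom. 28 (2019)) and four context-only citers; arXiv listings `primaries/arxivabs/abs_*.html` (read-only GET 2026-08-23).  Loci: C282 p0001:L1,
p0002:L3-5, p0003:L7-27, p0004:L1-18, p0010:L39-65, p0011:L1-14, p0012:L8-14, p0013:L5-24, p0015:L7-9; C283 p0001:L1, p0003:L11-14, p0009:L15-27, p0010:L21, p0021:L15, p0022:L49;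
C284 p0001:L1, p0002:L3, p0003:L9-11, p0004:L5-32, p0005:L5; C285 p0001:L1, p0002:L3, p0005:L1, L18-19, p0028:L7-55, L144-147, p0029:L1-2, p0049:L9. -/

/-- NEW rows C282 (Stover – Toledo 2022), C283 (Llosa Isenrich – Py 2025), C284 (Petersen 2019), C285 (Laza – O'Grady 2019) of the census, as an arbitrary assignment of propositions; nothing about the content of a field is assumed. [cite: Arthur2013, downstream register of the cell, hundred-and-tenth tranche (structure only)] -/
structure Consumers110 where
  /-- C282, first statement = a HYPOTHESIS NODE (NEW census row, block `[g43]` of `DOWNSTREAM4.md`; PUBLISHED: Pure Appl. Math. Q. 18 (2022), no. 4, 1771–1797, doi:10.4310/pamq.2022.v18.n4.a15 (Crossref via `lit cite`; the Clemens volume); corpus TeX `paper-arxiv-2108.12404` (arXiv v1 2021-08-27 / v2 2021-12-30; the chunked version is not determined); authors per `primaries/arxivabs/abs_2108.12404.html`: Matthew Stover, Domingo Toledo), p0001:L1 "Residual finiteness for central extensions of lattices in $\mathrm{PU}(n,1)$ and negatively curved projective varieties" — ABSTRACT: p0002:L3 "We study residual finiteness for cyclic central extensions of cocompact arithmetic lattices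 $\Gam < \PU(n,1)$ simple type. We prove that the preimage of $\Gam$ in any connected cover of $\PU(n,1)$, in particular the universal cover, is residually finite. This follows from a more general theorem on residual finiteness of extensions whose characteristic class is contained in the span in $H^2(\Gam, \bbZ)$ of the Poincaré duals to totally geodesic divisors on the ball quotient $\Gam \bs \bbB^n$. For $n \ge 4$, if $\Gam$ is a congruence lattice, we prove residual finiteness of the central extension associated with any element of $H^2(\Gam, \bbZ)$." p0002:L5 "Our main application is to existence of cyclic covers of ball quotients branched over totally geodesic divisors. This gives examples of smooth projective varieties admitting a metric of negative sectional curvature that are not homotopy equivalent to a locally symmetric manifold. The existence of such examples is new for all dimensions $n \ge 4$." — THE NODE is THEOREM 3.3 of §3.4 (the cup-product theorem, with its integral form Corollary 3.5): p0010:L39 "The purpose of this section is to prove the following theorem, whose proof was communicated to us by Nicolas Bergeron." p0010:L41-42 "Theorem 3.3. Let $X = \Gam \bs \bbB^n$ be a compact congruence arithmetic ball quotient of simple type and $\mathrm{SC}^1(X) \subseteq H^2(X, \bbC)$ be the span of the Poincaré duals to the totally geodesic codimension one subvarieties of $X$. Then:" p0010:L44-44 "* For any class $\sig \in \mathrm{SC}^1(X)$,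 there is a congruence cover $p : X^\prime \to X$ so that $p^*(\sig) \in \mathrm{SC}^1(X^\prime)$ is in the image of the cup product map" p0010:L46-48 "\[ c : \bigwedge\nolimits^2 H^1(X^\prime, \bbC) \lra H^2(X^\prime, \bbC). \]" p0010:L50-50 "* If $n \ge 3$, then for every $\phi \in H^{1,1}(X, \bbC)$ we can find a congruence cover $p : X^\prime \to X$ so that $p^*(\phi)$ is contained in the image of $c$." p0010:L52-52 "* If $n \ge 4$, then for all $\phi \in H^2(X, \bbC)$ we can find a congruence cover $p : X^\prime \to X$ so that $p^*(\phi)$ is in the image of $c$." — p0011:L1 "Theorem (thm:ChernInSpan) and Theorem (thm:Cup) combine with Remark (rem:OverQ) to give the following." p0011:L3-4 "Corollary 3.5. Let $X$ be a smooth compact congruence arithmetic ball quotient of simple type with dimension $n \ge 2$. Suppose that $\phi \in H^2(X, \bbZ)$ is one of the following classes:" p0011:L6-6 "* $c_1(X)$;" p0011:L8-8 "* $c_1(D)$ for $D \subset X$ a reduced effective divisor with support a union of totally geodesic subvarieties, or any linear combination of such classes;" p0011:L10-10 "* any class in $H^{1,1}(X, \bbQ) \cap H^2(X, \bbZ)$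 if $n \ge 3$;" p0011:L12-12 "* an arbitrary element of $H^2(X, \bbZ)$ if $n \ge 4$." p0011:L14-14 "Then there is a congruence cover $p : X^\prime \to X$ so that the image of $p^*(\phi)$ in $H^2(X^\prime, \bbQ)$ is contained in the image of the cup product map" [cite: StoverToledo2022CentralExtensions, Thm 3.3 / Cor. 3.5 (chunks p0010:L41-52, p0011:L3-14)] -/
  STcupProduct : Prop
  /-- C282, second statement: THEOREM 1.2, THE TYPED STATEMENT (with THEOREM 1.1 and COROLLARY 1.4, its stated consequences): p0003:L12-13 "Theorem 1.2. Suppose that $\Gam \bs \bbB^n$ is a smooth compact ball quotient with $\Gam$ a congruence arithmetic lattice of simple type. Let $\wt{\Gam}$ be the central extension of $\Gam$ by $\bbZ$ with characteristic class $\phi \in H^2(\Gam, \bbZ)$." p0003:L15-15 "* If $n\ge 4$, then $\wt{\Gam}$ is residually finite." p0003:L17-17 "* If $n <4$, then $\wt{\Gam}$ is residually finite under the following additional assumptions:" p0003:L19-19 "* If $n = 3$, assume that $\phi \in H^{1,1}(\Gam \bs \bbB^3, \bbC) \cap H^2(\Gam \bs \bbB^3, \bbZ)$." p0003:L21-21 "*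 If $n = 2$, assume that $\phi$ is contained in the span of the Poincaré duals to the totally geodesic divisors on $\Gam \bs \bbB^2$." p0003:L23-23 "Moreover, if $\conj{\phi} \in H^2(\Gam, \bbZ / d)$ is the reduction modulo $d$ of any class $\phi$ in $H^2(\Gam, \bbZ)$ satisfying the above hypotheses, then the central extension of $\Gam$ by $\bbZ / d$ associated with $\conj{\phi}$ is residually finite." — THEOREM 1.1: p0003:L7-8 "Theorem 1.1. Let $\Gam < \PU(n,1)$ be a cocompact arithmetic lattice of simple type. Then the preimage of $\Gam$ in $\wt{\PU}(n,1)$ is residually finite. In fact, the preimage of $\Gam$ in any connected cover of $\PU(n,1)$ is residually finite." — COROLLARY 1.4: p0004:L1-2 "Corollary 1.4. Let $M = \Gam \bs \bbB^n$ be a closed complex hyperbolic $n$-manifold with $\Gam$ a congruence arithmetic lattice. If $D \subset M$ is a smooth embedded codimension one totally geodesic subvariety, $\calO(D)$ is the line bundle over $M$ associated with $D$, and $\calO(D)^\times \subset \calO(D)$ is the complement of the zero section, then $\pi_1(\calO(D)^\times)$ is residually finite." [cite: StoverToledo2022CentralExtensions, Thm 1.2 (chunk p0003:L12-23), Thm 1.1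 (p0003:L7-8), Cor. 1.4 (p0004:L1-2)] -/
  STcentralRF : Prop
  /-- C282, third statement: PROPOSITION 5.1 (existence of cyclic covers of congruence arithmetic ball quotients of simple type branched over totally geodesic divisors) with THEOREM 1.5 (the statement row C283 consumes, restated there as its Theorem 4.2): p0013:L5-6 "Proposition 5.1. Fix $d \ge 2$. Let $X = \Gam \bs \bbB^n$ be a smooth compact complex hyperbolic $n$-manifold, $n \ge 2$, with $\Gam$ a congruence arithmetic lattice of simple type. Then we can pass to a congruence cover $X^\prime = \Gam^\prime \bs \bbB^n$ so that $X^\prime$ contains a totally geodesic divisor $D^\prime$ such that:" p0013:L8-8 "* $(X^\prime, D^\prime)$ is a good pair in the sense of Definition (def:goodpair), and consequently" p0013:L10-10 "* there exists a smooth projective variety $Y$ and a cyclic branched cover $f : Y \to X^\prime$ with branch divisor $D^\prime$ and branching of degree $d$ along each irreducible component of $D^\prime$." — THEOREM 1.5: p0004:L8-9 "Theorem 1.5. For all $n \ge 2$, there are $n$-dimensional smooth complex projective varieties admitting a Kähler metric of strongly negative curvature, thus a Riemannian metric of strictly negative sectional curvature, that are not homotopy equivalent to a locally symmetric manifold." p0004:L11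 "Our examples are cyclic branched covers of ball quotients branched over smooth (but possibly disconnected) totally geodesic divisors. Existence of these branched covers follows from Corollary (cor:ComplementRF). The fact that they admit a strongly negatively curved Kähler metric is a theorem of Zheng [Zheng] that generalizes the famous work of Mostow and Siu [MostowSiu]." [cite: StoverToledo2022CentralExtensions, Prop. 5.1 (chunk p0013:L5-10), Thm 1.5 (p0004:L8-9)] -/
  STbranchedCovers : Prop
  /-- C283 (NEW census row, block `[g43]`; PUBLISHED: J. Topol. 18 (2025), no. 1, Paper No. e70013, doi:10.1112/topo.70013 (arXiv journal-ref; Crossref); corpus TeX `paper-arxiv-2310.04073` = arXiv v1 2023-10-06, the only version; authors per `abs_2310.04073.html`: Claudio Llosa Isenrich, Pierre Py), p0001:L1 "Groups with exotic finiteness properties from complex Morse theory" — p0003:L11 "In this work we provide further examples of groups with exotic finiteness properties built from complex geometry. We emphasise that we produce both Kähler and non-Kähler groups. The first result takes as input a new class of hyperbolic Kähler groups constructed by Stover and Toledo [StoTol-21-II]. Their groups arise as fundamental groups of certain compact Kähler manifolds which admit a Kähler metric of negative sectional curvature, but are not homotopy equivalent to any locally symmetric manifold. Combining ideas from [LloPy-22]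 and [StoTol-21-II], we shall prove:" THEOREM 1.1, THE TYPED STATEMENT: p0003:L13-14 "Theorem 1.1. For every $n\geq 2$ there is an $n$-dimensional compact Kähler manifold $Y$ which admits a Kähler metric of negative sectional curvature, is not homotopy equivalent to any locally symmetric manifold and which has the following property. There exists a dense open set $O\subset H^{1}(Y,\R)-\{0\}$ which is invariant by multiplication by nonzero scalars, such that for any homomorphism $\phi: \pi_1(Y)\to \mathbb{Z}$ contained in $O$, the kernel $\ker(\phi)$ is of type $\mathscr{F}_{n-1}$ but not of type ${\rm FP}_n(\mathbb{Q})$." [cite: LlosaIsenrichPy2025ExoticFiniteness, Thm 1.1 (chunk p0003:L13-14)] -/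
  LIPexoticKernels : Prop
  /-- C284 (NEW census row, block `[g43]`; PUBLISHED: Amer. J. Math. 141 (2019), no. 3, 733–736, doi:10.1353/ajm.2019.0014 (Crossref; zbMATH); corpus TeX `paper-arxiv-1606.06716` = arXiv v2 2017-02-16 (its text cites Pandharipande – Yin of July 2016, later than v1 2016-06-21); author per `abs_1606.06716.html`: Dan Petersen), p0001:L1 "A vanishing result for tautological classes on the moduli of K3 surfaces" — ABSTRACT: p0002:L3 "Looijenga's vanishing theorem on the moduli space of curves $\M_g$ says that the tautological ring vanishes above degree $g-2$. We prove an analogous result for the tautological cohomology ring of the moduli space of K3 surfaces." — p0003:L11 "The goal of this note is to prove the analogue of the vanishing part of Looijenga's theorem for the tautological ring of $\F_g$ in cohomology: more precisely, if $\RH^\bullet(\F_g)$ denotes the image of the tautological ring in cohomology, then we prove that $\RH^k(\F_g)=0$ for $k>34$." — THEOREM 2.2, THE TYPED STATEMENT (M_Λ the orthogonal modular variety of Λ-polarized K3 surfaces, of dimension d; d = 19 is F_g): p0004:L14-15 "Theorem 2.2. If $\dim M_\Lambda = d$, $4 \leq d \leq 19$, then $W_k H^k(M_\Lambda,\Q)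 =0$ for $k > 2(d-2)$, where $W_\bullet$ denotes the weight filtration on the mixed Hodge structure on the cohomology of $M_\Lambda$." — with COROLLARY 2.3: p0004:L24-25 "Corollary 2.3. The tautological cohomology ring $\RH^\bullet(\F_g)$ of the moduli space of polarized K3 surfaces vanishes above cohomology degree $34$." p0004:L28 "A tautological class is in particular the class of an algebraic cycle, so it lies in the pure part of the mixed Hodge structure. Thus the vanishing follows from the case $d=19$ of the previous theorem." [cite: Petersen2019K3Vanishing, Thm 2.2 / Cor. 2.3 (chunk p0004:L14-28)] -/
  PetersenVanishing : Prop
  /-- C285 (NEW census row, block `[g43]`; PUBLISHED: Compositio Math. 155 (2019), no. 9, 1655–1710, doi:10.1112/S0010437X19007516 (arXiv DOI field; Crossref); corpus TeX `paper-arxiv-1607.01324` = arXiv v1 2016-07-05, the only version (the chunker drops the TeX macro for K3 from the title); authors per `abs_1607.01324.html`: Radu Laza, Kieran G. O'Grady), p0001:L1 "Birational geometry of the moduli space of quartic  surfaces" [arXiv listing: *Birational geometry of the moduli space of quartic K3 surfaces*] — p0005:L18-19 "In secpicdtower we study the Picard group of of $\cF(N)$, for $N\le 25$. First we compute the Picard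 groups for the D-tower (thmthmrankpic) for $N\le 20$, by applying work of Borcherds, Brunier, and Bergeron. Next we study the quasi-pullback of Borcherds' celebrated automorphic given by two embeddings" — THEOREM 3.1.1, THE TYPED STATEMENT (F_{Λ_N}(Õ(Λ_N)^+) the N-dimensional locally symmetric variety of the D-tower, N ≥ 3; F(19) = quartic K3 surfaces, F(18) = hyperelliptic quartics, F(20) = double EPW sextics modulo duality): p0028:L10 "Theorem 3.1.1." p0028:L12 "The rank of $\Pic(\cF_{\Lambda_N}(\wt{O}(\Lambda_N)^+))$ is equal to" [ρ_N := ⌊(N+6)/8⌋ if N ≡ 1 (mod 2); ⌊(N+2)/6⌋ if N ≡ 0, 6 (mod 8); ⌊(N−4)/6⌋ if N ≡ 2 (mod 8); ⌊(N+8)/6⌋ if N ≡ 4 (mod 8)] p0028:L33 "Explicitly, for $3\le N\le 20$, we obtain:" p0028:L35 "$N$ 3 4 5-10 11 12 13-15 16 17-18 19 20" p0028:L37 "$\rho_N$ 1 2 1 2 3 2 3 2 3 4" — p0028:L40 "If $N$ is odd, the natural map" […] p0028:L48 "is an isomorphism, and hence $\rho_N$ is also the Picard number of $\cF(N)$." [cite: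 LazaOGrady2019QuarticK3, Thm 3.1.1 (chunk p0028:L10-37)] -/
  LOGpicardRank : Prop

variable (ν : Nodes) (μ : Mok2015.Nodes) (κ : KMSW2014.Nodes) (c : Consumers) (c₂ : Consumers2) (c₃ : Consumers3) (c₄ : Consumers4) (c₁₁₀ : Consumers110)

-- Verbatim lines kept out of docstrings by the register's lint (titles and sentences naming a conj., bibliography entries):
-- C282 (`paper-arxiv-2108.12404`) bibliography [Acta] / [Invent]: p0015:L9 "[Acta] Nicolas Bergeron, John Millson, and Colette Moeglin. \newblock The {H}odge conjecture and arithmetic quotients of complex balls. \newblock {\em Acta Math.}, 216(1):1--125, 2016. \newblock URL: \url{https://doi.org/10.1007/s11511-016-0136-2}." / p0015:L7 "[Invent] Nicolas Bergeron, Zhiyuan Li, John Millson, and Colette Moeglin. \newblock The {N}oether-{L}efschetz conjecture and generalizations. \newblock {\em Invent. Math.}, 208(2):501--552, 2017. \newblock URL: \url{https://doi.org/10.1007/s00222-016-0695-z}."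
-- C283 (`paper-arxiv-2310.04073`) bibliography [StoTol-21-II] / [BeMiMo-16]: p0022:L49 "[StoTol-21-II] M.~Stover and D.~Toledo, \emph{{Residual finiteness for central extensions of lattices in ${\rm PU}(n, 1)$ and negatively curved projective varieties}}, Pure Appl. Math. Q. \textbf{18} (2022), no.~4, 1771--1797." / p0021:L15 "[BeMiMo-16] N.~Bergeron, J.~Millson, and C.~Moeglin, \emph{The {H}odge conjecture and arithmetic quotients of complex balls}, Acta Math. \textbf{216} (2016), no.~1, 1--125."
-- C284 (`paper-arxiv-1606.06716`) the definition of the tautological ring (names a conj.): p0003:L9 "We define the tautological ring of $M_\Lambda$ to be the subring of $\CH^\bullet_\Q(M_\Lambda)$ generated by the classes of all Noether–Lefschetz loci. The resulting tautological ring would a priori seem to be smaller than the one defined in [marianopreapandharipande] (which includes certain kappa classes), but Pandharipande and Yin [pandharipandeyin] have recently proved that the two notions in fact agree, as conjectured in [marianopreapandharipande]. The same result has been independently obtained by Bergeron and Li (pers. comm.) for the image of the tautological ring in cohomology."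
-- C284 bibliography [bergeronlimillsonmoeglin]: p0005:L5 "[bergeronlimillsonmoeglin] Nicolas Bergeron, Zhiyuan Li, John Millson, and Colette Moeglin. \newblock {The {N}oether-{L}efschetz conjecture and generalizations}. \newblock To appear, \emph{Invent. Math.} Preprint available at arXiv:1412.3774, 2014."
-- C285 (`paper-arxiv-1607.01324`) abstract (first sentences): p0002:L3 "By work of Looijenga and others, one has a good understanding of the relationship between GIT and Baily-Borel compactifications for the moduli spaces of degree $2$ $K3$ surfaces, cubic fourfolds, and a few other related examples. The similar-looking cases of degree $4$ $K3$ surfaces and double EPW sextics turn out to be much more complicated for arithmetic reasons. In this paper, we refine work of Looijenga to allow us to handle these cases. Specifically, in analogy with the so-called Hassett-Keel program for the moduli space of curves, we study the variation of log canonical models for locally symmetric varieties of Type IV associated to $D$ lattices. In particular, for the dimension $19$ case, we conjecturally obtain a continuous one-parameter interpolation (via a directed MMP) between the GIT and Baily-Borel compactifications for the moduli of degree $4$ $K3$ surfaces."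
-- C285 bibliography [pick3nl]: p0049:L9 "[pick3nl] N.~Bergeron, Z.~Li, J.~Millson, and C.~Moeglin, \emph{The {N}oether-{L}efschetz conjecture and generalizations}, arXiv:1412.3774, 2014."

/-- C282's NODE (THEOREM 3.3 / COROLLARY 3.5) SUPPLIED ⇐ ROW C17-Acta — the places: the introduction: p0003:L27 "The proof of Theorem (thm:MainRF2) begins by using work of Bergeron, Millson, and Moeglin [Acta] to show that for any class satisfying the hypotheses of the theorem, there is a congruence subgroup $\Gam^\prime \le \Gam$ so that the pullback of $\phi$ to $\Gam^\prime \bs \bbB^n$ is in the image of the cup product from $\bigwedge\nolimits^2 H^1(\Gam^\prime \bs \bbB^n, \bbC)$; this is Theorem (thm:Cup). Our previous work [StoverToledo], stated in slightly different language as Theorem (thm:CentralRF1) below, then implies that the associated central extension $\wt{\Gam}$ of $\Gam$ by $\bbZ$ has a two-step nilpotent quotient that is injective on the center of $\wt{\Gam}$. The claims regarding residual finiteness of $\wt{\Gam}$ and $\wt{\Gam}_d$ follow from results in [StoverToledo] that we recall in (sub:residualf) below." — the proof of Theorem 3.3: p0010:L55 "Let $G$ be the $\bbQ$-algebraic group associated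 with $X$ and $\Gam$ as in (ssec:Simple), and suppose that $X$ is a connected component of the Shimura variety $S(K)$. The theorem follows fairly directly from deep structural results on cohomology arising from the theta correspondence; see [Acta] for a precise definition." p0010:L57 "Taking $q=1$ and the appropriate values of $(a,b)$ in [Acta], we see that $H^1(X, \bbC)$ is generated by the classes of theta lifts for all $n \ge 2$, $H^{1,1}(X, \bbC)$ is generated by theta lifts when $n \ge 3$, and all of $H^2(X, \bbC)$ is generated by the theta correspondence for $n \ge 4$. For $n \ge 2$, Kudla and Millson proved that the Poincaré duals to codimension $1$ geodesic subvarieties are contained in the subspace generated by theta lifts and Poincaré duals to special cycles span the subspace generated by theta lifts [KMI, KMII, KM] (also see [Acta])." […] p0010:L65 "Using [Acta], arguing almost verbatim as in the proof of [Acta] (the only change being the degrees of the forms under consideration), we have that $\wt{\sig}$ is in the image of the cup product map" […] — the acknowledgments: p0004:L18 "Profound thanks are due to Nicolas Bergeron, who explained to us how to apply Kudla–Millson theory and his work to prove the results on cup products necessary to apply our previous methods. In particular, the arguments for Theorem (thm:ChernInSpan) and Theorem (thm:Cup) should be attributed to him." — [Acta] = N. Bergeron – J. Millson – C. Moeglin,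 Acta Math. 216 (2016) = row C17-Acta `Consumers4.BMMball` (tranche 4: ⇐ Mok at all ranks ∧ KMSW's node `StabOrdI` ∧ Arancibia – Moeglin – Renard's unitary theorem; the generation of H^1, H^{1,1}, H^2 of congruence ball quotients of simple type by theta lifts for n ≥ 2 / 3 / 4 is the Acta paper's Theorem 1 ff. with (a,b) = (1,0), (1,1), (2,0), (0,2) — bound); Theorem 3.2 (c₁ in the span of totally geodesic divisors: Kudla – Millson theory [KM], [KMI], [KMII], p0003:L25 "Under our hypotheses, $c_1(\Gam \bs \bbB^n)$ is contained in the span of the Poincaré duals to the totally geodesic divisors on $\Gam \bs \bbB^n$; see Theorem (thm:ChernInSpan). The proof uses Kudla–Millson theory [KM], following an analogous argument of Bergeron, Li, Millson, and Moeglin for orthogonal Shimura varieties [Invent]. Thus $c_1(\Gam \bs \bbB^n)$ satisfies the hypotheses of Theorem (thm:MainRF2), and Theorem (thm:MainRF) follows." — [Invent] = row C99 is named for the METHOD, its theorem is not invoked: NOT bound); the authors' earlier paper [StoverToledo] (Michigan Math. J. 2022: the nilpotent-quotient criterion, Theorem 2.12 / 2.16 here), Deligne's and Raghunathan's work on central extensions: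 Arthur-2013-free, absorbed. [cite: StoverToledo2022CentralExtensions, §1 (chunk p0003:L27), proof of Thm 3.3 (chunk p0010:L55-65); BergeronMillsonMoeglin2013, Thm 1 ff. (as [Acta]) (edge as printed)] -/
def E_STcupProduct : Prop := c₄.BMMball → c₁₁₀.STcupProduct

/-- C282's THEOREM 1.2 (hence THEOREM 1.1, COROLLARY 1.4) ⇐ ITS NODE — the proof of Theorem 1.2 (§4): p0012:L8 "By Corollary (cor:ChernCover), we can choose $\Gam^\prime$ to be a congruence subgroup of $\Gam$ such that" […] p0012:L14 "where $X^\prime = \Gam^\prime \bs \bbB^n$. By Theorem (thm:CentralRF1), the extension with group $\wt{\Gam}^\prime$ satisfies condition $N_2$." — and Theorem 1.1 from Theorem 1.2 through Theorem 3.2 (Kudla – Millson); [StoverToledo]'s Theorem (thm:CentralRF1) and residual-finiteness lemmas: Arthur-2013-free, absorbed. [cite: StoverToledo2022CentralExtensions, proof of Thm 1.2 (chunk p0012:L5-14) (edge as printed)] -/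
def E_STcentralRF : Prop := c₁₁₀.STcupProduct → c₁₁₀.STcentralRF

/-- C282's PROPOSITION 5.1 AND THEOREM 1.5 ⇐ ITS NODE — the places: §1: p0004:L6 "Our final application of Theorem (thm:MainRF2) is to the existence of covers of ball quotients branched over totally geodesic divisors, answering a question raised to the second author by Gromov over $40$ years ago. Existence of these covers allows us to prove the following in (sec:Branched)." — the proof of Proposition 5.1: p0013:L13 "Corollary (cor:ChernCover) and Theorem (thm:CentralRF1) imply that condition $N_2$ is satisfied by the central extension of $\Gam$ by $\bbZ$ associated with $\pi_1(\calO(D)^\times)$ as in (subsec:basic). Therefore, by Corollary (cor:existbranch) there is a further finite cover $p : X^\prime \to X$ so that there exists a cyclic $d$-fold branched cover $Y\to X^\prime$, branched over the totally geodesic divisor $D^\prime = p^*(D)$, with $Y$ smooth." — the proof of Theorem 1.5: p0013:L24 "Let $Y$ be one of the smooth projective varieties provided by Proposition (prop:GoodCover). Then $Y$ admits a metric of strongly negative curvature by Theorem (thm:Zheng), so to complete the proof we must show that $Y$ is not homotopy equivalent to a locally symmetric manifold." […] — Corollary 3.5 (= the node's integral form), Theorem 2.12 and Corollary 2.15 (the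 branched-cover criterion from [StoverToledo]), Zheng's Theorem 5.2 [Zheng] (Comm. Anal. Geom. 4 (1996)), Carlson – Toledo, Siu rigidity, Wolf: Arthur-2013-free, absorbed. [cite: StoverToledo2022CentralExtensions, proof of Prop. 5.1 (chunk p0013:L13), proof of Thm 1.5 (chunk p0013:L24) (edge as printed)] -/
def E_STbranchedCovers : Prop := c₁₁₀.STcupProduct → c₁₁₀.STbranchedCovers

/-- C283's THEOREM 1.1 ⇐ ROW C282's PROPOSITION 5.1 / THEOREM 1.5 — the places: §4.1 (the authors' restatement of the input as their Theorem 4.2): p0009:L15 "If $\Gamma$ is of the simplest type, then $X$ admits totally geodesically immersed divisors. Up to passing to a finite cover of $X$, we can find such divisors which are embedded. We will require the following more precise version of this result (see [StoTol-21-II])." […] p0009:L22-23 "Theorem 4.2 ( [StoTol-21-II]). Assume that $\Gamma < {\rm PU}(m,1)$ is a cocompact torsion-free congruence arithmetic lattice of the simplest type and let $X=\Gamma\backslash \mathbb{B}^m_{\mathbb{C}}$. Let $D\subset X$ be a divisor such that $(X,D)$ is a totally geodesic good pair. Let $d\geq 2$. Then there is a finite cover $p:X'\to X$ which admits a cyclic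 $d$-fold ramified cover $Y\to X'$ with ramification locus the totally geodesic divisor $D':=p^{-1}(D)$. The cover $Y$ is a smooth projective variety which admits a metric of negative sectional curvature and is not homotopy equivalent to any locally symmetric manifold." — p0009:L25 "Let us make a few comments on Theorem (thm:StoverToledo). The fact that ramified covers of ball quotients along totally geodesic divisors admit negatively curved Kähler metrics was known prior to [StoTol-21-II] and is due to Zheng [zheng1], who generalized earlier work by Mostow–Siu [MoSi-80]. The key contribution made in [StoTol-21-II] is to show that one can find many arithmetic ball quotients $X$ containing totally geodesic divisors $D$, forming a good pair and such that the integral homology class of $D$ is divisible by some nontrivial integer, thus allowing to build cyclic ramified covers. The new contribution (the divisibility of the homology class $[D]$) relies on deep results on the cohomology of arithmetic groups due to Bergeron, Millson and Moeglin [BeMiMo-16]." — p0009:L27 "Remark 4.3. Arithmeticity of the lattices under consideration appears in two ways in this work. Firstly, through the results on the cohomology of arithmetic groups used in [StoTol-21-II], and secondly through properties of the Albanese map of arithmetic ball quotients [Eys-18, LloPy-22]. In this second appearance, arithmeticity is used in a much more elementary way." — the proof of Theorem 1.1 (§4.2): p0010:L21 "By Lemma (lem:totgeod), there exists a finite congruence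 cover $X_1\to X$ and a divisor $D_1\subset X_1$ such that $(X_1,D_1)$ is a totally geodesic good pair. Theorem (thm:StoverToledo) implies that there is a finite congruence cover $p_2: X_2\to X_1$ which admits a $d$-fold cyclic ramified cover $q: Y_d\to X_2$ with ramification locus the totally geodesic divisor $D_2=p_2^{-1}(D_1)$. The manifold $Y_d$ admits a Kähler metric of negative sectional curvature and does not have the homotopy type of a locally symmetric space." […] — [StoTol-21-II] = M. Stover – D. Toledo, Pure Appl. Math. Q. 18 (2022) = row C282 `STbranchedCovers` (bound); [BeMiMo-16] = row C17-Acta, NAMED by the authors as the source of the divisibility (the sentence quoted), reached through C282 — not bound a second time; Zheng, Mostow – Siu, Eyssidieux [Eys-18], the authors' [LloPy-22] (BNSR invariants, Addendum (add-to-thm:LP-BNSR)), Lemma 4.4 (Euler characteristic): Arthur-2013-free, absorbed.  Theorem 1.2, Corollary 1.3 (which the text obtains from arithmetic ball quotients with b₁ > 0 as well as from the Stover – Toledo manifolds, Corollary 5.2), Theorems 1.4 / 1.5 are not typed. [cite: LlosaIsenrichPy2025ExoticFiniteness, §4.1 Thm 4.2 (chunk p0009:L22-25), proof of Thm 1.1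 (chunk p0010:L21); StoverToledo2022CentralExtensions, Prop. 5.1 / Thm 1.5 (as [StoTol-21-II]) (edge as printed)] -/
def E_LIPexoticKernels : Prop := c₁₁₀.STbranchedCovers → c₁₁₀.LIPexoticKernels

/-- C284's THEOREM 2.2 / COROLLARY 2.3 ⇐ ROW C99 — the places: the proof of Theorem 2.1 (van der Geer – Katsura's vanishing, re-proved): p0004:L5 "Theorem 2.1 (van der Geer–Katsura). If $\dim M_\Lambda = d$, $3 \leq d \leq 19$, then $\lambda^{d-1} =0$ and $\lambda^{d-2} \neq 0$ in $H^\bullet(M_\Lambda,\Q)$." […] p0004:L10 "For $d>3$, the class $\lambda^{d-2}$ multiplied by any Noether–Lefschetz divisor on $M_\Lambda$ vanishes, by the induction hypothesis. But $\lambda$ itself is a linear combination of classes of Noether–Lefschetz divisors [bkps] — more generally, every class in $H^2(M_\Lambda,\Q)$ is in fact a linear combination of Noether–Lefschetz divisors, after [bergeronlimillsonmoeglin]. Thus $\lambda^{d-1}=0$." — the proof of Theorem 2.2: p0004:L21 "Since $k>2(d-2)$, $\beta$ has degree at most $3$. The only nontrivial case is when $\beta \in H^2(M_\Lambda,\Q)$.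 In this case, $\beta$ is a linear combination of Noether–Lefschetz divisors [bergeronlimillsonmoeglin], and $\alpha = \lambda^{d-2}\cdot \beta$ must vanish, as observed in the proof of the previous theorem." — Remark 2.4: p0004:L32 "According to [bergeronlimillsonmoeglin], $H^k(\F_g,\Q)$ is tautological for $k\leq 8$. Therefore the same Hard Lefschetz argument shows more generally that every class in $W_k H^k(\F_g,\Q)$ is tautological for $k \geq 30$." — [bergeronlimillsonmoeglin] = N. Bergeron – Z. Li – J. Millson – C. Moeglin, Invent. Math. 208 (2017) = row C99 `Consumers2.BLMM` (tranche 2: ⇐ every leaf of the book ∧ the inner-form stabilisation; the statement used is the generation of H²(M_Λ, ℚ) by Noether–Lefschetz divisors — bound); [bkps] (λ is a combination of Noether–Lefschetz divisors: Borcherds – Katzarkov – Pantev – Shepherd-Barron), van der Geer – Katsura, Hard Lefschetz for the intersection cohomology of the Baily – Borel compactification [durfee], purity of algebraic cycle classes: Arthur-2013-free, absorbed. [cite: Petersen2019K3Vanishing, proofs of Thms 2.1 / 2.2 (chunk p0004:L10-21), Rem. 2.4 (p0004:L32); BergeronEtAl2016, Thm 1 ff. (as [bergeronlimillsonmoeglin])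 (edge as printed)] -/
def E_PetersenVanishing : Prop := c₂.BLMM → c₁₁₀.PetersenVanishing

/-- C285's THEOREM 3.1.1 ⇐ ROW C99 — the places: the introduction: p0005:L1 "We share with them the main technical tool (beyond standard lattice theory), namely Borcherds' construction ( [borcherds]) of automorphic forms for Type IV domains (and subsequent improvements due to Bruinier [bruinierbook] and Bergeron et al. [pick3nl])." — §3.1: p0028:L7-8 "Let $N\ge 3$. The Picard group of $\cF_{\Lambda_N}(\wt{O}(\Lambda_N)^+)$ is finitely generated, see [ghs-abelianisation]; in the present section we will compute its rank by applying results of Bergeron et al. [pick3nl], and of Bruinier [bruinier]." — the proof of Theorem 3.1.1 (§3.2): p0028:L144 "The work of Borcherds and the refinements of Bruinier [bruinier,bruinierbook] give a recipe for computing the rank of the Picard group for modular varieties of Type IV, by relating this to a dimension computation for vector valued modular forms." p0028:L146 "Proof of thmthmrankpic." p0028:L147 "Let $L$ be an even lattice of signature $(2,N)$. Let $k=1+\frac{N}{2}\in \frac{1}{2}\bZ$. Borcherds has defined a homorphism" […] p0029:L1-2 "from the space of cusp forms of weight $k$ with values in $L$. This morphism is injective if $L$ contains $2$ hyperbolic summands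 (cf. Bruinier). Recent work of Bergeron et al. [pick3nl] establishes that this is in fact an isomorphism. We are interested in the case $L= \Lambda_N$ is a $D$ lattice. Thus thmthmrankpic will follow from the computation of $\dim S_{k,\Lambda_N}$ carried out below (see (dimpicodd) and (dimpiceven))." — and the role of the case N = 10 in the paper: p0028:L54-55 "The fact that the Picard number of $\cF(10)$ is equal to $1$ is particularly relevant for us. It implies that the $\QQ$-Picard group of $\cF(10)$ is generated by $\lambda(10)$, and thus $H_h(10)$ is proportional to $\lambda(10)$. In fact Gritsenko [gritsenko] proved that $H_h(10)=8 \lambda(10)$. That is a key relation for what follows. More generally, we will need to know what are the relations between $\lambda(N)$, $H_n(N)$, $H_h(N)$ and $H_u(N)$. We will derive such" — [pick3nl] = row C99 `Consumers2.BLMM` (the surjectivity of Borcherds' map from vector-valued cusp forms onto Pic ⊗ ℂ modulo λ for lattices of signature (2,N) splitting two hyperbolic planes — bound); Borcherds [borcherds], Bruinier [bruinier, bruinierbook] (injectivity and the dimension formula for S_{k,Λ_N}), Gritsenko – Hulek – Sankaran [ghs-abelianisation] (finite generation), Gritsenko's reflective form (H_h(10) = 8λ(10), which gives the N = 10 consequence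 independently): Arthur-2013-free, absorbed.  The paper's Borcherds relations (Theorems 3.1.2 / 3.1.3), its GIT analysis and its predictions for the Hassett – Keel – Looijenga programme of F(19) are not typed. [cite: LazaOGrady2019QuarticK3, §3.1 (chunk p0028:L7-8), proof of Thm 3.1.1 (chunks p0028:L144-147, p0029:L1-2); BergeronEtAl2016, Thm 1 ff. (as [pick3nl]) (edge as printed)] -/
def E_LOGpicardRank : Prop := c₂.BLMM → c₁₁₀.LOGpicardRank

/-- The hundred-and-tenth tranche of implications (C282: a node supplied from C17-Acta and two edges from it; C283: one edge from C282; C284, C285: one edge each from C99). [cite: StoverToledo2022CentralExtensions, Thms 1.2 / 1.5 / 3.3; LlosaIsenrichPy2025ExoticFiniteness, Thm 1.1; Petersen2019K3Vanishing, Thm 2.2; LazaOGrady2019QuarticK3, Thm 3.1.1 (edges as printed)] -/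
structure Implications110 : Prop where
  stCup : E_STcupProduct c₄ c₁₁₀
  stRF : E_STcentralRF c₁₁₀
  stBr : E_STbranchedCovers c₁₁₀
  lip : E_LIPexoticKernels c₁₁₀
  pet : E_PetersenVanishing c₂ c₁₁₀
  log : E_LOGpicardRank c₂ c₁₁₀

variable {ν μ κ c c₂ c₃ c₄ c₁₁₀}

/-- THE BALL-QUOTIENT LINE OF THE TRANCHE (C282's three statements and C283) GIVEN ROW C17-Acta. [cite: StoverToledo2022CentralExtensions, Thms 1.2 / 1.5 / 3.3; LlosaIsenrichPy2025ExoticFiniteness, Thm 1.1 (bookkeeping proved here)] -/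
theorem stoverToledoLine_of_row (X : Implications110 c₂ c₄ c₁₁₀) (h : c₄.BMMball) :
    c₁₁₀.STcupProduct ∧ c₁₁₀.STcentralRF ∧ c₁₁₀.STbranchedCovers ∧ c₁₁₀.LIPexoticKernels :=
  have n : c₁₁₀.STcupProduct := X.stCup h
  have b : c₁₁₀.STbranchedCovers := X.stBr n
  ⟨n, X.stRF n, b, X.lip b⟩

/-- THE BALL-QUOTIENT LINE FROM MOK's AND KMSW's INPUTS, through tranche 4's `bmmBall_of_inputs` (C17-Acta ⇐ Mok at all ranks ∧ KMSW's supply edge, published leaves and general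
weighted FL ∧ AMR's unitary theorem) — no node of the book, no chapter of KMSW, no sequel. [cite: StoverToledo2022CentralExtensions, Thms 1.2 / 1.5; LlosaIsenrichPy2025ExoticFiniteness, Thm 1.1; BergeronMillsonMoeglin2013, Thm 1 ff. (bookkeeping proved here)] [claim: KalethaMinguezShinWhite2014, under-review] -/
theorem stoverToledoLine_of_inputs (X : Implications110 c₂ c₄ c₁₁₀) (W : Implications4 ν μ κ c c₂ c₃ c₄) (M : MokInputs μ) (K : KMSWInputs μ κ) :
    c₁₁₀.STcupProduct ∧ c₁₁₀.STcentralRF ∧ c₁₁₀.STbranchedCovers ∧ c₁₁₀.LIPexoticKernels :=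
  stoverToledoLine_of_row X (bmmBall_of_inputs W M K)

/-- THE BALL-QUOTIENT LINE IN CONDITIONAL FORM, 2026 (C282 PUBLISHED 2022, C283 PUBLISHED 2025; neither text names Arthur, Mok or KMSW — C283 names [BeMiMo-16] as [read: deep
results on the cohomology of arithmetic groups]): granting Mok's section edges, supplies, published inputs and 2024–2026 preprint layer, KMSW's supply edge and published inputs,
and the identification of the two copies of the general weighted FL (`KMSW2014.E_SameWFL`), the four statements are conditional on the general and the non-standard weighted
fundamental lemmas — exactly the Acta paper's residue (`bmmBall_conditional_form`). [cite: StoverToledo2022CentralExtensions, p0003:L27; LlosaIsenrichPy2025ExoticFiniteness, p0009:L25; BergeronMillsonMoeglin2013, p0002:L7-9 (bookkeeping proved here)] [claim: KalethaMinguezShinWhite2014, under-review] -/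
theorem stoverToledoLine_conditional_form (X : Implications110 c₂ c₄ c₁₁₀) (W : Implications4 ν μ κ c c₂ c₃ c₄) (D3 : KMSW2014.E_SameWFL μ κ)
    (MB : μ.SectionEdges) (MS : μ.SupplyEdges) (MP : μ.PublishedLeaves) (MQ : μ.PreprintLeaves2026) (KS : κ.SupplyEdges) (KP : κ.PublishedLeaves) :
    μ.WFL_general → μ.WFL_nonstandard →
      c₁₁₀.STcupProduct ∧ c₁₁₀.STcentralRF ∧ c₁₁₀.STbranchedCovers ∧ c₁₁₀.LIPexoticKernels :=
  fun h6 h7 => stoverToledoLine_of_row X (bmmBall_conditional_form W D3 MB MS MP MQ KS KP h6 h7)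

/-- THE K3-MODULI LINE OF THE TRANCHE (C284, C285) GIVEN ROW C99. [cite: Petersen2019K3Vanishing, Thm 2.2; LazaOGrady2019QuarticK3, Thm 3.1.1 (bookkeeping proved here)] -/
theorem k3ModuliLine_of_row (X : Implications110 c₂ c₄ c₁₁₀) (h : c₂.BLMM) : c₁₁₀.PetersenVanishing ∧ c₁₁₀.LOGpicardRank :=
  ⟨X.pet h, X.log h⟩

/-- THE K3-MODULI LINE FROM THE BOOK's INPUTS, through tranche 2's `blmm_of_leaves` (C99 ⇐ every leaf of the book, the general weighted FL a second time through the inner-form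
stabilisation). [cite: Petersen2019K3Vanishing, Thm 2.2; LazaOGrady2019QuarticK3, Thm 3.1.1; BergeronEtAl2016, Thms 1, 5 (bookkeeping proved here)] -/
theorem k3ModuliLine_of_leaves (X : Implications110 c₂ c₄ c₁₁₀) (I : Implications ν μ κ c) (J : Implications2 ν μ κ c c₂) (A : BookInputs ν) :
    c₁₁₀.PetersenVanishing ∧ c₁₁₀.LOGpicardRank :=
  k3ModuliLine_of_row X (blmm_of_leaves I J A)

/-- THE K3-MODULI LINE IN CONDITIONAL FORM, 2026 (C284 PUBLISHED 2019, C285 PUBLISHED 2019; neither text names Arthur; C99's own sentence of 2014–2017 is [read: our results are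
now unconditional]): granting the book's derivations, the supply edges and every PUBLISHED input (Moeglin – Waldspurger's stabilisation included), both statements are conditional on
the 2024–2026 preprint layer and on the two unwritten weighted fundamental lemmas — exactly C99's residue (`blmm_conditional_form`), as for C161 / C162. [cite: Petersen2019K3Vanishing, p0004:L21; LazaOGrady2019QuarticK3, p0029:L1; BergeronEtAl2016, p0005:L17 (bookkeeping proved here)] -/
theorem k3ModuliLine_conditional_form (X : Implications110 c₂ c₄ c₁₁₀) (I : Implications ν μ κ c) (J : Implications2 ν μ κ c c₂) (B : ν.BookEdges)
    (S : ν.SupplyEdges) (P : ν.PublishedLeaves) :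
    ν.PreprintLeaves2026 → ν.WFL_general → ν.WFL_nonstandard → c₁₁₀.PetersenVanishing ∧ c₁₁₀.LOGpicardRank :=
  fun hQ h6 h7 => k3ModuliLine_of_row X (blmm_conditional_form I J B S P hQ h6 h7)

/-- THE WHOLE HUNDRED-AND-TENTH TRANCHE FROM THE INPUTS OF THE THREE DAGs AND THE EARLIER TRANCHES' EDGES (the ball-quotient line from Mok ∧ KMSW through C17-Acta, the
K3-moduli line from the book through C99). [cite: StoverToledo2022CentralExtensions, Thms 1.2 / 1.5 / 3.3; LlosaIsenrichPy2025ExoticFiniteness, Thm 1.1; Petersen2019K3Vanishing, Thm 2.2; LazaOGrady2019QuarticK3, Thm 3.1.1 (bookkeeping proved here)] [claim: KalethaMinguezShinWhite2014, under-review] -/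
theorem hundredtenth_of_inputs (X : Implications110 c₂ c₄ c₁₁₀) (I : Implications ν μ κ c) (J : Implications2 ν μ κ c c₂) (W : Implications4 ν μ κ c c₂ c₃ c₄)
    (A : BookInputs ν) (M : MokInputs μ) (K : KMSWInputs μ κ) :
    (c₁₁₀.STcupProduct ∧ c₁₁₀.STcentralRF ∧ c₁₁₀.STbranchedCovers ∧ c₁₁₀.LIPexoticKernels) ∧ (c₁₁₀.PetersenVanishing ∧ c₁₁₀.LOGpicardRank) :=
  ⟨stoverToledoLine_of_inputs X W M K, k3ModuliLine_of_leaves X I J A⟩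

end Downstream

end Literature.NumberTheory.Automorphic.Arthur2013
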